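import Literature.NumberTheory.EllipticCurves.BhargavaSkinnerZhang2014.Pieces
import Literature.NumberTheory.EllipticCurves.PAdicHeightsProofs
import Literature.NumberTheory.EllipticCurves.PadicLogNormProofs
import Literature.NumberTheory.EllipticCurves.PadicPthPowerCriterionProofs
import Literature.NumberTheory.EllipticCurves.TateParameterPrimeTorsion
import Literature.NumberTheory.EllipticCurves.LocalTorsionMultiplicativeProofs
import Literature.NumberTheory.EllipticCurves.GlobalMinimalModelProofs
import Literature.NumberTheory.EllipticCurves.HeightDensityFullBSDOffS
import Literature.NumberTheory.EllipticCurves.BSDSelmerSkinnerThmBProofs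
import Literature.NumberTheory.EllipticCurves.LeadingTermBSZReductionTypesProofs
import Literature.NumberTheory.EllipticCurves.HeightFamilyProofs
import Literature.NumberTheory.EllipticCurves.HeightDensityThinFamilies
import Mathlib.NumberTheory.Padics.PadicVal.Basic
import Literature.NumberTheory.EllipticCurves.TateJSecondOrderProofs
import Literature.NumberTheory.EllipticCurves.LeadingTermBSZSplitOrdDensityProofs
import Literature.NumberTheory.EllipticCurves.LeadingTermBSZSplitReductionProofs
import Literature.NumberTheory.EllipticCurves.ExceptionalPrimesDensityTransfer
import Literature.NumberTheory.EllipticCurves.TwoMultiplicativePrimesAwayFromPDensity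
import Literature.NumberTheory.EllipticCurves.PadicValFiveCongruenceProofs
import Literature.NumberTheory.EllipticCurves.BhargavaSkinner2014.SelmerLocalEquidistribution
import Literature.NumberTheory.EllipticCurves.BhargavaShankar5Selmer2013.FiveSelmerAverage
import Literature.NumberTheory.EllipticCurves.BhargavaSkinnerZhang2014.RootNumberTwistSubfamily
import Literature.NumberTheory.EllipticCurves.LeadingTermBSZAssemblyProofs
import Literature.NumberTheory.EllipticCurves.LeadingTermBSZCRankAllowancesProofs
import Literature.NumberTheory.EllipticCurves.LeadingTermBSZMuDiffProofs
import Literature.NumberTheory.EllipticCurves.LocalPointsPlaceTransportProofs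
import HarnessLib

/-!
# The pieces `T = S₁'(5)`, `R = T₅`, `P = SP'_K` read on the Tate parameter: `q_E = 5^k · u`
# (Bhargava–Skinner–Zhang, proof of Lemma 18; the `5`-adic seam of the cell book, G9)

Theorems only: **no definition, no named fact** (D-0014 / D-0026, debt `+0`).

Source: M. Bhargava, C. Skinner, W. Zhang, *A majority of elliptic curves over `ℚ` satisfy the
Birch and Swinnerton-Dyer conjecture*, arXiv:1407.1826v2 (2014), proof of Lemma 18 (pp. 8–9; held
text `paper:arxiv-1407.1826` p0008 L104 – p0009 L21), verbatim: "Let `E = E_{A,B}` be an elliptic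
curve with multiplicative reduction at `p`, and let `q ∈ pℤ_p` be the Tate period of `E`; … The
`𝓛`-invariant of `E_{A,B}` is defined by `𝓛(E_{A,B}) = log_p q / ord_p(q)` … we see that
`k = ord_p(q)` and that if `p ∤ k`, then `𝓛(E_{A,B}) ∈ pℤ_p^×` if and only if `log_p q ∈ pℤ_p^×`.
Write `q = p^k ω u` with `ω ∈ μ_{p-1}` and `u ∈ 1 + pℤ_p`. Then `log_p(q) = log_p(u)`, so
`log_p q ∈ pℤ_p^×` if and only if `u ∉ 1 + p²ℤ_p`", together with the bundle `pub-bsdpct`'s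
Lemma 4.3 (the Tate-fifth-power set: "`E(ℚ₅)[5] ≠ 0 ⟺ q_E ∈ (ℚ₅^×)⁵`", tree
`prime_torsion_ne_zero_iff_exists_pow_eq_tateParameter`, below the named fact
`tateUniformization_points` = Silverman ATAEC Thm. V.5.3).

## What this file does (cell book `cells/density/C0-SPEC.md`, gap G9 "composition")

For an elliptic `W/ℚ` split multiplicative at an odd prime `p` with Tate parameter datum `D`
(`WeierstrassCurve.TateParameterData`), write `q = D.q = p^k · u` with `u ∈ ℤ_pˣ`
(`TateParameterData.exists_eq_pow_mul_of_isUnit`; `k = ord_p q`). In place of the source's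
`ω u` (Teichmüller factor times principal unit) the criteria are stated through `u^{p-1}`, whose
class modulo `p²` is that of the principal-unit part (`u^{p-1} ≡ 1 (mod p²) ⟺ u ∈ μ_{p-1}·(1 + p²ℤ_p)`):

* `TateParameterData.valuation_lInvariant_eq_one_iff` — **for `p ∤ k`: `ord_p 𝓛(E) = 1 ⟺
  u^{p-1} ≢ 1 (mod p²)`** (the source's "`𝓛(E_{A,B}) ∈ pℤ_p^×` iff `u ∉ 1 + p²ℤ_p`"), composed
  from the tree's `norm_padicLog_eq_norm_unitPart_pow_sub_one` (`‖log_p q‖ = ‖u^{p-1} - 1‖`,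
  `PadicLogNormProofs`) and a model-free form of `valuation_lInvariant_eq_valuation_padicLog_of_not_dvd`;
* `forall_prime_smul_eq_zero_iff_of_eq_pow_mul` — **`E(ℚ_p)[p] = 0 ⟺ ¬(p ∣ k ∧ u^{p-1} ≡ 1
  (mod p²))`**, composed from `forall_prime_smul_eq_zero_iff_not_exists_pow_eq_tateParameter`
  (`TateParameterPrimeTorsion`, below `tateUniformization_points`) and
  `Padic.exists_pow_prime_eq_iff_of_eq_pow_mul` (`PadicPthPowerCriterionProofs`);

and, at `p = 5` for the curves `E_{A,B} : y² = x³ + Ax + B` of the height family with `5 ∤ A`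
(so `k = ord₅ q = ord₅(4A³ + 27B²)`, `Pieces.valuation_q_eq_padicValInt_disc`, from the tree's
`valuation_tateJ_holds` and `j(E_{A,B}) = 6912A³/(4A³ + 27B²)`), the three pieces of
`bsz_rankLeOne_cRank_of_pieces` instantiated in `Pieces.lean` are decided by the reduction type at
`5`, `k` and `u⁴ mod 25`:

* `T`: `Pieces.S₁'_iff_of_hasSplitMultiplicativeReductionAtPrime` (split: `S₁' ⟺ 5 ∤ k ∧ u⁴ ≢ 1
  (mod 25)`), `Pieces.S₁'_iff_of_not_hasSplitMultiplicativeReductionAtPrime` (non-split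
  multiplicative: `S₁' ⟺ 5 ∤ k`), `Pieces.S₁'_of_not_dvd_disc` (good reduction at `5`: `S₁'`);
* `E(ℚ₅)[5] = 0`: `Pieces.locallyTorsionFree_iff_of_hasSplitMultiplicativeReductionAtPrime`
  (split: `⟺ ¬(5 ∣ k ∧ u⁴ ≡ 1 (mod 25))`), `Pieces.locallyTorsionFree_of_not_hasSplit…` /
  `Pieces.locallyTorsionFree_of_not_dvd_padicValInt` (non-split, resp. `5 ∤ k`: automatic — the
  tree's `LocalTorsionMult.localTorsion_eq_zero_of_mult_of_smul_eq` on a global minimal model,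
  `WeierstrassCurve.hasGlobalMinimalModel_rat_holds`);
* `R`: `Pieces.T₅_iff` (`T₅ ⟺ 5 ∤ A ∧ split ∧ 5 ∣ k ∧ u⁴ ≡ 1 (mod 25)`);
* `P`: `Pieces.SP'_iff` (`SP'_K ⟺ 5 ∤ A ∧ 5 ∣ 4A³ + 27B² ∧ k ≤ K ∧ (non-split ∧ 5 ∣ k, or split
  with exactly one of `5 ∣ k`, `u⁴ ≡ 1 (mod 25)`)`).

What is NOT here (the remaining half of the seam, for the density counts `hT` / `hR` / `hPd`):
the class of `u` modulo `25` as a function of `(A, B)` — `u ≡ J + 744·5^k·J² (mod 25)` with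
`J = (4A³ + 27B²)/(5^k · 6912A³) = 1/(5^k j)`, from the tree's `norm_inv_tateJ_sub_add_le`
(`TateJSecondOrderProofs`) — and the residue counts themselves (`hasHeightDensity_residues`).

HONEST FRAMING: elementary `p`-adic bookkeeping for a density count assembled from published
theorems and labelled preprint claims; nothing is booked, no density number, RESIDUAL-MAP mark,
tier or status word moves by this file.

## References

* [BhargavaSkinnerZhang2014] M. Bhargava, C. Skinner, W. Zhang, arXiv:1407.1826v2 (2014): proof of
  Lemma 18 (pp. 8–9), §3.1 (p. 8), proof of Cor. 26 (pp. 11–12).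
* [MazurTateTeitelbaum1986Invent] B. Mazur, J. Tate, J. Teitelbaum, Invent. Math. 84 (1986), §II.1.
* [SilvermanATAEC1994] J. H. Silverman, *Advanced Topics in the Arithmetic of Elliptic Curves*,
  GTM 151 (1994): Thm. V.3.1, Lemma V.5.1, Thm. V.5.3.
* [Serre1973] J.-P. Serre, *A Course in Arithmetic*, GTM 7 (1973): Ch. II §3.
* [SilvermanAEC2009] J. H. Silverman, *The Arithmetic of Elliptic Curves*, 2nd ed. (2009): VII.6.1,
  VIII.8 Cor. 8.3.

## Parts 2–3 (appended). The density side of `bsz_rankLeOne_cRank_of_pieces` on the pieces —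
drafted as the modules `BhargavaSkinnerZhang2014/PiecesDensityProofs` (Part 2) and
`BhargavaSkinnerZhang2014/PiecesResiduePresentationProofs` (Part 3) — is APPENDED to this module so
that it lands in one verification behind the build lane (cell book `cells/density/C0-SPEC.md`
v0.22; the BSD-DENSITY sprint's K1 deadline). Declaration names are unchanged by the merge; Part 1
(the `5`-adic criteria) is byte-identical to the accepted proposal p378313.

## Part 2 — Bhargava–Skinner–Zhang, Lemma 18 / proof of Cor. 26 as HEIGHT DENSITIES of the pieces
## `T = S₀(5) ∩ S₁'(5)` (`μ = 747265625/953369043`), `R = T₅` (`μ = 78125/3813476172`) and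
## `P = SP'_K` (`μ ≥ 20546875/1271158724 - 10⁻⁶`, `K ≥ 8`), and `¬W₅` (density `0`, modulo Duke)
## — the binders `hT`, `hR`, `hPd`, `hW` of `bsz_rankLeOne_cRank_of_pieces` on `Pieces.S₁'`,
## `Pieces.T₅`, `Pieces.SP' K`, `Pieces.W₅`

Theorems only: no definition, no named fact (D-0014 / D-0026, debt `+0`).

Source: M. Bhargava, C. Skinner, W. Zhang, *A majority of elliptic curves over `ℚ` satisfy the Birch
and Swinnerton-Dyer conjecture*, arXiv:1407.1826v2 (2014), Lemma 18 (p. 8, held text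
`paper:arxiv-1407.1826` p0008 L72–L74) and its proof (p. 9): "The `p`-adic densities of `S₀(5)` and
`S₁'(5)` are given by: (a) `μ(S₀(5)) = …`; (b) `μ(S₁'(5)) = …`", "`μ(S₁'(5)) = (μ₅(Σ₅^g) + μ₅(Σ₅^ns)
+ μ₅(Σ₅^spl)) · (1 - 5⁻¹⁰)⁻¹`" — with the residue count of the proof corrected in the tree
(`bsz_lemma18_card_residues_eq`: `2(p-1)²` for the printed `(2p-1)(p-1)`), so that the value is
`(98/125 - 18/125 · 4/(5⁵-1))·(1-5⁻¹⁰)⁻¹ = 747265625/953369043 = 0.78381…` (`bsz_mu_S_one_prime_five`),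
the constant of the binder `hT` of the tree's theorem of record `bsz_rankLeOne_cRank_of_pieces`.

### What this file proves (cell book `cells/density/C0-SPEC.md`, G8 / G10; binders `hT`, `hR`, `hPd`, `hW`)

* `Pieces.S₁'_iff_residues` — **on the height family, `E_{A,B} ∈ S₁'(5)` iff `(A, B) ∈ Σ₅^g ∪ Σ₅^ns ∪
  Σ₅^spl`** (residue sets): good reduction (`5 ∤ A`, `5 ∤ 4A³+27B²`), or non-split (`A ≡ 2`,
  `B ≡ ±2`) with `5 ∤ k`, or split (`A ≡ 3`, `B ≡ ±1`) with `5 ∤ k` and the `𝓛`-unit condition — by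
  `Pieces.S₁'_iff_of_hasSplitMultiplicativeReductionAtPrime` (the `𝓛`-clause on `q = 5^k·u`),
  `sq_dvd_tateUnit_pow_sub_one_iff` (`u⁴ mod 25` from `(A, B)`) and the reduction-type residues
  (`hasSplitMultiplicativeReductionAtPrime_five_shortWeierstrass_iff`,
  `hasMultiplicative_not_split_five_shortWeierstrass_iff`).
* `Pieces.hasHeightDensity_S₁'` — **`HasHeightDensity Pieces.S₁' (747265625/953369043)`**: the
  three residue densities `hasHeightDensity_sigma_good_five` (`LeadingTermBSZLocalDensityProofs`),
  `hasHeightDensity_sigma_ns_five` (`LeadingTermBSZNonsplitDensityProofs`) and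
  `hasHeightDensity_sigma_spl_five` (`LeadingTermBSZSplitOrdDensityProofs`) added over the disjoint
  union.
* `Pieces.hT_pieces` — the binder `hT` of `bsz_rankLeOne_cRank_of_pieces` for `T := Pieces.S₁'`,
  letter for letter: `∀ η > 0, ∀ᶠ X, (747265625/953369043 - η)·#{H < X} ≤ #{H < X, E_{A,B} ∈ S₁'(5)}`.
* `Pieces.T₅_iff_residues` — on the height family and below the named fact `tateUniformization_points`
  (Tate's uniformisation, via `Pieces.T₅_iff`): `E_{A,B} ∈ T₅` iff `A ≡ 3`, `B ≡ ±1 (mod 5)`,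
  `5 ∣ k` and `tateUnitResidue(5^k, A, (4A³+27B²)/5^k)⁴ ≡ 1 (mod 25)` (the Tate-fifth-power residue
  set); `Pieces.hasHeightDensity_T₅` — **`HasHeightDensity Pieces.T₅ (78125/3813476172)`**
  (`hasHeightDensity_tateFifthPower_residues_five`); `Pieces.hR_pieces` — the binder `hR`, letter
  for letter.
* `Pieces.SP'_iff_residues` — on the height family and below `tateUniformization_points` (via
  `Pieces.SP'_iff`): `E_{A,B} ∈ SP'_K` iff [`A ≡ 2`, `B ≡ ±2`, `5 ∣ k` (non-split), or `A ≡ 3`,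
  `B ≡ ±1` with exactly one of `5 ∣ k`, `tateUnitResidue(5^k, A, (4A³+27B²)/5^k)⁴ ≡ 1 (mod 25)`
  (split, outside `S₁'(5)`, `E(ℚ₅)[5] = 0`)] and `k ≤ K`; `Pieces.hPd_pieces` — the binder `hPd` for
  `P := Pieces.SP' K`, `8 ≤ K`, letter for letter: `∀ η > 0, ∀ᶠ X, (20546875/1271158724 - 1/1000000
  - η)·#{H < X} ≤ #{H < X, E_{A,B} ∈ SP'_K}` — the residue set has height density
  `20546875/1271158724` (`hasHeightDensity_SPprime_residues_five`) and differs from `SP'_K` inside the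
  tail `{A ≡ 2, 3; 5^{K+1} ∣ 4A³+27B²}` of height density `≤ 10⁻⁶` (`hasHeightDensity_mult_tail_five`,
  `mult_tail_density_le`).

* `Pieces.hT_trunc_pieces` / `Pieces.hR_trunc_pieces (hTate)` (`8 ≤ K`) — the same two binders on the
  truncations `T_K = Pieces.S₁'Trunc K`, `R_K = Pieces.T₅Trunc K` with the allowance `10⁻⁶` (C0-SPEC G8:
  finite `5`-adic condition sets for the finite-union-of-large-families inputs); `hT_trunc_pieces'` /
  `hR_trunc_pieces'` (`9 ≤ K`) with the sharper allowance `10⁻⁷` (`mult_tail_density_le_of_nine_le`).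

* `Pieces.hW_pieces (hD : Duke1997_exceptionalPrimes_densityZero)` — the binder `hW` for `W := Pieces.W₅`,
  letter for letter (`#{H < X, ¬ W₅} ≤ η·#{H < X}` eventually): Duke's surjectivity off density `0`
  (`heightDensityGE_noExceptionalPrime_of_duke`) ∧ Lemma 20's two primes (`heightDensityGE_hram₂_five`).

The `T`-side is below NO named fact; the `R`- and `P`-sides are below `tateUniformization_points`
only (as the binder `hker` already is); `hW` is below Duke's fact only (as the capstone's `hDuke`).
HONEST FRAMING: a density count assembled from the tree's kernel theorems; no RESIDUAL-MAP mark,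
tier or status word moves by this file; the class theorems ON `T` (`h9`, `h13T`, …) are elsewhere.

### References

* [BhargavaSkinnerZhang2014] M. Bhargava, C. Skinner, W. Zhang, arXiv:1407.1826v2 (2014): Lemma 18
  and its proof (pp. 8–9), §3.1 (p. 8), proof of Cor. 26 (pp. 11–12).
* [BhargavaSkinner2014] M. Bhargava, C. Skinner, *A positive proportion of elliptic curves over `ℚ`
  have rank one*, J. Ramanujan Math. Soc. 29 (2014): Thm 7 (ii), Lemma 16.
* [Duke1997] W. Duke, *Elliptic curves with no exceptional primes*, C. R. Acad. Sci. Paris 325 (1997):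
  Thm. 1 (p. 815) — the named fact `Duke1997_exceptionalPrimes_densityZero` (hypothesis of `hW_pieces`).
* [SilvermanATAEC1994] J. H. Silverman, *Advanced Topics in the Arithmetic of Elliptic Curves*,
  GTM 151 (1994): Thm. V.3.1, Thm. V.5.3.

## Part 3 (merged module). The second half below was drafted as a separate module
`BhargavaSkinnerZhang2014/PiecesResiduePresentationProofs`; it is merged into this one so that the
density side of `bsz_rankLeOne_cRank_of_pieces` lands in ONE module behind the build lane (cell book
`cells/density/C0-SPEC.md` v0.22). Declaration names are unchanged by the merge.

## Part 3 — The truncated pieces `T_K = S₁'Trunc K`, `R_K = T₅Trunc K`, `P = SP' K` are `5`-adic condition sets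
### modulo `5^{K+2}`; `T_K` and the multiplicative tail are large congruence families; the binder `h13T`
### of `bsz_rankLeOne_cRank_of_pieces` for the FULL `T = S₁'(5)` from A330; the density side
### assembled: `bsz_rankLeOne_cRank` on the pieces MODULO the class theorems and the named facts

Theorems and ONE definition with a body (`Pieces.residueFamily m Q : CongruenceFamily`); no named
fact (D-0014 / D-0026, debt `+0`).

Bhargava–Skinner–Zhang (arXiv:1407.1826v2) define `S₀(5)`, `S₁'(5)`, `S₁(5)` "by congruence
conditions" (§3.1–3.2, p. 8) and count them class by class modulo `p^{k+2}` (proof of Lemma 18, p. 9: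
"given `A` modulo `p^{k+2}` … residue classes for `B` modulo `p^{k+2}` … such that `ord_p(Δ(A,B)) = k`
and `Δ(A,B)/p^k ∉ S_k (mod p²)`"); Bhargava–Skinner (J. Ramanujan Math. Soc. 29 (2014), Prop. 12 and
the proof of Lemma 16) consume such sets as finite unions of `ν`-adic discs `W = (a₀, b₀) + 5^m ℤ₅²`,
each "the corresponding (large) family `F(W)`". This file proves, for the tree's truncated pieces
(`BhargavaSkinnerZhang2014/Pieces.lean`; their residue descriptions `Pieces.S₁'_iff_residues`,
`T₅_iff_residues`, `SP'_iff_residues` of Part 1 above; the congruence invariance of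
`ord₅` and of `Δ'/5^k mod 25` of `PadicValFiveCongruenceProofs.lean`):

* `Pieces.S₁'Trunc_iff_of_modEq`, `Pieces.T₅Trunc_iff_of_modEq` (below `tateUniformization_points`),
  `Pieces.SP'_iff_of_modEq` (idem) — on the height family, membership in `T_K`, `R_K`, `SP'_K` only
  depends on `(A, B)` modulo `5^{K+2}`;
* `Pieces.exists_residues_S₁'Trunc` / `_T₅Trunc` / `_SP'` — hence each is, on the height family, the
  set `{(A, B) mod 5^{K+2} ∈ R}` for a finite set `R` of residue pairs all of whose integer lifts
  satisfy `5 ∤ a` and `5^{K+2} ∤ 4a³ + 27b²` — LETTER FOR LETTER the hypotheses `R`, `hRa`, `hRΔ`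
  (`m = K + 2`) of A329's `thm7_selmerResKer_equidistributed.sum_card_selmerResKer_sub_one_le_residues`
  (the binder `hlocP` of `bsz_rankLeOne_cRank_of_pieces` on `P = SP'_K`);
* `Pieces.residueFamily m Q` — the `CongruenceFamily` cut out at `5` (exponent `m`) by a predicate `Q`
  (no condition elsewhere); `mem_residueFamily_iff` (`Mem ↔ IsInHeightFamily ∧ Q` for `Q` a congruence
  condition mod `5^m`), `isLarge_residueFamily` (large once it contains a disc `(a₀, b₀) + 5^m ℤ₅²`,
  `5 ∤ a₀`: `isLarge_discFamily`); instances: `T_K` (`m = K + 2`, disc `(1, 0)`) and the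
  multiplicative tail `{A ≡ 2, 3; 5^{K+1} ∣ 4A³+27B²}` (`m = K + 1`, disc `(-3, 2)`);
* **`Pieces.h13T_trunc`**, `Pieces.h13_multTail` — A330 (`thm31_heightAverageOn_card_selmerFive_le_six
  .sum_card_selmerFive_le`) on those two large families; and **`Pieces.h13T_pieces (h31 : A330)`** —
  the binder `h13T` of `bsz_rankLeOne_cRank_of_pieces` for the FULL `T := Pieces.S₁'` (which is NOT a
  congruence family: `5 ∤ k` at every level `k`): `T ⊆ T_K ∪ tail_K`, A330 on both, and the tail's
  height density `→ 0` against `μ(S₁') > 0` (`hasHeightDensity_mult_tail_five`, `hT_pieces`).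

* `Pieces.exists_twistSubfamily_S₁'Trunc (h16 : A328) (K)` / `Pieces.exists_twistSubfamily_T₅Trunc
  (h16) (hTate) (hK : 8 ≤ K)` — the binders `hUT`/`hU`/`hUflip`/`hκU` (on `T := S₁'Trunc K`) and
  `hU₀R`/`hU₀`/`hU₀flip`/`hκU₀` (on `R := T₅Trunc K`) of `bsz_rankLeOne_cRank_of_pieces` from the named
  fact A328 (`thm16_exists_rootNumber_twist_subfamily_of_twistStable.exists_subfamily`) on the large,
  twist-stable congruence families `T_K`, `R_K` (`isLarge_residueFamily_T₅Trunc`: a member exists by the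
  positive lower density `hR_trunc_pieces`).

* `Pieces.exists_twistSubfamily_S₁' (h16)` / `Pieces.exists_twistSubfamily_T₅ (h16) (hTate)` — the same
  four binders for the FULL pieces `T := S₁'`, `R := T₅` with `κ = .5501 - 10⁻⁶` (for the parametrised
  assembly `heightDensityGE_satisfiesBSDRankLeOne_of_resPieces`): `U ⊆ T₉`, `U₀ ⊆ R₁₆` and the tails are
  negligible against `μ(S₁')`, `μ(T₅)`.

* **`Pieces.exists_twistSubfamily_T₅Trunc_sum_le (h16d : A331) (h31 : A330) (hTate) (hK)`** /
  **`exists_twistSubfamily_T₅_sum_le (h16d) (h31) (hTate)`** — the SAME `U₀` with `hU₀R`/`hU₀`/`hU₀flip`/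
  `hκU₀` AND **`h13U₀`** (cell book G2): the sharpened fact A331
  (`thm16_exists_disjoint_rootNumber_twist_subfamily_of_twistStable`, pieces pairwise disjoint as
  constructed in [BS5] §5) + A330's `sum_card_selmerFive_le_of_disjoint`; on `R_K` (κ = .5501) and on the
  full `R = T₅` (κ = .5501 - 10⁻⁶).
* **`Pieces.hlocP_pieces (h7 : A329) (h31 : A330) (hTate) (K) (hv : 5 ∈ v)`** — the binder `hlocP` of
  `bsz_rankLeOne_cRank_of_pieces` for `P := SP' K`, `Z := Pieces.Z v`, LETTER FOR LETTER: `exists_residues_SP'`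
  + `SP'.locallyTorsionFree` transported to `ℚ_v` (`natCard_ker_nsmul_adicCompletion_eq_one_of_forall_padic`)
  + A329's `….sum_card_selmerResKer_sub_one_le_residues_of_avg`.

* **`Pieces.densitySide (hTate) (hD) (h16d : A331) (h7 : A329) (h31 : A330) (hK : 8 ≤ K) (hv)`** — ALL of
  the above in one `∃ U U₀, …` for the FULL instantiation (`hUT … hW`, fifteen conjuncts), for D2.

* **`Pieces.heightDensityGE_satisfiesBSDRankLeOne_cRank (hGZK) (hDD) (hTate) (hD) (h16d) (h7) (h31)
  (hK) (hv) (h5) (h9) (hker) (hKim) (hWtors)`** — THE CAPSTONE OF THE DENSITY SIDE: the theorem of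
  record `bsz_rankLeOne_cRank_of_pieces` (`HeightDensityGE SatisfiesBSDRankLeOne c_rank`,
  `c_rank = 3059480216411717/4576171406400000`) instantiated on `S₀ := Pieces.S₀`, `T := S₁'`, `R := T₅`,
  `P := SP' K`, `S₁ := S₁Cond`, `W := W₅`, `Z := Z v`, with EVERY counting / density binder (group (B):
  `h13T h13U₀ hlocP hT hκU hR hκU₀ hPd hν hW` and the structural `hTS₀ … hU₀flip`) DISCHARGED — `densitySide`
  + `bsz_mu_diff_inter_le` (`hν`, via `S₁Cond_iff_of_ne_zero`) + the allowance form
  `bsz_rankLeOne_cRank_of_pieces_full` (`κ' = .5501 − 10⁻⁶`, `LeadingTermBSZCRankAllowancesProofs`) —,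
  leaving as hypotheses exactly: the named facts `hGZK` (A18), `hDD`, `hTate` (A230), `hD` (Duke), `h16d`
  (A331), `h7` (A329), `h31` (A330), and the five per-curve CLASS-THEOREM binders `h5` (on `S₀ ∩ W₅`),
  `h9` (on `S₁' ∩ S₁Cond ∩ W₅`), `hker` (on `SP' K`), `hKim` (on `SP' K ∩ W₅`), `hWtors` (on `W₅`) in the
  shapes of `PiecesClassTheoremsProofs` (`hker_pieces hv K`, `hWtors_pieces` unconditional; `h9_pieces`
  below A322 / A326 / A24; `h5` = good-ordinary leg + `h5_pieces_multiplicative`; `hKim` ANONYMOUS — cell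
  book G3). D2's `bsz_rankLeOne_cRank_of_facts` is this theorem composed with those five.

HONEST FRAMING: bookkeeping between kernel theorems and the named facts A328 / A329 / A330 / A331 as
their consumers want them; no density, mark or tier moves here. Cell book `cells/density/C0-SPEC.md` (G8, and
§2 rows `h13T`, `hlocP`).

#### References

* M. Bhargava, C. Skinner, W. Zhang, arXiv:1407.1826v2 (2014), §3.1–3.2 (p. 8), proof of Lemma 18
  (p. 9). [cite: BhargavaSkinnerZhang2014, §3.1–3.2 and Lemma 18 (proof)]
* M. Bhargava, C. Skinner, J. Ramanujan Math. Soc. 29 (2014) 221–242 = arXiv:1401.0233, Prop. 12 and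
  proof of Lemma 16 (finite unions of `ν`-adic discs; "(large) family `F(W)`"), Thm 5 (= [BS5] Thm 31).
  [cite: BhargavaSkinner2014, Prop 12 and proof of Lemma 16]
* M. Bhargava, A. Shankar, arXiv:1312.7859 (2013), Thm 31 (the named fact A330).
  [cite: BhargavaShankar5Selmer2013, Thm 31]
-/

set_option autoImplicit false

noncomputable section

open scoped Classical

open WeierstrassCurve

/-! ### The Tate parameter as `p^k · u` -/

namespace WeierstrassCurve.TateParameterData

variable {W : WeierstrassCurve ℚ} [W.IsElliptic] {p : ℕ} [hp : Fact p.Prime]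

/-- **`q = p^k · u` with `u ∈ ℤ_pˣ`, `k = ord_p q ≥ 1`** for a Tate parameter datum (`q ∈ pℤ_p`,
`q ≠ 0`; Mathlib `PadicInt.unitCoeff_spec`). The source writes `q = p^k ω u`, `ω ∈ μ_{p-1}`,
`u ∈ 1 + pℤ_p`; here `u` denotes the whole unit `ω u`. [cite: BhargavaSkinnerZhang2014, Lemma 18 (proof, p. 9)] -/
theorem exists_eq_pow_mul_of_isUnit (D : TateParameterData W p) :
    ∃ (k : ℕ) (u : ℤ_[p]), IsUnit u ∧ D.q = (p : ℚ_[p]) ^ k * (u : ℚ_[p]) ∧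
      (k : ℤ) = D.q.valuation ∧ 0 < k := by
  set Q : ℤ_[p] := ⟨D.q, D.norm_q_lt_one.le⟩ with hQ
  have hQ0 : Q ≠ 0 := by
    intro h
    apply D.q_ne_zero
    have := congrArg ((↑) : ℤ_[p] → ℚ_[p]) h
    simpa [hQ] using this
  refine ⟨Q.valuation, (PadicInt.unitCoeff hQ0 : ℤ_[p]), (PadicInt.unitCoeff hQ0).isUnit, ?_, ?_, ?_⟩
  · have h := PadicInt.unitCoeff_spec hQ0
    have h' := congrArg ((↑) : ℤ_[p] → ℚ_[p]) h
    simp only [PadicInt.coe_mul, PadicInt.coe_pow, PadicInt.coe_natCast] at h'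
    rw [mul_comm] at h'
    exact h'
  · rw [← PadicInt.valuation_coe]
  · have h := D.valuation_q_pos
    have : (D.q).valuation = ((Q : ℚ_[p])).valuation := rfl
    rw [this, PadicInt.valuation_coe] at h
    exact_mod_cast h

/-- In any writing `q = p^k · u` with `u ∈ ℤ_pˣ`, `k = ord_p q` (`ℚ_pˣ = p^ℤ × ℤ_pˣ`, Serre II §3.3).
[cite: Serre1973, Ch. II §3.3 (structure of ℚ_pˣ)] -/
theorem natCast_eq_valuation_of_eq_pow_mul (D : TateParameterData W p) {k : ℕ} {u : ℤ_[p]}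
    (hu : IsUnit u) (hq : D.q = (p : ℚ_[p]) ^ k * (u : ℚ_[p])) : (k : ℤ) = D.q.valuation := by
  have hpQ : (p : ℚ_[p]) ≠ 0 := by exact_mod_cast hp.out.ne_zero
  have hu1 : ‖(u : ℚ_[p])‖ = 1 := by
    rw [PadicInt.padic_norm_e_of_padicInt]; exact PadicInt.isUnit_iff.mp hu
  have hu0 : (u : ℚ_[p]) ≠ 0 := norm_pos_iff.mp (by rw [hu1]; exact one_pos)
  have huval : (u : ℚ_[p]).valuation = 0 := by
    have h := Padic.norm_eq_zpow_neg_valuation hu0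
    rw [hu1] at h
    have hp1 : (1 : ℝ) < p := by exact_mod_cast hp.out.one_lt
    have h' : (p : ℝ) ^ (0 : ℤ) = (p : ℝ) ^ (-(u : ℚ_[p]).valuation) := by rw [zpow_zero]; exact h
    have := zpow_right_injective₀ (by positivity) hp1.ne' h'
    linarith
  rw [hq, Padic.valuation_mul (pow_ne_zero _ hpQ) hu0, Padic.valuation_pow, Padic.valuation_p, huval]
  ring

/-- The unit part `q · p^{-ord_p q}` of the tree's logarithm (`Literature.NumberTheory.EllipticCurves.padicLog`)
is `u` when `q = p^k · u`, `u ∈ ℤ_pˣ` (Iwasawa's normalisation `x = p^{ord_p x} · u`).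
[cite: Iwasawa1972PadicL, §4.4] -/
theorem mul_zpow_neg_valuation_eq_of_eq_pow_mul (D : TateParameterData W p) {k : ℕ} {u : ℤ_[p]}
    (hu : IsUnit u) (hq : D.q = (p : ℚ_[p]) ^ k * (u : ℚ_[p])) :
    D.q * (p : ℚ_[p]) ^ (-D.q.valuation) = (u : ℚ_[p]) := by
  have hpQ : (p : ℚ_[p]) ≠ 0 := by exact_mod_cast hp.out.ne_zero
  rw [← natCast_eq_valuation_of_eq_pow_mul D hu hq, hq, zpow_neg, zpow_natCast,
    mul_comm ((p : ℚ_[p]) ^ k), mul_assoc, mul_inv_cancel₀ (pow_ne_zero _ hpQ), mul_one]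

/-- **`ord_p q = -ord_p j(E)`** for a Tate parameter datum (`j(q) = j(E)` and `ord_p j(q) = -ord_p q`,
Silverman ATAEC V.3.1(b); the tree's discharged fact `valuation_tateJ_holds`).
[cite: SilvermanATAEC1994, Thm. V.3.1 (b)] -/
theorem valuation_q_eq_neg_valuation_j (D : TateParameterData W p) :
    D.q.valuation = -((W.j : ℚ_[p])).valuation := by
  have h := valuation_j_holds (W := W) (p := p)
    Literature.NumberTheory.EllipticCurves.valuation_tateJ_holds D
  rw [h, neg_neg]

/-- **"if `p ∤ k`, then `𝓛(E) ∈ pℤ_p^×` if and only if `log_p q ∈ pℤ_p^×`"** in valuation form and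
WITHOUT a minimality hypothesis: `ord_p 𝓛_p(E) = ord_p log_p q` as soon as `p ∤ ord_p q`
(`𝓛 = log_p q / ord_p q` and the denominator is a `p`-adic unit). Model-free twin of the tree's
`valuation_lInvariant_eq_valuation_padicLog_of_not_dvd` (which reads `k` as `ord_p Δ_min` on a
global minimal model). [cite: BhargavaSkinnerZhang2014, Lemma 18 (proof, p. 9)] [cite: MazurTateTeitelbaum1986Invent, §II.1] -/
theorem valuation_lInvariant_eq_valuation_padicLog_of_not_dvd_valuation (D : TateParameterData W p)
    (hk : ¬ (p : ℤ) ∣ D.q.valuation) :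
    (LInvariant D).valuation =
      (Literature.NumberTheory.EllipticCurves.padicLog p D.q).valuation := by
  have hkval : ((D.q.valuation : ℤ) : ℚ_[p]).valuation = 0 := by
    rw [Padic.valuation_intCast]
    exact_mod_cast padicValInt.eq_zero_of_not_dvd hk
  have hk0 : D.q.valuation ≠ 0 := by
    have := D.valuation_q_pos; omega
  have hkne : ((D.q.valuation : ℤ) : ℚ_[p]) ≠ 0 := by exact_mod_cast hk0
  unfold LInvariant
  by_cases hlog : Literature.NumberTheory.EllipticCurves.padicLog p D.q = 0
  · rw [hlog, zero_div]
  · rw [div_eq_mul_inv, Padic.valuation_mul hlog (inv_ne_zero hkne), Padic.valuation_inv, hkval,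
      neg_zero, add_zero]

/-- Fermat in `ℤ_pˣ`: `p ∣ u^{p-1} - 1` for a unit `u`. [cite: Serre1973, Ch. II §3.1 Prop. 7] -/
private theorem p_dvd_pow_sub_one_of_isUnit' {u : ℤ_[p]} (hu : IsUnit u) :
    (p : ℤ_[p]) ∣ u ^ (p - 1) - 1 := by
  have hu0 : PadicInt.toZMod u ≠ 0 := (hu.map (PadicInt.toZMod (p := p))).ne_zero
  have h1 : PadicInt.toZMod (u ^ (p - 1) - 1) = 0 := by
    rw [map_sub, map_pow, map_one, ZMod.pow_card_sub_one_eq_one hu0, sub_self]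
  have h2 : u ^ (p - 1) - 1 ∈ RingHom.ker (PadicInt.toZMod (p := p)) := h1
  rw [PadicInt.ker_toZMod, PadicInt.maximalIdeal_eq_span_p, Ideal.mem_span_singleton] at h2
  exact h2

/-- For `y ∈ ℤ_p` with `p ∣ y`: `ord_p y = 1` (as an element of `ℚ_p`) iff `p² ∤ y`. [folklore] -/
private theorem valuation_coe_eq_one_iff_of_dvd {y : ℤ_[p]} (hpy : (p : ℤ_[p]) ∣ y) :
    ((y : ℚ_[p])).valuation = 1 ↔ ¬ (p : ℤ_[p]) ^ 2 ∣ y := by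
  by_cases hy0 : y = 0
  · subst hy0
    simp
  · have h2 : (p : ℤ_[p]) ^ 2 ∣ y ↔ 2 ≤ y.valuation := by
      rw [← Ideal.mem_span_singleton]; exact PadicInt.mem_span_pow_iff_le_valuation y hy0 2
    have h1 : 1 ≤ y.valuation := by
      rw [← PadicInt.mem_span_pow_iff_le_valuation y hy0 1, Ideal.mem_span_singleton, pow_one]
      exact hpy
    rw [h2, PadicInt.valuation_coe]
    omega

/-- **Bhargava–Skinner–Zhang, proof of Lemma 18 — the `𝓛`-clause of `S₁'(p)` on the Tate
parameter.** For `E/ℚ` elliptic, `p` odd, `D` a Tate parameter datum at `p` with `q = p^k · u`,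
`u ∈ ℤ_pˣ`, and `p ∤ k`: `ord_p 𝓛_p(E) = 1 ⟺ u^{p-1} ≢ 1 (mod p²)` ("`𝓛(E_{A,B}) ∈ pℤ_p^×` …
if and only if `u ∉ 1 + p²ℤ_p`"; `ord_p log_p q = ord_p(u^{p-1} - 1) ≥ 1` by the tree's
`norm_padicLog_eq_norm_unitPart_pow_sub_one`). [cite: BhargavaSkinnerZhang2014, Lemma 18 (proof, p. 9)] -/
theorem valuation_lInvariant_eq_one_iff (hp2 : p ≠ 2) (D : TateParameterData W p) {k : ℕ}
    {u : ℤ_[p]} (hu : IsUnit u) (hq : D.q = (p : ℚ_[p]) ^ k * (u : ℚ_[p])) (hk : ¬ p ∣ k) :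
    (LInvariant D).valuation = 1 ↔ ¬ (p : ℤ_[p]) ^ 2 ∣ u ^ (p - 1) - 1 := by
  have hkv := natCast_eq_valuation_of_eq_pow_mul D hu hq
  have hk' : ¬ (p : ℤ) ∣ D.q.valuation := by
    rw [← hkv]; exact_mod_cast hk
  have hunit := mul_zpow_neg_valuation_eq_of_eq_pow_mul D hu hq
  rw [valuation_lInvariant_eq_valuation_padicLog_of_not_dvd_valuation D hk']
  set y : ℤ_[p] := u ^ (p - 1) - 1 with hy
  have hy_coe : ((y : ℤ_[p]) : ℚ_[p]) = (D.q * (p : ℚ_[p]) ^ (-D.q.valuation)) ^ (p - 1) - 1 := by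
    rw [hunit, hy]; push_cast; rfl
  have hpy : (p : ℤ_[p]) ∣ y := p_dvd_pow_sub_one_of_isUnit' hu
  have hnorm := Literature.NumberTheory.EllipticCurves.norm_padicLog_eq_norm_unitPart_pow_sub_one
    hp2 D.q_ne_zero
  rw [← hy_coe] at hnorm
  by_cases hy0 : y = 0
  · -- `u^{p-1} = 1`: `log_p q = 0`, `ord_p 0 = 0 ≠ 1`, and `p² ∣ 0`
    have hlog0 : Literature.NumberTheory.EllipticCurves.padicLog p D.q = 0 := by
      rw [hy0, PadicInt.coe_zero, norm_zero] at hnorm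
      exact norm_eq_zero.mp hnorm
    rw [hlog0, Padic.valuation_zero, hy0]
    simp
  · have hne : (D.q * (p : ℚ_[p]) ^ (-D.q.valuation)) ^ (p - 1) - 1 ≠ 0 := by
      rw [← hy_coe]; exact PadicInt.coe_ne_zero.2 hy0
    rw [Literature.NumberTheory.EllipticCurves.valuation_padicLog_eq hp2 D.q_ne_zero hne, ← hy_coe]
    exact valuation_coe_eq_one_iff_of_dvd hpy

/-- The same for every Tate parameter datum at once (they share `q`, `TateParameterData.q_unique_holds`):
under `q = p^k · u`, `p ∤ k`, "`ord_p 𝓛(D') = 1` for all `D'`" iff `u^{p-1} ≢ 1 (mod p²)`.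
[cite: BhargavaSkinnerZhang2014, Lemma 18 (proof, p. 9)] -/
theorem forall_valuation_lInvariant_eq_one_iff (hp2 : p ≠ 2) (D : TateParameterData W p) {k : ℕ}
    {u : ℤ_[p]} (hu : IsUnit u) (hq : D.q = (p : ℚ_[p]) ^ k * (u : ℚ_[p])) (hk : ¬ p ∣ k) :
    (∀ D' : TateParameterData W p, (LInvariant D').valuation = 1) ↔
      ¬ (p : ℤ_[p]) ^ 2 ∣ u ^ (p - 1) - 1 := by
  rw [← valuation_lInvariant_eq_one_iff hp2 D hu hq hk]
  refine ⟨fun h ↦ h D, fun h D' ↦ ?_⟩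
  rw [LInvariant_eq_holds (fun {_} ↦ q_unique_holds) D' D]
  exact h

end WeierstrassCurve.TateParameterData

/-! ### `E(ℚ_p)[p] = 0` on the Tate parameter -/

namespace Literature.NumberTheory.EllipticCurves

/-- **The Tate-fifth-power test on `q = p^k · u`** (bundle Lemma 4.3 at `p = 5`): for `E/ℚ`
elliptic, `p` odd and a Tate parameter datum `D` with `q = p^k · u`, `u ∈ ℤ_pˣ`,
`E(ℚ_p)[p] = 0 ⟺ ¬(p ∣ k ∧ u^{p-1} ≡ 1 (mod p²))` — `E(ℚ_p)[p] ≠ 0 ⟺ q ∈ (ℚ_pˣ)^p` (Tate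
uniformisation, the tree's `forall_prime_smul_eq_zero_iff_not_exists_pow_eq_tateParameter`, below
the named fact `tateUniformization_points`) and `q ∈ (ℚ_pˣ)^p ⟺ p ∣ k ∧ u^{p-1} ≡ 1 (mod p²)`
(`Padic.exists_pow_prime_eq_iff_of_eq_pow_mul`). [cite: SilvermanATAEC1994, Thm. V.5.3] [cite: Serre1973, Ch. II §3.3] -/
theorem forall_prime_smul_eq_zero_iff_of_eq_pow_mul {p : ℕ} [hp : Fact p.Prime]
    (W : WeierstrassCurve ℚ) [W.IsElliptic] (hT : tateUniformization_points) (hp2 : p ≠ 2)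
    (D : TateParameterData W p) {k : ℕ} {u : ℤ_[p]} (hu : IsUnit u)
    (hq : D.q = (p : ℚ_[p]) ^ k * (u : ℚ_[p])) :
    (∀ P : (W.baseChange ℚ_[p]).toAffine.Point, p • P = 0 → P = 0) ↔
      ¬ (p ∣ k ∧ (p : ℤ_[p]) ^ 2 ∣ u ^ (p - 1) - 1) := by
  rw [forall_prime_smul_eq_zero_iff_not_exists_pow_eq_tateParameter W hT hp2 D,
    Padic.exists_pow_prime_eq_iff_of_eq_pow_mul hp2 hu hq]

end Literature.NumberTheory.EllipticCurves

/-! ### `p = 5`: the pieces of `E_{A,B}` on `(k, u⁴ mod 25)` -/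

namespace Literature.NumberTheory.EllipticCurves.BhargavaSkinnerZhang2014.Pieces

/-- **"`k = ord_p(Δ(E_{A,B})) = ord_p(q)`"** (proof of Lemma 18) for the curves `E_{A,B}` with
`p ∤ A`, `p ≥ 5`, read model-free through `j`: `ord_p q = -ord_p j(E_{A,B}) = ord_p(4A³ + 27B²)`
since `j(E_{A,B}) = 6912A³/(4A³ + 27B²)` (tree `shortWeierstrass_j`) with `p ∤ 6912A³`. [cite: BhargavaSkinnerZhang2014, Lemma 18 (proof, p. 9)] -/
theorem valuation_q_eq_padicValInt_disc {AB : ℤ × ℤ} [(shortWeierstrass AB).IsElliptic] {p : ℕ}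
    [hp : Fact p.Prime] (hp5 : 5 ≤ p) (hA : ¬ (p : ℤ) ∣ AB.1)
    (D : TateParameterData (shortWeierstrass AB) p) :
    D.q.valuation = padicValInt p (4 * AB.1 ^ 3 + 27 * AB.2 ^ 2) := by
  have hΔ := shortWeierstrass_Δ AB
  have hD : (4 * (AB.1 : ℚ) ^ 3 + 27 * (AB.2 : ℚ) ^ 2) ≠ 0 := by
    intro h0
    have hu := (shortWeierstrass AB).isUnit_Δ
    rw [hΔ, h0, mul_zero] at hu
    exact not_isUnit_zero hu
  have hDZ : (4 * AB.1 ^ 3 + 27 * AB.2 ^ 2 : ℤ) ≠ 0 := by exact_mod_cast hD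
  have hA0 : AB.1 ≠ 0 := by rintro h; exact hA (by rw [h]; exact dvd_zero _)
  have hp6912 : ¬ p ∣ 6912 := by
    intro h
    have h' : p ∣ 2 ^ 8 * 3 ^ 3 := by norm_num at h ⊢; exact h
    rcases (Nat.Prime.dvd_mul hp.out).mp h' with h2 | h3
    · have := (Nat.prime_dvd_prime_iff_eq hp.out Nat.prime_two).mp (hp.out.dvd_of_dvd_pow h2)
      omega
    · have := (Nat.prime_dvd_prime_iff_eq hp.out Nat.prime_three).mp (hp.out.dvd_of_dvd_pow h3)
      omega
  rw [D.valuation_q_eq_neg_valuation_j, shortWeierstrass_j, shortWeierstrassJ]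
  have hcast : ((6912 * (AB.1 : ℚ) ^ 3 / (4 * (AB.1 : ℚ) ^ 3 + 27 * (AB.2 : ℚ) ^ 2) : ℚ) : ℚ_[p]) =
      (((6912 * AB.1 ^ 3 : ℤ) : ℚ) / ((4 * AB.1 ^ 3 + 27 * AB.2 ^ 2 : ℤ) : ℚ) : ℚ) := by
    push_cast; ring
  have hpZ : Prime (p : ℤ) := Nat.prime_iff_prime_int.mp hp.out
  have h6912 : padicValInt p (6912 : ℤ) = 0 :=
    padicValInt.eq_zero_of_not_dvd (by exact_mod_cast hp6912)
  have hA3 : padicValInt p (AB.1 ^ 3) = 0 :=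
    padicValInt.eq_zero_of_not_dvd (fun h ↦ hA (hpZ.dvd_of_dvd_pow h))
  have hnum : (6912 * AB.1 ^ 3 : ℤ) ≠ 0 := mul_ne_zero (by norm_num) (pow_ne_zero 3 hA0)
  rw [hcast, Padic.valuation_ratCast,
    padicValRat.div (by exact_mod_cast hnum) (by exact_mod_cast hDZ),
    padicValRat.of_int, padicValRat.of_int,
    padicValInt.mul (by norm_num) (pow_ne_zero 3 hA0), h6912, hA3]
  ring

section Five

variable {AB : ℤ × ℤ}

/-- At `p = 5`, with `5 ∤ A` and `q = 5^k · u`: `k = ord₅(4A³ + 27B²)`. [cite: BhargavaSkinnerZhang2014, Lemma 18 (proof, p. 9)] -/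
theorem eq_padicValInt_disc_of_eq_pow_mul [Fact (Nat.Prime 5)] [(shortWeierstrass AB).IsElliptic]
    (hA : ¬ (5 : ℤ) ∣ AB.1) (D : TateParameterData (shortWeierstrass AB) 5) {k : ℕ} {u : ℤ_[5]}
    (hu : IsUnit u) (hq : D.q = (5 : ℚ_[5]) ^ k * (u : ℚ_[5])) :
    k = padicValInt 5 (4 * AB.1 ^ 3 + 27 * AB.2 ^ 2) := by
  have h1 := D.natCast_eq_valuation_of_eq_pow_mul hu (by exact_mod_cast hq)
  have h2 := valuation_q_eq_padicValInt_disc (p := 5) le_rfl (by exact_mod_cast hA) D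
  have : (k : ℤ) = (padicValInt 5 (4 * AB.1 ^ 3 + 27 * AB.2 ^ 2) : ℤ) := by rw [h1, h2]
  exact_mod_cast this

/-- Split multiplicative reduction of a family member at `5` forces `5 ∣ 4A³ + 27B²` and `5 ∤ A`.
[cite: BhargavaSkinnerZhang2014, Lemma 17 (proof, p. 8)] -/
theorem dvd_disc_and_not_dvd_of_hasSplitMultiplicativeReductionAtPrime [Fact (Nat.Prime 5)]
    [(shortWeierstrass AB).IsElliptic] (hfam : IsInHeightFamily AB)
    (hsplit : (shortWeierstrass AB).HasSplitMultiplicativeReductionAtPrime 5) :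
    (5 : ℤ) ∣ 4 * AB.1 ^ 3 + 27 * AB.2 ^ 2 ∧ ¬ (5 : ℤ) ∣ AB.1 := by
  have h := (hasMultiplicativeReductionAtPrime_shortWeierstrass_iff_of_isInHeightFamily 5 hfam
    le_rfl).mp hsplit.hasMultiplicativeReductionAtPrime
  exact ⟨by exact_mod_cast h.1, by exact_mod_cast h.2⟩

/-- **`T = S₁'(5)` at a SPLIT multiplicative curve, on the Tate parameter `q = 5^k · u`:**
`E_{A,B} ∈ S₁'(5) ⟺ 5 ∤ k ∧ u⁴ ≢ 1 (mod 25)` — the first bullet "`5 ∤ ord₅ Δ(A,B)`" is `5 ∤ k`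
(`k = ord₅ q = ord₅(4A³ + 27B²)`), the second "`ord₅ 𝓛(E_{A,B}) = 1`" is `u⁴ ≢ 1 (mod 25)` given
the first (`TateParameterData.forall_valuation_lInvariant_eq_one_iff`).
[cite: BhargavaSkinnerZhang2014, §3.1 (p. 8) and Lemma 18 (proof, p. 9)] -/
theorem S₁'_iff_of_hasSplitMultiplicativeReductionAtPrime [Fact (Nat.Prime 5)]
    [(shortWeierstrass AB).IsElliptic] (hfam : IsInHeightFamily AB)
    (hsplit : (shortWeierstrass AB).HasSplitMultiplicativeReductionAtPrime 5)
    (D : TateParameterData (shortWeierstrass AB) 5) {k : ℕ} {u : ℤ_[5]} (hu : IsUnit u)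
    (hq : D.q = (5 : ℚ_[5]) ^ k * (u : ℚ_[5])) :
    S₁' AB ↔ ¬ 5 ∣ k ∧ ¬ (5 : ℤ_[5]) ^ 2 ∣ u ^ 4 - 1 := by
  obtain ⟨hdisc, hA⟩ := dvd_disc_and_not_dvd_of_hasSplitMultiplicativeReductionAtPrime hfam hsplit
  have hk : k = padicValInt 5 (4 * AB.1 ^ 3 + 27 * AB.2 ^ 2) :=
    eq_padicValInt_disc_of_eq_pow_mul hA D hu hq
  have hL : ¬ 5 ∣ k → ((∀ D' : TateParameterData (shortWeierstrass AB) 5,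
      (LInvariant D').valuation = 1) ↔ ¬ (5 : ℤ_[5]) ^ 2 ∣ u ^ 4 - 1) := fun hk5 ↦
    TateParameterData.forall_valuation_lInvariant_eq_one_iff (by norm_num) D hu hq hk5
  unfold S₁' S₀
  constructor
  · rintro ⟨-, hfin, hLc⟩
    have hk5 : ¬ 5 ∣ k := by rw [hk]; exact hfin hdisc
    exact ⟨hk5, (hL hk5).mp fun D' ↦ hLc hsplit D'⟩
  · rintro ⟨hk5, hu4⟩
    refine ⟨hA, fun _ ↦ by rw [← hk]; exact hk5, ?_⟩
    intro _ _ D'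
    exact (hL hk5).mpr hu4 D'

/-- **`T = S₁'(5)` at a NON-SPLIT multiplicative curve:** `E_{A,B} ∈ S₁'(5) ⟺ 5 ∤ ord₅(4A³ + 27B²)`
(the `𝓛`-bullet only concerns split curves). [cite: BhargavaSkinnerZhang2014, §3.1 (p. 8)] -/
theorem S₁'_iff_of_not_hasSplitMultiplicativeReductionAtPrime [Fact (Nat.Prime 5)]
    [(shortWeierstrass AB).IsElliptic] (hA : ¬ (5 : ℤ) ∣ AB.1)
    (hdisc : (5 : ℤ) ∣ 4 * AB.1 ^ 3 + 27 * AB.2 ^ 2)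
    (hns : ¬ (shortWeierstrass AB).HasSplitMultiplicativeReductionAtPrime 5) :
    S₁' AB ↔ ¬ 5 ∣ padicValInt 5 (4 * AB.1 ^ 3 + 27 * AB.2 ^ 2) := by
  unfold S₁' S₀
  constructor
  · rintro ⟨-, hfin, -⟩
    exact hfin hdisc
  · intro hfin
    refine ⟨hA, fun _ ↦ hfin, ?_⟩
    intro _ hs
    exact absurd hs hns

/-- **`T = S₁'(5)` at a curve of GOOD reduction at `5`** (`5 ∤ A`, `5 ∤ 4A³ + 27B²`): both bullets
are vacuous, `E_{A,B} ∈ S₁'(5)`. [cite: BhargavaSkinnerZhang2014, §3.1 (p. 8) and Lemma 17 (p. 8)] -/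
theorem S₁'_of_not_dvd_disc (hfam : IsInHeightFamily AB) (hA : ¬ (5 : ℤ) ∣ AB.1)
    (hdisc : ¬ (5 : ℤ) ∣ 4 * AB.1 ^ 3 + 27 * AB.2 ^ 2) : S₁' AB := by
  refine ⟨hA, fun h ↦ absurd h hdisc, ?_⟩
  intro _ hs
  exact absurd (dvd_disc_and_not_dvd_of_hasSplitMultiplicativeReductionAtPrime hfam hs).1 hdisc

/-- **`E_{A,B}(ℚ₅)[5] = 0` at a SPLIT multiplicative curve, on `q = 5^k · u`:**
`⟺ ¬(5 ∣ k ∧ u⁴ ≡ 1 (mod 25))` (below `tateUniformization_points`).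
[cite: SilvermanATAEC1994, Thm. V.5.3] [cite: BhargavaSkinnerZhang2014, proof of Cor. 26 (pp. 11–12)] -/
theorem locallyTorsionFree_iff_of_hasSplitMultiplicativeReductionAtPrime [Fact (Nat.Prime 5)]
    [(shortWeierstrass AB).IsElliptic] (hT : tateUniformization_points)
    (D : TateParameterData (shortWeierstrass AB) 5) {k : ℕ} {u : ℤ_[5]} (hu : IsUnit u)
    (hq : D.q = (5 : ℚ_[5]) ^ k * (u : ℚ_[5])) :
    LocallyTorsionFree AB ↔ ¬ (5 ∣ k ∧ (5 : ℤ_[5]) ^ 2 ∣ u ^ 4 - 1) := by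
  have h := forall_prime_smul_eq_zero_iff_of_eq_pow_mul (shortWeierstrass AB) hT (by norm_num) D hu hq
  have h4 : (5 : ℕ) - 1 = 4 := rfl
  simp only [h4, Nat.cast_ofNat] at h
  exact h

/-- **`E_{A,B}(ℚ₅)[5] = 0` at a NON-SPLIT multiplicative curve** (automatic: `c₅ ≤ 2`,
`#Ẽ_ns(𝔽₅) = 6`; the tree's `LocalTorsionMult.localTorsion_eq_zero_of_mult_of_smul_eq` on a global
minimal model of `E_{A,B}`, which exists by `WeierstrassCurve.hasGlobalMinimalModel_rat_holds`).
[cite: SilvermanAEC2009, Thm VII.6.1 and VIII.8 Cor. 8.3] -/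
theorem locallyTorsionFree_of_not_hasSplitMultiplicativeReductionAtPrime [Fact (Nat.Prime 5)]
    [(shortWeierstrass AB).IsElliptic]
    (hmult : (shortWeierstrass AB).HasMultiplicativeReductionAtPrime 5)
    (hns : ¬ (shortWeierstrass AB).HasSplitMultiplicativeReductionAtPrime 5) :
    LocallyTorsionFree AB := by
  obtain ⟨C, hC⟩ := WeierstrassCurve.hasGlobalMinimalModel_rat_holds (shortWeierstrass AB)
  haveI : (C • shortWeierstrass AB).IsGloballyMinimal := hC
  have hX : C⁻¹ • (C • shortWeierstrass AB) = shortWeierstrass AB := inv_smul_smul C _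
  have hmultW : (C • shortWeierstrass AB).HasMultiplicativeReductionAtPrime 5 :=
    (hasMultiplicativeReductionAtPrime_smul_iff (shortWeierstrass AB) C 5).mpr hmult
  have hnsW : ¬ (C • shortWeierstrass AB).HasSplitMultiplicativeReductionAtPrime 5 := fun h ↦
    hns ((hasSplitMultiplicativeReductionAtPrime_smul_iff (shortWeierstrass AB) C 5).mp h)
  intro P hP
  exact LocalTorsionMult.localTorsion_eq_zero_of_mult_of_smul_eq (C • shortWeierstrass AB) 5
    (by norm_num) hmultW (Or.inl hnsW) (shortWeierstrass AB) C⁻¹ hX P hP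

/-- **`E_{A,B}(ℚ₅)[5] = 0` at a multiplicative curve of the family with `5 ∤ ord₅(4A³ + 27B²)`**
(automatic: `c₅ ∣ ord₅ Δ_min` or `c₅ ≤ 2`; `ord₅ Δ_min = ord₅(4A³ + 27B²)` for a family member,
tree `padicValInt_minimalDiscriminantInt_smul_shortWeierstrass`). [cite: SilvermanAEC2009, Thm VII.6.1 and VIII.8 Cor. 8.3] -/
theorem locallyTorsionFree_of_not_dvd_padicValInt [Fact (Nat.Prime 5)]
    [(shortWeierstrass AB).IsElliptic] (hfam : IsInHeightFamily AB)
    (hmult : (shortWeierstrass AB).HasMultiplicativeReductionAtPrime 5)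
    (hfin : ¬ 5 ∣ padicValInt 5 (4 * AB.1 ^ 3 + 27 * AB.2 ^ 2)) :
    LocallyTorsionFree AB := by
  obtain ⟨C, hC⟩ := WeierstrassCurve.hasGlobalMinimalModel_rat_holds (shortWeierstrass AB)
  haveI : (C • shortWeierstrass AB).IsGloballyMinimal := hC
  have hX : C⁻¹ • (C • shortWeierstrass AB) = shortWeierstrass AB := inv_smul_smul C _
  have hmultW : (C • shortWeierstrass AB).HasMultiplicativeReductionAtPrime 5 :=
    (hasMultiplicativeReductionAtPrime_smul_iff (shortWeierstrass AB) C 5).mpr hmult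
  have hv : padicValInt 5 (C • shortWeierstrass AB).minimalDiscriminantInt =
      padicValInt 5 (4 * AB.1 ^ 3 + 27 * AB.2 ^ 2) :=
    padicValInt_minimalDiscriminantInt_smul_shortWeierstrass hfam (C • shortWeierstrass AB) C rfl
      le_rfl
  intro P hP
  exact LocalTorsionMult.localTorsion_eq_zero_of_mult_of_smul_eq (C • shortWeierstrass AB) 5
    (by norm_num) hmultW (Or.inr (by rw [hv]; exact hfin)) (shortWeierstrass AB) C⁻¹ hX P hP

/-- **The Tate-fifth-power set `R = T₅` on the Tate parameter** (proof of Cor. 26; the bundle's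
"Tate-fifth-power set"): a family member `E_{A,B}` lies in `T₅` iff `5 ∤ A`, `E_{A,B}` is SPLIT
multiplicative at `5` and its Tate parameter `q = 5^k · u` has `5 ∣ k` and `u⁴ ≡ 1 (mod 25)` —
i.e. `q ∈ (ℚ₅ˣ)⁵`. Non-split curves and curves with `5 ∤ k` have `E(ℚ₅)[5] = 0`; for `5 ∣ k` the
first bullet of `S₁'(5)` fails. Below `tateUniformization_points`; any ellipticity witness.
[cite: BhargavaSkinnerZhang2014, proof of Cor. 26 (pp. 11–12)] [cite: SilvermanATAEC1994, Thm. V.5.3] -/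
theorem T₅_iff [Fact (Nat.Prime 5)] [(shortWeierstrass AB).IsElliptic]
    (hT : tateUniformization_points) (hfam : IsInHeightFamily AB) :
    T₅ AB ↔ ¬ (5 : ℤ) ∣ AB.1 ∧
      ∃ (_ : (shortWeierstrass AB).HasSplitMultiplicativeReductionAtPrime 5)
        (D : TateParameterData (shortWeierstrass AB) 5) (k : ℕ) (u : ℤ_[5]),
        IsUnit u ∧ D.q = (5 : ℚ_[5]) ^ k * (u : ℚ_[5]) ∧ 5 ∣ k ∧ (5 : ℤ_[5]) ^ 2 ∣ u ^ 4 - 1 := by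
  constructor
  · rintro ⟨hA, hnS, hnL⟩
    -- multiplicative at `5`: otherwise `S₁'` holds
    have hdisc : (5 : ℤ) ∣ 4 * AB.1 ^ 3 + 27 * AB.2 ^ 2 := by
      by_contra h; exact hnS (S₁'_of_not_dvd_disc hfam hA h)
    have hmult : (shortWeierstrass AB).HasMultiplicativeReductionAtPrime 5 :=
      (hasMultiplicativeReductionAtPrime_shortWeierstrass_iff_of_isInHeightFamily 5 hfam le_rfl).mpr
        ⟨by exact_mod_cast hdisc, by exact_mod_cast hA⟩
    -- split: otherwise `E(ℚ₅)[5] = 0`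
    have hsplit : (shortWeierstrass AB).HasSplitMultiplicativeReductionAtPrime 5 := by
      by_contra h
      exact hnL (locallyTorsionFree_of_not_hasSplitMultiplicativeReductionAtPrime hmult h)
    obtain ⟨D⟩ := (nonempty_tateParameterData_iff_holds (W := shortWeierstrass AB) (p := 5)).mpr
      hsplit
    obtain ⟨k, u, hu, hq, -, -⟩ := D.exists_eq_pow_mul_of_isUnit
    have h := (locallyTorsionFree_iff_of_hasSplitMultiplicativeReductionAtPrime hT D hu hq).not.mp
      hnL
    push Not at h
    exact ⟨hA, hsplit, D, k, u, hu, hq, h.1, h.2⟩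
  · rintro ⟨hA, hsplit, D, k, u, hu, hq, hk5, hu4⟩
    refine ⟨hA, ?_, ?_⟩
    · rw [S₁'_iff_of_hasSplitMultiplicativeReductionAtPrime hfam hsplit D hu hq]
      exact fun h ↦ h.1 hk5
    · rw [locallyTorsionFree_iff_of_hasSplitMultiplicativeReductionAtPrime hT D hu hq]
      exact fun h ↦ h ⟨hk5, hu4⟩

/-- **The slice `P = SP'_K` on the Tate parameter** (proof of Cor. 26; the bundle's `SP'_K`): a
family member `E_{A,B}` lies in `SP'_K` iff `5 ∤ A`, `5 ∣ 4A³ + 27B²` (multiplicative at `5`),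
`ord₅(4A³ + 27B²) ≤ K`, and EITHER it is non-split at `5` with `5 ∣ ord₅(4A³ + 27B²)`, OR it is
split at `5` and its Tate parameter `q = 5^k · u` satisfies exactly one of `5 ∣ k`,
`u⁴ ≡ 1 (mod 25)` (outside `S₁'(5)` and with `E(ℚ₅)[5] = 0`). Below `tateUniformization_points`;
any ellipticity witness. [cite: BhargavaSkinnerZhang2014, proof of Cor. 26 (pp. 11–12)] [cite: BhargavaSkinner2014, Thm 7 (ii) and proof of Lemma 16] -/
theorem SP'_iff [Fact (Nat.Prime 5)] [(shortWeierstrass AB).IsElliptic]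
    (hT : tateUniformization_points) (hfam : IsInHeightFamily AB) (K : ℕ) :
    SP' K AB ↔ ¬ (5 : ℤ) ∣ AB.1 ∧ (5 : ℤ) ∣ 4 * AB.1 ^ 3 + 27 * AB.2 ^ 2 ∧
      padicValInt 5 (4 * AB.1 ^ 3 + 27 * AB.2 ^ 2) ≤ K ∧
      ((¬ (shortWeierstrass AB).HasSplitMultiplicativeReductionAtPrime 5 ∧
          5 ∣ padicValInt 5 (4 * AB.1 ^ 3 + 27 * AB.2 ^ 2)) ∨
        ∃ (_ : (shortWeierstrass AB).HasSplitMultiplicativeReductionAtPrime 5)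
          (D : TateParameterData (shortWeierstrass AB) 5) (k : ℕ) (u : ℤ_[5]),
          IsUnit u ∧ D.q = (5 : ℚ_[5]) ^ k * (u : ℚ_[5]) ∧
            ((5 ∣ k ∧ ¬ (5 : ℤ_[5]) ^ 2 ∣ u ^ 4 - 1) ∨
              (¬ 5 ∣ k ∧ (5 : ℤ_[5]) ^ 2 ∣ u ^ 4 - 1))) := by
  constructor
  · rintro ⟨hA, hnS, hL, hK⟩
    have hdisc : (5 : ℤ) ∣ 4 * AB.1 ^ 3 + 27 * AB.2 ^ 2 := by
      by_contra h; exact hnS (S₁'_of_not_dvd_disc hfam hA h)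
    refine ⟨hA, hdisc, hK, ?_⟩
    by_cases hsplit : (shortWeierstrass AB).HasSplitMultiplicativeReductionAtPrime 5
    · right
      obtain ⟨D⟩ := (nonempty_tateParameterData_iff_holds (W := shortWeierstrass AB) (p := 5)).mpr
        hsplit
      obtain ⟨k, u, hu, hq, -, -⟩ := D.exists_eq_pow_mul_of_isUnit
      refine ⟨hsplit, D, k, u, hu, hq, ?_⟩
      have h1 := (S₁'_iff_of_hasSplitMultiplicativeReductionAtPrime hfam hsplit D hu hq).not.mp hnS
      have h2 := (locallyTorsionFree_iff_of_hasSplitMultiplicativeReductionAtPrime hT D hu hq).mp hL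
      by_cases hk5 : 5 ∣ k
      · exact Or.inl ⟨hk5, fun h ↦ h2 ⟨hk5, h⟩⟩
      · right
        refine ⟨hk5, ?_⟩
        by_contra h
        exact h1 ⟨hk5, h⟩
    · left
      refine ⟨hsplit, ?_⟩
      by_contra h
      exact hnS ((S₁'_iff_of_not_hasSplitMultiplicativeReductionAtPrime hA hdisc hsplit).mpr h)
  · rintro ⟨hA, hdisc, hK, h⟩
    have hmult : (shortWeierstrass AB).HasMultiplicativeReductionAtPrime 5 :=
      (hasMultiplicativeReductionAtPrime_shortWeierstrass_iff_of_isInHeightFamily 5 hfam le_rfl).mpr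
        ⟨by exact_mod_cast hdisc, by exact_mod_cast hA⟩
    rcases h with ⟨hns, hk5⟩ | ⟨hsplit, D, k, u, hu, hq, h⟩
    · refine ⟨hA, ?_, locallyTorsionFree_of_not_hasSplitMultiplicativeReductionAtPrime hmult hns, hK⟩
      rw [S₁'_iff_of_not_hasSplitMultiplicativeReductionAtPrime hA hdisc hns]
      exact fun h ↦ h hk5
    · refine ⟨hA, ?_, ?_, hK⟩
      · rw [S₁'_iff_of_hasSplitMultiplicativeReductionAtPrime hfam hsplit D hu hq]
        rintro ⟨hk5, hu4⟩
        rcases h with ⟨hk5', -⟩ | ⟨-, hu4'⟩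
        · exact hk5 hk5'
        · exact hu4 hu4'
      · rw [locallyTorsionFree_iff_of_hasSplitMultiplicativeReductionAtPrime hT D hu hq]
        rintro ⟨hk5, hu4⟩
        rcases h with ⟨-, hu4'⟩ | ⟨hk5', -⟩
        · exact hu4' hu4
        · exact hk5' hk5

end Five

end Literature.NumberTheory.EllipticCurves.BhargavaSkinnerZhang2014.Pieces

end

noncomputable section

open Filter Topology

open scoped Classical

open WeierstrassCurve

namespace Literature.NumberTheory.EllipticCurves

/-! ### Generic: densities of predicates that agree on the family; the binder form -/

/-- Two predicates that agree on the members of the height family have the same height density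
(`heightProportion` only counts family members). [folklore] -/
private theorem hasHeightDensity_congr_of_isInHeightFamily {P Q : ℤ × ℤ → Prop} {μ : ℝ}
    (h : ∀ AB, IsInHeightFamily AB → (P AB ↔ Q AB)) (hP : HasHeightDensity P μ) :
    HasHeightDensity Q μ :=
  hasHeightDensity_of_squeeze (fun _ ↦ P) (fun _ ↦ P) (fun _ ↦ μ) (fun _ ↦ μ) (fun _ ↦ hP)
    (fun _ ↦ hP) (fun _ AB hAB hPAB ↦ (h AB hAB).mp hPAB) (fun _ AB hAB hQAB ↦ (h AB hAB).mpr hQAB)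
    tendsto_const_nhds tendsto_const_nhds

/-- **From a height density to the binder form of `bsz_rankLeOne_cRank_of_pieces`**: if `P` has
height density `μ`, then for every `η > 0`, eventually `(μ - η)·#{H < X} ≤ #{H < X, P}`. [folklore] -/
private theorem HasHeightDensity.eventually_mul_card_le {P : ℤ × ℤ → Prop} {μ : ℝ}
    (hP : HasHeightDensity P μ) (η : ℝ) (hη : 0 < η) :
    ∀ᶠ X : ℕ in atTop,
      (μ - η) * (heightFamilyBelow X).card ≤ ((heightFamilyBelow X).filter P).card := by
  have h := (Metric.tendsto_atTop.mp hP) η hη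
  obtain ⟨N, hN⟩ := h
  filter_upwards [eventually_ge_atTop N] with X hX
  have hd := hN X hX
  rw [Real.dist_eq, abs_lt, heightProportion_eq_card_div] at hd
  by_cases h0 : ((heightFamilyBelow X).card : ℝ) = 0
  · rw [h0, mul_zero]; exact Nat.cast_nonneg _
  · have hpos : 0 < ((heightFamilyBelow X).card : ℝ) :=
      lt_of_le_of_ne (Nat.cast_nonneg _) (Ne.symm h0)
    have h1 := hd.1
    rw [lt_sub_iff_add_lt, lt_div_iff₀ hpos] at h1
    linarith

/-- **From a height density to an upper bound in binder form**: if `P` has height density `μ`,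
then for every `η > 0`, eventually `#{H < X, P} ≤ (μ + η)·#{H < X}`. [folklore] -/
private theorem HasHeightDensity.eventually_card_le_mul {P : ℤ × ℤ → Prop} {μ : ℝ}
    (hP : HasHeightDensity P μ) (η : ℝ) (hη : 0 < η) :
    ∀ᶠ X : ℕ in atTop,
      (((heightFamilyBelow X).filter P).card : ℝ) ≤ (μ + η) * (heightFamilyBelow X).card := by
  obtain ⟨N, hN⟩ := (Metric.tendsto_atTop.mp hP) η hη
  filter_upwards [eventually_ge_atTop N] with X hX
  have hd := hN X hX
  rw [Real.dist_eq, abs_lt, heightProportion_eq_card_div] at hd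
  by_cases h0 : ((heightFamilyBelow X).card : ℝ) = 0
  · have h0' : heightFamilyBelow X = ∅ := Finset.card_eq_zero.mp (by exact_mod_cast h0)
    rw [h0', Finset.filter_empty, Finset.card_empty, Nat.cast_zero, mul_zero]
  · have hpos : 0 < ((heightFamilyBelow X).card : ℝ) :=
      lt_of_le_of_ne (Nat.cast_nonneg _) (Ne.symm h0)
    have h2 := hd.2
    rw [sub_lt_iff_lt_add, div_lt_iff₀ hpos] at h2
    linarith

/-- **Binder form with a truncation allowance**: if `P` has height density `μ`, `R` has height
density `τ ≤ ε`, and on the height family `P ⊆ Q ∪ R`, then for every `η > 0`, eventually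
`(μ - ε - η)·#{H < X} ≤ #{H < X, Q}` (`#{P} ≤ #{Q} + #{R}`). [folklore] -/
private theorem eventually_mul_card_le_of_subset_union {P Q R : ℤ × ℤ → Prop} {μ τ ε : ℝ}
    (hP : HasHeightDensity P μ) (hR : HasHeightDensity R τ) (hτ : τ ≤ ε)
    (h : ∀ AB, IsInHeightFamily AB → P AB → Q AB ∨ R AB) :
    ∀ η : ℝ, 0 < η → ∀ᶠ X : ℕ in atTop,
      (μ - ε - η) * (heightFamilyBelow X).card ≤ ((heightFamilyBelow X).filter Q).card := by
  intro η hη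
  have hη2 : 0 < η / 2 := by linarith
  filter_upwards [hP.eventually_mul_card_le (η / 2) hη2, hR.eventually_card_le_mul (η / 2) hη2]
    with X hPX hRX
  have hsub : (heightFamilyBelow X).filter P ⊆
      (heightFamilyBelow X).filter Q ∪ (heightFamilyBelow X).filter R := by
    intro AB hAB
    rw [Finset.mem_filter] at hAB
    rw [Finset.mem_union, Finset.mem_filter, Finset.mem_filter]
    rcases h AB ((mem_heightFamilyBelow_iff AB X).mp hAB.1).1 hAB.2 with hQ | hR'
    · exact Or.inl ⟨hAB.1, hQ⟩
    · exact Or.inr ⟨hAB.1, hR'⟩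
  have hcard : (((heightFamilyBelow X).filter P).card : ℝ) ≤
      ((heightFamilyBelow X).filter Q).card + ((heightFamilyBelow X).filter R).card := by
    exact_mod_cast (Finset.card_le_card hsub).trans (Finset.card_union_le _ _)
  have hN : (0 : ℝ) ≤ (heightFamilyBelow X).card := Nat.cast_nonneg _
  nlinarith [mul_le_mul_of_nonneg_right hτ hN]

/-! ### `S₁'(5)` on the height family = the three residue sets -/

namespace BhargavaSkinnerZhang2014.Pieces

open BSZSigmaNs BSZSigmaSpl

/-- Residue arithmetic in `ZMod 5` (stated outside any `Fact (Nat.Prime 5)` context so that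
`decide` applies). [folklore] -/
private theorem zmod5_zero_ne_two : (0 : ZMod 5) ≠ 2 := by decide

/-- [folklore] -/
private theorem zmod5_zero_ne_three : (0 : ZMod 5) ≠ 3 := by decide

/-- [folklore] -/
private theorem zmod5_three_ne_two : (3 : ZMod 5) ≠ 2 := by decide

/-- `5 ∤ 6912A³` for `5 ∤ A`, read in `ZMod 5`. [folklore] -/
private theorem castHom_c_ne_zero {A : ℤ} (hA : ¬ (5 : ℤ) ∣ A) :
    ZMod.castHom five_dvd_twentyfive (ZMod 5) (((6912 * A ^ 3 : ℤ) : ZMod (5 ^ 2))) ≠ 0 := by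
  rw [map_intCast, ne_eq, ZMod.intCast_zmod_eq_zero_iff_dvd]
  intro h
  have h5 : Prime (5 : ℤ) := by norm_num
  rcases h5.dvd_or_dvd (by exact_mod_cast h : (5 : ℤ) ∣ 6912 * A ^ 3) with h1 | h2
  · norm_num at h1
  · exact hA (h5.dvd_of_dvd_pow h2)

/-- **`u⁴ mod 25` from `(A, B)` for a split family member**: for a Tate parameter datum `D` of
`E_{A,B}` at `5` with `q = 5^k·u`, `25 ∣ u⁴ - 1` iff `tateUnitResidue(5^v, A, (4A³+27B²)/5^v)⁴ = 1`,
`v = ord₅(4A³+27B²)` (`= k`): `sq_dvd_tateUnit_pow_sub_one_iff` (`u mod 25 = w + 744·5^k·w²`,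
`w·6912A³ = Δ'/5^k`) with `w = (Δ'/5^k)·(6912A³)¹⁹` (`mul_pow_nineteen_eq_one`).
[cite: BhargavaSkinnerZhang2014, Lemma 18 (proof, p. 9)] -/
theorem sq_dvd_pow_four_sub_one_iff_tateUnitResidue [Fact (Nat.Prime 5)] {AB : ℤ × ℤ}
    [(shortWeierstrass AB).IsElliptic] (hfam : IsInHeightFamily AB)
    (hsplit : (shortWeierstrass AB).HasSplitMultiplicativeReductionAtPrime 5)
    (D : TateParameterData (shortWeierstrass AB) 5) {k : ℕ} {u : ℤ_[5]} (hu : IsUnit u)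
    (hq : D.q = (5 : ℚ_[5]) ^ k * (u : ℚ_[5])) :
    (5 : ℤ_[5]) ^ 2 ∣ u ^ 4 - 1 ↔
      tateUnitResidue ((5 : ZMod (5 ^ 2)) ^ padicValInt 5 (4 * AB.1 ^ 3 + 27 * AB.2 ^ 2))
          (AB.1 : ZMod (5 ^ 2))
          (((4 * AB.1 ^ 3 + 27 * AB.2 ^ 2) / 5 ^ padicValInt 5 (4 * AB.1 ^ 3 + 27 * AB.2 ^ 2) : ℤ) :
            ZMod (5 ^ 2)) ^ 4 = 1 := by
  obtain ⟨hdisc, hA⟩ := dvd_disc_and_not_dvd_of_hasSplitMultiplicativeReductionAtPrime hfam hsplit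
  have hk : k = padicValInt 5 (4 * AB.1 ^ 3 + 27 * AB.2 ^ 2) :=
    eq_padicValInt_disc_of_eq_pow_mul hA D hu hq
  -- `Δ' = 5^k · d`
  set d : ℤ := (4 * AB.1 ^ 3 + 27 * AB.2 ^ 2) / 5 ^ k with hd
  have hdvd : (5 : ℤ) ^ k ∣ 4 * AB.1 ^ 3 + 27 * AB.2 ^ 2 := by rw [hk]; exact padicValInt_dvd _
  have hΔ : 4 * AB.1 ^ 3 + 27 * AB.2 ^ 2 = (5 : ℤ) ^ k * d := by
    rw [hd, Int.mul_ediv_cancel' hdvd]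
  -- `w = d · (6912A³)¹⁹` solves `w · 6912A³ = d`
  set c : ZMod (5 ^ 2) := ((6912 * AB.1 ^ 3 : ℤ) : ZMod (5 ^ 2)) with hc
  set w : ZMod (5 ^ 2) := (d : ZMod (5 ^ 2)) * c ^ 19 with hw
  have hwc : w * ((6912 * AB.1 ^ 3 : ℤ) : ZMod (5 ^ 2)) = (d : ZMod (5 ^ 2)) := by
    rw [hw, ← hc, mul_assoc, ← pow_succ, show (19 + 1 : ℕ) = 20 from rfl]
    have h20 : c ^ 20 = 1 := by
      have h := mul_pow_nineteen_eq_one c (castHom_c_ne_zero hA)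
      rw [← pow_succ'] at h
      exact h
    rw [h20, mul_one]
  have hcrit := sq_dvd_tateUnit_pow_sub_one_iff (p := 5) le_rfl (by exact_mod_cast hA) D hu
    (by exact_mod_cast hq) (by exact_mod_cast hΔ) hwc
  have h4 : (5 : ℕ) - 1 = 4 := rfl
  simp only [h4, Nat.cast_ofNat] at hcrit
  have htu : w + 744 * (5 : ZMod (5 ^ 2)) ^ k * w ^ 2 =
      tateUnitResidue ((5 : ZMod (5 ^ 2)) ^ k) (AB.1 : ZMod (5 ^ 2)) (d : ZMod (5 ^ 2)) := by
    rw [tateUnitResidue_def, hw, hc]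
    push_cast
    ring
  rw [hcrit, htu, ← hk]

/-- **The `𝓛`-clause of `S₁'(5)` as a residue condition**, for a SPLIT family member with
`5 ∤ k = ord₅(4A³ + 27B²)`: `E_{A,B} ∈ S₁'(5)` iff `tateUnitResidue(5^k, A, (4A³+27B²)/5^k)⁴ ≢ 1
(mod 25)` — `S₁'_iff_of_hasSplitMultiplicativeReductionAtPrime` (`⟺ u⁴ ≢ 1 (mod 25)` on
`q = 5^k·u`) with `sq_dvd_pow_four_sub_one_iff_tateUnitResidue`.
[cite: BhargavaSkinnerZhang2014, Lemma 18 (proof, p. 9)] -/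
theorem S₁'_iff_tateUnitResidue_of_split [Fact (Nat.Prime 5)] {AB : ℤ × ℤ}
    (hfam : IsInHeightFamily AB)
    (hsplit : haveI := isElliptic_shortWeierstrass hfam
      (shortWeierstrass AB).HasSplitMultiplicativeReductionAtPrime 5) :
    S₁' AB ↔ ¬ 5 ∣ padicValInt 5 (4 * AB.1 ^ 3 + 27 * AB.2 ^ 2) ∧
      tateUnitResidue ((5 : ZMod (5 ^ 2)) ^ padicValInt 5 (4 * AB.1 ^ 3 + 27 * AB.2 ^ 2))
          (AB.1 : ZMod (5 ^ 2))
          (((4 * AB.1 ^ 3 + 27 * AB.2 ^ 2) / 5 ^ padicValInt 5 (4 * AB.1 ^ 3 + 27 * AB.2 ^ 2) : ℤ) :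
            ZMod (5 ^ 2)) ^ 4 ≠ 1 := by
  haveI := isElliptic_shortWeierstrass hfam
  obtain ⟨-, hA⟩ := dvd_disc_and_not_dvd_of_hasSplitMultiplicativeReductionAtPrime hfam hsplit
  obtain ⟨D⟩ := (nonempty_tateParameterData_iff_holds (W := shortWeierstrass AB) (p := 5)).mpr hsplit
  obtain ⟨k, u, hu, hq, -, -⟩ := D.exists_eq_pow_mul_of_isUnit
  have hk : k = padicValInt 5 (4 * AB.1 ^ 3 + 27 * AB.2 ^ 2) :=
    eq_padicValInt_disc_of_eq_pow_mul hA D hu hq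
  rw [S₁'_iff_of_hasSplitMultiplicativeReductionAtPrime hfam hsplit D hu hq,
    sq_dvd_pow_four_sub_one_iff_tateUnitResidue hfam hsplit D hu hq, ← hk]

/-- **`E_{A,B} ∈ S₁'(5)` on the height family = `(A, B) ∈ Σ₅^g ∪ Σ₅^ns ∪ Σ₅^spl`** (proof of Lemma
18: "`μ(S₁'(5)) = (μ₅(Σ₅^g) + μ₅(Σ₅^ns) + μ₅(Σ₅^spl))·(1-5⁻¹⁰)⁻¹`", the three residue sets): good
reduction at `5` (`5 ∤ A`, `5 ∤ 4A³+27B²`: `S₁'_of_not_dvd_disc`), or non-split multiplicative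
(`A ≡ 2`, `B ≡ ±2`, `hasMultiplicative_not_split_five_shortWeierstrass_iff`) with `5 ∤ k`
(`S₁'_iff_of_not_hasSplitMultiplicativeReductionAtPrime`), or split (`A ≡ 3`, `B ≡ ±1`) with
`5 ∤ k` and the `𝓛`-residue condition (`S₁'_iff_tateUnitResidue_of_split`).
[cite: BhargavaSkinnerZhang2014, Lemma 18 (proof, p. 9: Σ₅^g, Σ₅^ns, Σ₅^spl)] -/
theorem S₁'_iff_residues [Fact (Nat.Prime 5)] {AB : ℤ × ℤ} (hfam : IsInHeightFamily AB) :
    S₁' AB ↔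
      (¬ (5 : ℤ) ∣ AB.1 ∧ ¬ (5 : ℤ) ∣ 4 * AB.1 ^ 3 + 27 * AB.2 ^ 2) ∨
      ((AB.1 : ZMod 5) = 2 ∧ ((AB.2 : ZMod 5) = 2 ∨ (AB.2 : ZMod 5) = 3) ∧
        ¬ 5 ∣ padicValInt 5 (4 * AB.1 ^ 3 + 27 * AB.2 ^ 2)) ∨
      ((AB.1 : ZMod 5) = 3 ∧ ((AB.2 : ZMod 5) = 1 ∨ (AB.2 : ZMod 5) = 4) ∧
        ¬ 5 ∣ padicValInt 5 (4 * AB.1 ^ 3 + 27 * AB.2 ^ 2) ∧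
        tateUnitResidue ((5 : ZMod (5 ^ 2)) ^ padicValInt 5 (4 * AB.1 ^ 3 + 27 * AB.2 ^ 2))
            (AB.1 : ZMod (5 ^ 2))
            (((4 * AB.1 ^ 3 + 27 * AB.2 ^ 2) / 5 ^ padicValInt 5 (4 * AB.1 ^ 3 + 27 * AB.2 ^ 2) : ℤ) :
              ZMod (5 ^ 2)) ^ 4 ≠ 1) := by
  haveI := isElliptic_shortWeierstrass hfam
  have hfam5 : ¬ ((5 : ℤ) ^ 4 ∣ AB.1 ∧ (5 : ℤ) ^ 6 ∣ AB.2) := hfam.2 5 Nat.prime_five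
  have hsplit_iff := hasSplitMultiplicativeReductionAtPrime_five_shortWeierstrass_iff (AB := AB)
    hfam.1 hfam5
  have hns_iff := hasMultiplicative_not_split_five_shortWeierstrass_iff (AB := AB) hfam.1 hfam5
  have hmult_iff := hasMultiplicativeReductionAtPrime_shortWeierstrass_iff_of_isInHeightFamily 5 hfam
    le_rfl
  -- residues of `A`: `2`, `3` are units, and distinct
  have h02 : (0 : ZMod 5) ≠ 2 := zmod5_zero_ne_two
  have h03 : (0 : ZMod 5) ≠ 3 := zmod5_zero_ne_three
  have h32 : (3 : ZMod 5) ≠ 2 := zmod5_three_ne_two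
  have h23 : (2 : ZMod 5) ≠ 3 := fun h ↦ zmod5_three_ne_two h.symm
  have hA2 : (AB.1 : ZMod 5) = 2 → ¬ (5 : ℤ) ∣ AB.1 := fun h2 h5 ↦ by
    rw [(ZMod.intCast_zmod_eq_zero_iff_dvd AB.1 5).mpr h5] at h2; exact h02 h2
  have hA3 : (AB.1 : ZMod 5) = 3 → ¬ (5 : ℤ) ∣ AB.1 := fun h3 h5 ↦ by
    rw [(ZMod.intCast_zmod_eq_zero_iff_dvd AB.1 5).mpr h5] at h3; exact h03 h3
  by_cases hA : (5 : ℤ) ∣ AB.1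
  · -- `5 ∣ A`: not in `S₀`, and in none of the residue sets
    constructor
    · intro h; exact absurd hA h.1
    · rintro (⟨h, -⟩ | ⟨h, -⟩ | ⟨h, -⟩)
      · exact absurd hA h
      · exact absurd hA (hA2 h)
      · exact absurd hA (hA3 h)
  by_cases hdisc : (5 : ℤ) ∣ 4 * AB.1 ^ 3 + 27 * AB.2 ^ 2
  · -- multiplicative at `5`
    have hmult : (shortWeierstrass AB).HasMultiplicativeReductionAtPrime 5 :=
      hmult_iff.mpr ⟨by exact_mod_cast hdisc, by exact_mod_cast hA⟩
    by_cases hsplit : (shortWeierstrass AB).HasSplitMultiplicativeReductionAtPrime 5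
    · -- split: `A ≡ 3`, `B ≡ ±1`
      obtain ⟨ha, hb⟩ := hsplit_iff.mp hsplit
      rw [S₁'_iff_tateUnitResidue_of_split hfam hsplit]
      constructor
      · rintro ⟨hv, hc⟩; exact Or.inr (Or.inr ⟨ha, hb, hv, hc⟩)
      · rintro (⟨-, h⟩ | ⟨h2, -⟩ | ⟨-, -, hv, hc⟩)
        · exact absurd hdisc h
        · rw [ha] at h2; exact absurd h2 h32
        · exact ⟨hv, hc⟩
    · -- non-split: `A ≡ 2`, `B ≡ ±2`
      obtain ⟨ha, hb⟩ := hns_iff.mp ⟨hmult, hsplit⟩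
      rw [S₁'_iff_of_not_hasSplitMultiplicativeReductionAtPrime hA hdisc hsplit]
      constructor
      · intro hv; exact Or.inr (Or.inl ⟨ha, hb, hv⟩)
      · rintro (⟨-, h⟩ | ⟨-, -, hv⟩ | ⟨h3, -⟩)
        · exact absurd hdisc h
        · exact hv
        · rw [ha] at h3; exact absurd h3 h23
  · -- good reduction at `5`
    constructor
    · intro _; exact Or.inl ⟨hA, hdisc⟩
    · intro _; exact S₁'_of_not_dvd_disc hfam hA hdisc

/-- **`μ(S₁'(5)) = 747265625/953369043` as a height density of the piece `T = Pieces.S₁'`**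
(Lemma 18 (b) with the corrected residue count: `(16/25 + 2/25·(1-4/(5⁵-1)) + 8/125·(1-4/(5⁵-1)))
·(1-5⁻¹⁰)⁻¹`, the tree's `bsz_mu_S_one_prime_five`; the three residue densities
`hasHeightDensity_sigma_good_five`, `hasHeightDensity_sigma_ns_five`, `hasHeightDensity_sigma_spl_five`
added over the disjoint union `S₁'_iff_residues`). [cite: BhargavaSkinnerZhang2014, Lemma 18 (b) (p. 8; value corrected)] -/
theorem hasHeightDensity_S₁' : HasHeightDensity S₁' (747265625 / 953369043) := by
  haveI : Fact (Nat.Prime 5) := ⟨Nat.prime_five⟩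
  have hg := hasHeightDensity_sigma_good_five
  have hns := hasHeightDensity_sigma_ns_five
  have hspl := hasHeightDensity_sigma_spl_five
  have h2 := hns.or_of_disjoint hspl (by
    rintro AB - ⟨h2, -⟩ ⟨h3, -⟩
    rw [h2] at h3; exact zmod5_three_ne_two h3.symm)
  have h3 := hg.or_of_disjoint h2 (by
    rintro AB - ⟨hA, hdisc⟩ (⟨h2, hb, -⟩ | ⟨h3, hb, -⟩)
    · apply hdisc
      have h0 : ((4 * AB.1 ^ 3 + 27 * AB.2 ^ 2 : ℤ) : ZMod 5) = 0 := by
        push_cast; rw [h2]; exact (zmod5_disc_two _).mpr hb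
      exact (ZMod.intCast_zmod_eq_zero_iff_dvd _ 5).mp h0
    · apply hdisc
      have h0 : ((4 * AB.1 ^ 3 + 27 * AB.2 ^ 2 : ℤ) : ZMod 5) = 0 := by
        push_cast; rw [h3]; exact (zmod5_disc_three _).mpr hb
      exact (ZMod.intCast_zmod_eq_zero_iff_dvd _ 5).mp h0)
  have hμ : (16 * 5 ^ 10 / (25 * (5 ^ 10 - 1)) +
      (2 / 25 * (1 - 4 / (5 ^ 5 - 1)) / (1 - 1 / (5 : ℝ) ^ 10) +
        8 / 125 * (1 - 4 / (5 ^ 5 - 1)) / (1 - 1 / (5 : ℝ) ^ 10)) : ℝ) = 747265625 / 953369043 := by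
    norm_num
  rw [← hμ]
  exact hasHeightDensity_congr_of_isInHeightFamily (fun AB hAB ↦ (S₁'_iff_residues hAB).symm) h3

/-- **The binder `hT` of `bsz_rankLeOne_cRank_of_pieces` for `T := Pieces.S₁'`, letter for letter**:
for every `η > 0`, eventually `(747265625/953369043 - η)·#{H < X} ≤ #{H < X, E_{A,B} ∈ S₁'(5)}`.
[cite: BhargavaSkinnerZhang2014, Lemma 18 (b) (p. 8; value corrected) and proof of Cor. 26 (p. 11)] -/
theorem hT_pieces : ∀ η : ℝ, 0 < η → ∀ᶠ X : ℕ in atTop,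
    (747265625 / 953369043 - η) * (heightFamilyBelow X).card ≤
      ((heightFamilyBelow X).filter S₁').card :=
  fun η hη ↦ hasHeightDensity_S₁'.eventually_mul_card_le η hη

/-! ### `R = T₅` on the height family = the Tate-fifth-power residue set -/

/-- **`E_{A,B} ∈ T₅` on the height family = the Tate-fifth-power residue set** (below
`tateUniformization_points`): `A ≡ 3`, `B ≡ ±1 (mod 5)` (split), `5 ∣ k = ord₅(4A³+27B²)` and
`tateUnitResidue(5^k, A, (4A³+27B²)/5^k)⁴ ≡ 1 (mod 25)` (`q_E ∈ (ℚ₅ˣ)⁵`) — `Pieces.T₅_iff` read through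
`sq_dvd_pow_four_sub_one_iff_tateUnitResidue` and the split residues.
[cite: BhargavaSkinnerZhang2014, proof of Cor. 26 (pp. 11–12)] [cite: SilvermanATAEC1994, Thm. V.5.3] -/
theorem T₅_iff_residues [Fact (Nat.Prime 5)] (hTate : tateUniformization_points) {AB : ℤ × ℤ}
    (hfam : IsInHeightFamily AB) :
    T₅ AB ↔
      (AB.1 : ZMod 5) = 3 ∧ ((AB.2 : ZMod 5) = 1 ∨ (AB.2 : ZMod 5) = 4) ∧
        5 ∣ padicValInt 5 (4 * AB.1 ^ 3 + 27 * AB.2 ^ 2) ∧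
        tateUnitResidue ((5 : ZMod (5 ^ 2)) ^ padicValInt 5 (4 * AB.1 ^ 3 + 27 * AB.2 ^ 2))
            (AB.1 : ZMod (5 ^ 2))
            (((4 * AB.1 ^ 3 + 27 * AB.2 ^ 2) / 5 ^ padicValInt 5 (4 * AB.1 ^ 3 + 27 * AB.2 ^ 2) : ℤ) :
              ZMod (5 ^ 2)) ^ 4 = 1 := by
  haveI := isElliptic_shortWeierstrass hfam
  have hfam5 : ¬ ((5 : ℤ) ^ 4 ∣ AB.1 ∧ (5 : ℤ) ^ 6 ∣ AB.2) := hfam.2 5 Nat.prime_five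
  have hsplit_iff := hasSplitMultiplicativeReductionAtPrime_five_shortWeierstrass_iff (AB := AB)
    hfam.1 hfam5
  rw [T₅_iff hTate hfam]
  constructor
  · rintro ⟨-, hsplit, D, k, u, hu, hq, hk5, hu4⟩
    obtain ⟨-, hA⟩ := dvd_disc_and_not_dvd_of_hasSplitMultiplicativeReductionAtPrime hfam hsplit
    have hk : k = padicValInt 5 (4 * AB.1 ^ 3 + 27 * AB.2 ^ 2) :=
      eq_padicValInt_disc_of_eq_pow_mul hA D hu hq
    obtain ⟨ha, hb⟩ := hsplit_iff.mp hsplit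
    refine ⟨ha, hb, hk ▸ hk5, ?_⟩
    exact (sq_dvd_pow_four_sub_one_iff_tateUnitResidue hfam hsplit D hu hq).mp hu4
  · rintro ⟨ha, hb, hv5, htu⟩
    have hsplit : (shortWeierstrass AB).HasSplitMultiplicativeReductionAtPrime 5 :=
      hsplit_iff.mpr ⟨ha, hb⟩
    obtain ⟨-, hA⟩ := dvd_disc_and_not_dvd_of_hasSplitMultiplicativeReductionAtPrime hfam hsplit
    obtain ⟨D⟩ := (nonempty_tateParameterData_iff_holds (W := shortWeierstrass AB) (p := 5)).mpr
      hsplit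
    obtain ⟨k, u, hu, hq, -, -⟩ := D.exists_eq_pow_mul_of_isUnit
    have hk : k = padicValInt 5 (4 * AB.1 ^ 3 + 27 * AB.2 ^ 2) :=
      eq_padicValInt_disc_of_eq_pow_mul hA D hu hq
    exact ⟨hA, hsplit, D, k, u, hu, hq, hk ▸ hv5,
      (sq_dvd_pow_four_sub_one_iff_tateUnitResidue hfam hsplit D hu hq).mpr htu⟩

/-- **`μ(T₅) = 78125/3813476172` as a height density of the piece `R = Pieces.T₅`** (below
`tateUniformization_points`; the bundle `pub-bsdpct`'s `μ(T₅)`; `hasHeightDensity_tateFifthPower_residues_five`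
transported along `T₅_iff_residues`). [cite: BhargavaSkinnerZhang2014, proof of Cor. 26 (pp. 11–12)] -/
theorem hasHeightDensity_T₅ (hTate : tateUniformization_points) :
    HasHeightDensity T₅ (78125 / 3813476172) := by
  haveI : Fact (Nat.Prime 5) := ⟨Nat.prime_five⟩
  exact hasHeightDensity_congr_of_isInHeightFamily (fun AB hAB ↦ (T₅_iff_residues hTate hAB).symm)
    hasHeightDensity_tateFifthPower_residues_five

/-- **The binder `hR` of `bsz_rankLeOne_cRank_of_pieces` for `R := Pieces.T₅`, letter for letter**
(below `tateUniformization_points`): for every `η > 0`, eventually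
`(78125/3813476172 - η)·#{H < X} ≤ #{H < X, E_{A,B} ∈ T₅}`.
[cite: BhargavaSkinnerZhang2014, proof of Cor. 26 (pp. 11–12)] -/
theorem hR_pieces (hTate : tateUniformization_points) : ∀ η : ℝ, 0 < η → ∀ᶠ X : ℕ in atTop,
    (78125 / 3813476172 - η) * (heightFamilyBelow X).card ≤
      ((heightFamilyBelow X).filter T₅).card :=
  fun η hη ↦ (hasHeightDensity_T₅ hTate).eventually_mul_card_le η hη

/-! ### `P = SP'_K` on the height family = the residue set of the slice, truncated at `ord₅ ≤ K` -/

/-- **`E_{A,B} ∈ SP'_K` on the height family = the residue set of the slice, truncated** (below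
`tateUniformization_points`): non-split (`A ≡ 2`, `B ≡ ±2 (mod 5)`) with `5 ∣ k = ord₅(4A³+27B²)`,
or split (`A ≡ 3`, `B ≡ ±1`) with exactly one of `5 ∣ k`, `tateUnitResidue(5^k, A, (4A³+27B²)/5^k)⁴
≡ 1 (mod 25)` — and `k ≤ K`; `Pieces.SP'_iff` read through
`sq_dvd_pow_four_sub_one_iff_tateUnitResidue` and the reduction-type residues.
[cite: BhargavaSkinnerZhang2014, proof of Cor. 26 (pp. 11–12)] [cite: BhargavaSkinner2014, Thm 7 (ii) and proof of Lemma 16] -/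
theorem SP'_iff_residues [Fact (Nat.Prime 5)] (hTate : tateUniformization_points) {AB : ℤ × ℤ}
    (hfam : IsInHeightFamily AB) (K : ℕ) :
    SP' K AB ↔
      (((AB.1 : ZMod 5) = 2 ∧ ((AB.2 : ZMod 5) = 2 ∨ (AB.2 : ZMod 5) = 3) ∧
            5 ∣ padicValInt 5 (4 * AB.1 ^ 3 + 27 * AB.2 ^ 2)) ∨
          ((AB.1 : ZMod 5) = 3 ∧ ((AB.2 : ZMod 5) = 1 ∨ (AB.2 : ZMod 5) = 4) ∧
            5 ∣ padicValInt 5 (4 * AB.1 ^ 3 + 27 * AB.2 ^ 2) ∧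
            tateUnitResidue ((5 : ZMod (5 ^ 2)) ^ padicValInt 5 (4 * AB.1 ^ 3 + 27 * AB.2 ^ 2))
              (AB.1 : ZMod (5 ^ 2))
              (((4 * AB.1 ^ 3 + 27 * AB.2 ^ 2) / 5 ^ padicValInt 5 (4 * AB.1 ^ 3 + 27 * AB.2 ^ 2) : ℤ) :
                ZMod (5 ^ 2)) ^ 4 ≠ 1) ∨
          ((AB.1 : ZMod 5) = 3 ∧ ((AB.2 : ZMod 5) = 1 ∨ (AB.2 : ZMod 5) = 4) ∧
            ¬ 5 ∣ padicValInt 5 (4 * AB.1 ^ 3 + 27 * AB.2 ^ 2) ∧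
            tateUnitResidue ((5 : ZMod (5 ^ 2)) ^ padicValInt 5 (4 * AB.1 ^ 3 + 27 * AB.2 ^ 2))
              (AB.1 : ZMod (5 ^ 2))
              (((4 * AB.1 ^ 3 + 27 * AB.2 ^ 2) / 5 ^ padicValInt 5 (4 * AB.1 ^ 3 + 27 * AB.2 ^ 2) : ℤ) :
                ZMod (5 ^ 2)) ^ 4 = 1)) ∧
        padicValInt 5 (4 * AB.1 ^ 3 + 27 * AB.2 ^ 2) ≤ K := by
  haveI := isElliptic_shortWeierstrass hfam
  have hfam5 : ¬ ((5 : ℤ) ^ 4 ∣ AB.1 ∧ (5 : ℤ) ^ 6 ∣ AB.2) := hfam.2 5 Nat.prime_five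
  have hsplit_iff := hasSplitMultiplicativeReductionAtPrime_five_shortWeierstrass_iff (AB := AB)
    hfam.1 hfam5
  have hns_iff := hasMultiplicative_not_split_five_shortWeierstrass_iff (AB := AB) hfam.1 hfam5
  have hmult_iff := hasMultiplicativeReductionAtPrime_shortWeierstrass_iff_of_isInHeightFamily 5 hfam
    le_rfl
  have h02 : (0 : ZMod 5) ≠ 2 := zmod5_zero_ne_two
  have h03 : (0 : ZMod 5) ≠ 3 := zmod5_zero_ne_three
  have h32 : (3 : ZMod 5) ≠ 2 := zmod5_three_ne_two
  have h23 : (2 : ZMod 5) ≠ 3 := fun h ↦ zmod5_three_ne_two h.symm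
  have hA2 : (AB.1 : ZMod 5) = 2 → ¬ (5 : ℤ) ∣ AB.1 := fun h2 h5 ↦ by
    rw [(ZMod.intCast_zmod_eq_zero_iff_dvd AB.1 5).mpr h5] at h2; exact h02 h2
  have hA3 : (AB.1 : ZMod 5) = 3 → ¬ (5 : ℤ) ∣ AB.1 := fun h3 h5 ↦ by
    rw [(ZMod.intCast_zmod_eq_zero_iff_dvd AB.1 5).mpr h5] at h3; exact h03 h3
  -- the residue classes force `5 ∣ 4A³ + 27B²`
  have hD2 : (AB.1 : ZMod 5) = 2 → ((AB.2 : ZMod 5) = 2 ∨ (AB.2 : ZMod 5) = 3) →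
      (5 : ℤ) ∣ 4 * AB.1 ^ 3 + 27 * AB.2 ^ 2 := fun h2 hb ↦ by
    have h0 : ((4 * AB.1 ^ 3 + 27 * AB.2 ^ 2 : ℤ) : ZMod 5) = 0 := by
      push_cast; rw [h2]; exact (zmod5_disc_two _).mpr hb
    exact (ZMod.intCast_zmod_eq_zero_iff_dvd _ 5).mp h0
  have hD3 : (AB.1 : ZMod 5) = 3 → ((AB.2 : ZMod 5) = 1 ∨ (AB.2 : ZMod 5) = 4) →
      (5 : ℤ) ∣ 4 * AB.1 ^ 3 + 27 * AB.2 ^ 2 := fun h3 hb ↦ by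
    have h0 : ((4 * AB.1 ^ 3 + 27 * AB.2 ^ 2 : ℤ) : ZMod 5) = 0 := by
      push_cast; rw [h3]; exact (zmod5_disc_three _).mpr hb
    exact (ZMod.intCast_zmod_eq_zero_iff_dvd _ 5).mp h0
  rw [SP'_iff hTate hfam K]
  by_cases hA : (5 : ℤ) ∣ AB.1
  · -- `5 ∣ A`: neither side
    constructor
    · rintro ⟨h, -⟩; exact absurd hA h
    · rintro ⟨(⟨h, -⟩ | ⟨h, -⟩ | ⟨h, -⟩), -⟩
      · exact absurd hA (hA2 h)
      · exact absurd hA (hA3 h)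
      · exact absurd hA (hA3 h)
  by_cases hdisc : (5 : ℤ) ∣ 4 * AB.1 ^ 3 + 27 * AB.2 ^ 2
  · -- multiplicative at `5`
    have hmult : (shortWeierstrass AB).HasMultiplicativeReductionAtPrime 5 :=
      hmult_iff.mpr ⟨by exact_mod_cast hdisc, by exact_mod_cast hA⟩
    by_cases hsplit : (shortWeierstrass AB).HasSplitMultiplicativeReductionAtPrime 5
    · -- split: `A ≡ 3`, `B ≡ ±1`; `k` and `u⁴ mod 25` read off `(A, B)`
      obtain ⟨ha, hb⟩ := hsplit_iff.mp hsplit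
      constructor
      · rintro ⟨-, -, hK, (⟨hns, -⟩ | ⟨-, D, k, u, hu, hq, h⟩)⟩
        · exact absurd hsplit hns
        · have hk : k = padicValInt 5 (4 * AB.1 ^ 3 + 27 * AB.2 ^ 2) :=
            eq_padicValInt_disc_of_eq_pow_mul hA D hu hq
          have hu4 := sq_dvd_pow_four_sub_one_iff_tateUnitResidue hfam hsplit D hu hq
          refine ⟨Or.inr ?_, hK⟩
          rcases h with ⟨hk5, hn⟩ | ⟨hk5, hy⟩
          · exact Or.inl ⟨ha, hb, hk ▸ hk5, fun h1 ↦ hn (hu4.mpr h1)⟩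
          · exact Or.inr ⟨ha, hb, hk ▸ hk5, hu4.mp hy⟩
      · rintro ⟨(⟨h2, -⟩ | ⟨-, -, hv5, hne⟩ | ⟨-, -, hv5, heq⟩), hK⟩
        · rw [ha] at h2; exact absurd h2 h32
        · obtain ⟨D⟩ := (nonempty_tateParameterData_iff_holds (W := shortWeierstrass AB)
            (p := 5)).mpr hsplit
          obtain ⟨k, u, hu, hq, -, -⟩ := D.exists_eq_pow_mul_of_isUnit
          have hk : k = padicValInt 5 (4 * AB.1 ^ 3 + 27 * AB.2 ^ 2) :=
            eq_padicValInt_disc_of_eq_pow_mul hA D hu hq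
          have hu4 := sq_dvd_pow_four_sub_one_iff_tateUnitResidue hfam hsplit D hu hq
          exact ⟨hA, hdisc, hK, Or.inr ⟨hsplit, D, k, u, hu, hq,
            Or.inl ⟨hk ▸ hv5, fun h1 ↦ hne (hu4.mp h1)⟩⟩⟩
        · obtain ⟨D⟩ := (nonempty_tateParameterData_iff_holds (W := shortWeierstrass AB)
            (p := 5)).mpr hsplit
          obtain ⟨k, u, hu, hq, -, -⟩ := D.exists_eq_pow_mul_of_isUnit
          have hk : k = padicValInt 5 (4 * AB.1 ^ 3 + 27 * AB.2 ^ 2) :=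
            eq_padicValInt_disc_of_eq_pow_mul hA D hu hq
          have hu4 := sq_dvd_pow_four_sub_one_iff_tateUnitResidue hfam hsplit D hu hq
          exact ⟨hA, hdisc, hK, Or.inr ⟨hsplit, D, k, u, hu, hq, Or.inr ⟨hk ▸ hv5, hu4.mpr heq⟩⟩⟩
    · -- non-split: `A ≡ 2`, `B ≡ ±2`
      obtain ⟨ha, hb⟩ := hns_iff.mp ⟨hmult, hsplit⟩
      constructor
      · rintro ⟨-, -, hK, (⟨-, hv5⟩ | ⟨hs, -⟩)⟩
        · exact ⟨Or.inl ⟨ha, hb, hv5⟩, hK⟩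
        · exact absurd hs hsplit
      · rintro ⟨(⟨-, -, hv5⟩ | ⟨h3, -⟩ | ⟨h3, -⟩), hK⟩
        · exact ⟨hA, hdisc, hK, Or.inl ⟨hsplit, hv5⟩⟩
        · rw [ha] at h3; exact absurd h3 h23
        · rw [ha] at h3; exact absurd h3 h23
  · -- good reduction at `5`: neither side
    constructor
    · rintro ⟨-, h, -⟩; exact absurd h hdisc
    · rintro ⟨(⟨h2, hb, -⟩ | ⟨h3, hb, -⟩ | ⟨h3, hb, -⟩), -⟩
      · exact absurd (hD2 h2 hb) hdisc
      · exact absurd (hD3 h3 hb) hdisc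
      · exact absurd (hD3 h3 hb) hdisc

/-- **The binder `hPd` of `bsz_rankLeOne_cRank_of_pieces` for `P := Pieces.SP' K`, `K ≥ 8`, letter
for letter** (below `tateUniformization_points`): for every `η > 0`, eventually
`(20546875/1271158724 - 10⁻⁶ - η)·#{H < X} ≤ #{H < X, E_{A,B} ∈ SP'_K}` — the residue set of the
slice has height density `20546875/1271158724` (`hasHeightDensity_SPprime_residues_five`; the bundle
`pub-bsdpct`'s `μ(SP')`), and on the height family it lies in `SP'_K ∪ {A ≡ 2, 3; 5^{K+1} ∣ 4A³+27B²}`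
(`SP'_iff_residues`), the tail having height density `≤ 10⁻⁶` for `K ≥ 8`
(`hasHeightDensity_mult_tail_five`, `mult_tail_density_le`).
[cite: BhargavaSkinnerZhang2014, proof of Cor. 26 (pp. 11–12)] -/
theorem hPd_pieces (hTate : tateUniformization_points) {K : ℕ} (hK : 8 ≤ K) :
    ∀ η : ℝ, 0 < η → ∀ᶠ X : ℕ in atTop,
      (20546875 / 1271158724 - 1 / 1000000 - η) * (heightFamilyBelow X).card ≤
        ((heightFamilyBelow X).filter (SP' K)).card :=
  haveI : Fact (Nat.Prime 5) := ⟨Nat.prime_five⟩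
  eventually_mul_card_le_of_subset_union hasHeightDensity_SPprime_residues_five
    (hasHeightDensity_mult_tail_five (K := K) (by omega)) (mult_tail_density_le hK)
    (fun AB hfam hres ↦ by
      by_cases hvK : padicValInt 5 (4 * AB.1 ^ 3 + 27 * AB.2 ^ 2) ≤ K
      · exact Or.inl ((SP'_iff_residues hTate hfam K).mpr ⟨hres, hvK⟩)
      · right
        have hle : K + 1 ≤ padicValInt 5 (4 * AB.1 ^ 3 + 27 * AB.2 ^ 2) := by omega
        refine ⟨?_, (pow_dvd_pow (5 : ℤ) hle).trans (padicValInt_dvd _)⟩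
        rcases hres with ⟨h2, -⟩ | ⟨h3, -⟩ | ⟨h3, -⟩
        · exact Or.inl h2
        · exact Or.inr h3
        · exact Or.inr h3)

/-! ### The truncations `T_K = S₁'Trunc K`, `R_K = T₅Trunc K` (C0-SPEC G8): the same binders up to `10⁻⁶` -/

/-- On the height family, a pair with `5 ∤ A` and `ord₅(4A³+27B²) > K` lies in the tail
`{A ≡ 2, 3 (mod 5); 5^{K+1} ∣ 4A³+27B²}`: `E_{A,B}` is multiplicative at `5`, split (`A ≡ 3`) or
non-split (`A ≡ 2`). [cite: BhargavaSkinnerZhang2014, Lemma 18 (proof, pp. 8–9: "A ≡ 3 (mod 5)" split, "A ≡ 2 (mod 5)" non-split)] -/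
theorem tail_of_lt_padicValInt [Fact (Nat.Prime 5)] {AB : ℤ × ℤ} (hfam : IsInHeightFamily AB)
    (hA : ¬ (5 : ℤ) ∣ AB.1) {K : ℕ} (hK : K < padicValInt 5 (4 * AB.1 ^ 3 + 27 * AB.2 ^ 2)) :
    ((AB.1 : ZMod 5) = 2 ∨ (AB.1 : ZMod 5) = 3) ∧ (5 : ℤ) ^ (K + 1) ∣ 4 * AB.1 ^ 3 + 27 * AB.2 ^ 2 := by
  haveI := isElliptic_shortWeierstrass hfam
  have hfam5 : ¬ ((5 : ℤ) ^ 4 ∣ AB.1 ∧ (5 : ℤ) ^ 6 ∣ AB.2) := hfam.2 5 Nat.prime_five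
  have hle : K + 1 ≤ padicValInt 5 (4 * AB.1 ^ 3 + 27 * AB.2 ^ 2) := by omega
  have hdvd : (5 : ℤ) ^ (K + 1) ∣ 4 * AB.1 ^ 3 + 27 * AB.2 ^ 2 :=
    (pow_dvd_pow (5 : ℤ) hle).trans (padicValInt_dvd _)
  have hdisc : (5 : ℤ) ∣ 4 * AB.1 ^ 3 + 27 * AB.2 ^ 2 := (dvd_pow_self (5 : ℤ) (by omega)).trans hdvd
  have hmult : (shortWeierstrass AB).HasMultiplicativeReductionAtPrime 5 :=
    (hasMultiplicativeReductionAtPrime_shortWeierstrass_iff_of_isInHeightFamily 5 hfam le_rfl).mpr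
      ⟨by exact_mod_cast hdisc, by exact_mod_cast hA⟩
  refine ⟨?_, hdvd⟩
  by_cases hsplit : (shortWeierstrass AB).HasSplitMultiplicativeReductionAtPrime 5
  · exact Or.inr ((hasSplitMultiplicativeReductionAtPrime_five_shortWeierstrass_iff (AB := AB) hfam.1
      hfam5).mp hsplit).1
  · exact Or.inl ((hasMultiplicative_not_split_five_shortWeierstrass_iff (AB := AB) hfam.1 hfam5).mp
      ⟨hmult, hsplit⟩).1

/-- **The binder `hT` on the truncation `T_K = S₁'Trunc K` (`K ≥ 8`), up to the truncation
allowance `10⁻⁶`**: for every `η > 0`, eventually `(747265625/953369043 - 10⁻⁶ - η)·#{H < X} ≤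
#{H < X, E_{A,B} ∈ T_K}` — `T ⊆ T_K ∪ tail` on the height family, `hasHeightDensity_S₁'`,
`hasHeightDensity_mult_tail_five`, `mult_tail_density_le` (C0-SPEC G8: `T_K` is a finite `5`-adic
condition set, as a finite-union-of-large-families input wants). [cite: BhargavaSkinnerZhang2014, Lemma 18 (b) (p. 8; value corrected) and §3.2] -/
theorem hT_trunc_pieces {K : ℕ} (hK : 8 ≤ K) : ∀ η : ℝ, 0 < η → ∀ᶠ X : ℕ in atTop,
    (747265625 / 953369043 - 1 / 1000000 - η) * (heightFamilyBelow X).card ≤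
      ((heightFamilyBelow X).filter (S₁'Trunc K)).card :=
  haveI : Fact (Nat.Prime 5) := ⟨Nat.prime_five⟩
  eventually_mul_card_le_of_subset_union hasHeightDensity_S₁'
    (hasHeightDensity_mult_tail_five (K := K) (by omega)) (mult_tail_density_le hK)
    (fun AB hfam hS ↦ by
      by_cases hvK : padicValInt 5 (4 * AB.1 ^ 3 + 27 * AB.2 ^ 2) ≤ K
      · exact Or.inl ⟨hS, hvK⟩
      · exact Or.inr (tail_of_lt_padicValInt hfam hS.1 (by omega)))

/-- **The binder `hR` on the truncation `R_K = T₅Trunc K` (`K ≥ 8`), up to `10⁻⁶`** (below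
`tateUniformization_points`): for every `η > 0`, eventually `(78125/3813476172 - 10⁻⁶ - η)·#{H < X}
≤ #{H < X, E_{A,B} ∈ R_K}`. [cite: BhargavaSkinnerZhang2014, Cor. 26 (proof, p. 12: S₀(5) ∖ S₁'(5)) and Lemma 18 (proof)] -/
theorem hR_trunc_pieces (hTate : tateUniformization_points) {K : ℕ} (hK : 8 ≤ K) :
    ∀ η : ℝ, 0 < η → ∀ᶠ X : ℕ in atTop,
      (78125 / 3813476172 - 1 / 1000000 - η) * (heightFamilyBelow X).card ≤
        ((heightFamilyBelow X).filter (T₅Trunc K)).card :=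
  haveI : Fact (Nat.Prime 5) := ⟨Nat.prime_five⟩
  eventually_mul_card_le_of_subset_union (hasHeightDensity_T₅ hTate)
    (hasHeightDensity_mult_tail_five (K := K) (by omega)) (mult_tail_density_le hK)
    (fun AB hfam hR ↦ by
      by_cases hvK : padicValInt 5 (4 * AB.1 ^ 3 + 27 * AB.2 ^ 2) ≤ K
      · exact Or.inl ⟨hR, hvK⟩
      · exact Or.inr (tail_of_lt_padicValInt hfam hR.1 (by omega)))

/-- The tail density for `K ≥ 9` is at most `10⁻⁷` (`4/5^{11}·(1-5⁻¹⁰)⁻¹ = 8.19…·10⁻⁸`): a sharper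
truncation allowance, for assemblies whose constant has little margin. [cite: BhargavaSkinnerZhang2014, Cor. 26 (proof, pp. 11–12: the truncation allowances)] -/
theorem mult_tail_density_le_of_nine_le {K : ℕ} (hK : 9 ≤ K) :
    ((5 ^ (K + 1) * (2 * 5) : ℕ) : ℝ) / ((5 : ℝ) ^ (K + 2)) ^ 2 / (1 - 1 / (5 : ℝ) ^ 10) +
        ((5 ^ (K + 1) * (2 * 5) : ℕ) : ℝ) / ((5 : ℝ) ^ (K + 2)) ^ 2 / (1 - 1 / (5 : ℝ) ^ 10) ≤
      1 / 10000000 := by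
  have hc0 : (0 : ℝ) < 1 - 1 / (5 : ℝ) ^ 10 := by norm_num
  have hfK : ((5 ^ (K + 1) * (2 * 5) : ℕ) : ℝ) / ((5 : ℝ) ^ (K + 2)) ^ 2 / (1 - 1 / (5 : ℝ) ^ 10) =
      2 / 25 / (1 - 1 / (5 : ℝ) ^ 10) * (1 / 5 : ℝ) ^ K := by
    rw [one_div_pow]
    push_cast
    field_simp
    ring
  rw [hfK]
  have hpow : (1 / 5 : ℝ) ^ K ≤ (1 / 5 : ℝ) ^ 9 :=
    pow_le_pow_of_le_one (by norm_num) (by norm_num) hK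
  have h9 : 2 / 25 / (1 - 1 / (5 : ℝ) ^ 10) * (1 / 5 : ℝ) ^ 9 +
      2 / 25 / (1 - 1 / (5 : ℝ) ^ 10) * (1 / 5 : ℝ) ^ 9 ≤ 1 / 10000000 := by norm_num
  have hpos : 0 ≤ 2 / 25 / (1 - 1 / (5 : ℝ) ^ 10) := by positivity
  nlinarith [mul_le_mul_of_nonneg_left hpow hpos]

/-- `hT` on `T_K` with the sharper allowance `10⁻⁷` (`K ≥ 9`). [cite: BhargavaSkinnerZhang2014, Lemma 18 (b) (p. 8; value corrected) and §3.2] -/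
theorem hT_trunc_pieces' {K : ℕ} (hK : 9 ≤ K) : ∀ η : ℝ, 0 < η → ∀ᶠ X : ℕ in atTop,
    (747265625 / 953369043 - 1 / 10000000 - η) * (heightFamilyBelow X).card ≤
      ((heightFamilyBelow X).filter (S₁'Trunc K)).card :=
  haveI : Fact (Nat.Prime 5) := ⟨Nat.prime_five⟩
  eventually_mul_card_le_of_subset_union hasHeightDensity_S₁'
    (hasHeightDensity_mult_tail_five (K := K) (by omega)) (mult_tail_density_le_of_nine_le hK)
    (fun AB hfam hS ↦ by
      by_cases hvK : padicValInt 5 (4 * AB.1 ^ 3 + 27 * AB.2 ^ 2) ≤ K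
      · exact Or.inl ⟨hS, hvK⟩
      · exact Or.inr (tail_of_lt_padicValInt hfam hS.1 (by omega)))

/-- `hR` on `R_K` with the sharper allowance `10⁻⁷` (`K ≥ 9`; below `tateUniformization_points`).
[cite: BhargavaSkinnerZhang2014, Cor. 26 (proof, p. 12: S₀(5) ∖ S₁'(5)) and Lemma 18 (proof)] -/
theorem hR_trunc_pieces' (hTate : tateUniformization_points) {K : ℕ} (hK : 9 ≤ K) :
    ∀ η : ℝ, 0 < η → ∀ᶠ X : ℕ in atTop,
      (78125 / 3813476172 - 1 / 10000000 - η) * (heightFamilyBelow X).card ≤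
        ((heightFamilyBelow X).filter (T₅Trunc K)).card :=
  haveI : Fact (Nat.Prime 5) := ⟨Nat.prime_five⟩
  eventually_mul_card_le_of_subset_union (hasHeightDensity_T₅ hTate)
    (hasHeightDensity_mult_tail_five (K := K) (by omega)) (mult_tail_density_le_of_nine_le hK)
    (fun AB hfam hR ↦ by
      by_cases hvK : padicValInt 5 (4 * AB.1 ^ 3 + 27 * AB.2 ^ 2) ≤ K
      · exact Or.inl ⟨hR, hvK⟩
      · exact Or.inr (tail_of_lt_padicValInt hfam hR.1 (by omega)))

/-! ### `W = W₅`: the binder `hW` (density of `¬ W₅` is `0`), modulo Duke 1997 -/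

/-- **The binder `hW` of `bsz_rankLeOne_cRank_of_pieces` for `W := Pieces.W₅`, letter for letter,
granted Duke's theorem** (`Duke1997_exceptionalPrimes_densityZero`, the tree's named fact): for every
`η > 0`, eventually `#{H < X, E_{A,B} ∉ W₅} ≤ η·#{H < X}` — `ρ̄_{E,5}` is surjective off a density-`0`
set (`heightDensityGE_noExceptionalPrime_of_duke`), and two multiplicative primes `ℓ₁ ≠ ℓ₂ > 5` with
`5 ∤ ord_ℓ(4A³+27B²)` exist off a density-`0` set (Lemma 20: `heightDensityGE_hram₂_five`); intersect
(`HeightDensityGE.and_of_one`). [cite: BhargavaSkinnerZhang2014, Lemma 20 and its proof (p. 10)] [cite: Duke1997, Thm. 1 (p. 815)] -/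
theorem hW_pieces (hD : Duke1997_exceptionalPrimes_densityZero) :
    ∀ η : ℝ, 0 < η → ∀ᶠ X : ℕ in atTop,
      (((heightFamilyBelow X).filter (fun AB ↦ ¬ W₅ AB)).card : ℝ) ≤ η * (heightFamilyBelow X).card := by
  have hW : HeightDensityGE W₅ 1 := by
    intro ε hε
    refine (((heightDensityGE_noExceptionalPrime_of_duke hD).and_of_one
      heightDensityGE_hram₂_five) ε hε).mono fun X hX ↦ hX.trans (heightProportion_mono ?_ X)
    rintro AB ⟨hno, hram⟩
    refine ⟨?_, hram⟩
    have h5 := hno 5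
    unfold IsExceptionalPrime at h5
    rw [show ((5 : ℕ) : ℤ) = 5 from rfl] at h5
    by_contra hns
    exact h5 ⟨Nat.prime_five, hns⟩
  intro η hη
  filter_upwards [hW η hη] with X hX
  rw [heightProportion_eq_card_div] at hX
  have hsum : (((heightFamilyBelow X).filter W₅).card : ℝ) +
      ((heightFamilyBelow X).filter (fun AB ↦ ¬ W₅ AB)).card = (heightFamilyBelow X).card := by
    exact_mod_cast Finset.card_filter_add_card_filter_not W₅
  by_cases h0 : ((heightFamilyBelow X).card : ℝ) = 0
  · have hem : heightFamilyBelow X = ∅ := Finset.card_eq_zero.mp (by exact_mod_cast h0)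
    rw [hem, Finset.filter_empty, Finset.card_empty, Nat.cast_zero, mul_zero]
  · have hpos : 0 < ((heightFamilyBelow X).card : ℝ) :=
      lt_of_le_of_ne (Nat.cast_nonneg _) (Ne.symm h0)
    rw [le_div_iff₀ hpos] at hX
    linarith

end BhargavaSkinnerZhang2014.Pieces

end Literature.NumberTheory.EllipticCurves

end

noncomputable section

open Filter Topology

open scoped Classical
open scoped AddSubgroup

open WeierstrassCurve NumberField IsDedekindDomain

namespace Literature.NumberTheory.EllipticCurves.BhargavaSkinnerZhang2014.Pieces

open PadicValFive BSZSigmaSpl BhargavaSkinner2014 BhargavaShankar5Selmer2013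

/-! ### Residue data of congruent pairs -/

/-- Divisibility by a divisor of the modulus is a congruence invariant. [folklore] -/
private theorem dvd_iff_of_modEq {a b d n : ℤ} (h : a ≡ b [ZMOD n]) (hd : d ∣ n) : d ∣ a ↔ d ∣ b := by
  have h' := h.of_dvd hd
  constructor
  · intro ha; exact Int.modEq_zero_iff_dvd.1 (h'.symm.trans (Int.modEq_zero_iff_dvd.2 ha))
  · intro hb; exact Int.modEq_zero_iff_dvd.1 (h'.trans (Int.modEq_zero_iff_dvd.2 hb))

/-- The unconditional residue data of `(A, B) ≡ (A', B') (mod 5^{K+2})`: `A, B mod 5`, `A mod 25`,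
`5 ∣ A`, `5 ∣ 4A³+27B²`. [folklore] -/
private theorem residues_of_modEq {K : ℕ} {AB AB' : ℤ × ℤ}
    (hA : AB.1 ≡ AB'.1 [ZMOD (5 : ℤ) ^ (K + 2)]) (hB : AB.2 ≡ AB'.2 [ZMOD (5 : ℤ) ^ (K + 2)]) :
    ((AB.1 : ZMod 5) = (AB'.1 : ZMod 5)) ∧ ((AB.2 : ZMod 5) = (AB'.2 : ZMod 5)) ∧
      ((AB.1 : ZMod (5 ^ 2)) = (AB'.1 : ZMod (5 ^ 2))) ∧
      ((5 : ℤ) ∣ AB.1 ↔ (5 : ℤ) ∣ AB'.1) ∧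
      ((5 : ℤ) ∣ 4 * AB.1 ^ 3 + 27 * AB.2 ^ 2 ↔ (5 : ℤ) ∣ 4 * AB'.1 ^ 3 + 27 * AB'.2 ^ 2) := by
  have h5 : (5 : ℤ) ∣ (5 : ℤ) ^ (K + 2) := dvd_pow_self 5 (by omega)
  have hΔ := disc_modEq_of_modEq hA hB
  refine ⟨?_, ?_, intCast_zmod_eq_of_modEq_pow hA (by omega), dvd_iff_of_modEq hA h5,
    dvd_iff_of_modEq hΔ h5⟩
  · rw [ZMod.intCast_eq_intCast_iff]; push_cast; exact hA.of_dvd h5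
  · rw [ZMod.intCast_eq_intCast_iff]; push_cast; exact hB.of_dvd h5

/-- The residue data on the truncation: if moreover `ord₅(4A'³+27B'²) ≤ K`, then the two `ord₅` agree
and the unit parts agree modulo `25` (`PadicValFiveCongruenceProofs`). [cite: BhargavaSkinnerZhang2014, Lemma 18 (proof, p. 9: ord_p Δ(A,B) = k and Δ(A,B)/p^k mod p², read modulo p^{k+2})] -/
theorem ord_eq_and_unitPart_eq_of_modEq {K : ℕ} {AB AB' : ℤ × ℤ} (hfam' : IsInHeightFamily AB')
    (hA : AB.1 ≡ AB'.1 [ZMOD (5 : ℤ) ^ (K + 2)]) (hB : AB.2 ≡ AB'.2 [ZMOD (5 : ℤ) ^ (K + 2)])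
    (hv' : padicValInt 5 (4 * AB'.1 ^ 3 + 27 * AB'.2 ^ 2) ≤ K) :
    padicValInt 5 (4 * AB.1 ^ 3 + 27 * AB.2 ^ 2) = padicValInt 5 (4 * AB'.1 ^ 3 + 27 * AB'.2 ^ 2) ∧
      (((4 * AB.1 ^ 3 + 27 * AB.2 ^ 2) / 5 ^ padicValInt 5 (4 * AB'.1 ^ 3 + 27 * AB'.2 ^ 2) : ℤ) :
          ZMod (5 ^ 2)) =
        (((4 * AB'.1 ^ 3 + 27 * AB'.2 ^ 2) / 5 ^ padicValInt 5 (4 * AB'.1 ^ 3 + 27 * AB'.2 ^ 2) : ℤ) :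
          ZMod (5 ^ 2)) := by
  have hΔ := disc_modEq_of_modEq hA hB
  refine ⟨padicValInt_five_eq_of_modEq hΔ hfam'.1 (by omega), ?_⟩
  rw [ZMod.intCast_eq_intCast_iff]
  push_cast
  exact div_pow_padicValInt_five_modEq_of_modEq (e := 2) hΔ hfam'.1 (by omega)

/-! ### Membership in `T_K`, `R_K`, `SP'_K` only depends on `(A, B) mod 5^{K+2}` -/

/-- **`T_K = S₁'Trunc K` is a congruence condition modulo `5^{K+2}`** on the height family.
[cite: BhargavaSkinnerZhang2014, §3.1–3.2 (p. 8: S₁'(5) defined by congruence conditions) and Lemma 18 (proof, p. 9)] -/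
theorem S₁'Trunc_iff_of_modEq [Fact (Nat.Prime 5)] (K : ℕ) {AB AB' : ℤ × ℤ}
    (hfam : IsInHeightFamily AB) (hfam' : IsInHeightFamily AB')
    (hA : AB.1 ≡ AB'.1 [ZMOD (5 : ℤ) ^ (K + 2)]) (hB : AB.2 ≡ AB'.2 [ZMOD (5 : ℤ) ^ (K + 2)]) :
    S₁'Trunc K AB ↔ S₁'Trunc K AB' := by
  obtain ⟨hA5, hB5, hA25, hdA, hdD⟩ := residues_of_modEq hA hB
  have hΔ := disc_modEq_of_modEq hA hB
  have hvK := padicValInt_five_le_iff_of_modEq (K := K) hΔ hfam.1 hfam'.1 (by omega)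
  by_cases hv' : padicValInt 5 (4 * AB'.1 ^ 3 + 27 * AB'.2 ^ 2) ≤ K
  · obtain ⟨hv, hq⟩ := ord_eq_and_unitPart_eq_of_modEq hfam' hA hB hv'
    unfold S₁'Trunc
    rw [S₁'_iff_residues hfam, S₁'_iff_residues hfam', hv, hq, hA5, hB5, hA25, hdA, hdD]
  · constructor
    · rintro ⟨-, hv⟩; exact absurd (hvK.mp hv) hv'
    · rintro ⟨-, hv⟩; exact absurd hv hv'

/-- **`R_K = T₅Trunc K` is a congruence condition modulo `5^{K+2}`** on the height family (below
`tateUniformization_points`). [cite: BhargavaSkinnerZhang2014, Lemma 18 (proof, p. 9) and Cor. 26 (proof, p. 12: S₀(5) ∖ S₁'(5))] -/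
theorem T₅Trunc_iff_of_modEq [Fact (Nat.Prime 5)] (hTate : tateUniformization_points) (K : ℕ)
    {AB AB' : ℤ × ℤ} (hfam : IsInHeightFamily AB) (hfam' : IsInHeightFamily AB')
    (hA : AB.1 ≡ AB'.1 [ZMOD (5 : ℤ) ^ (K + 2)]) (hB : AB.2 ≡ AB'.2 [ZMOD (5 : ℤ) ^ (K + 2)]) :
    T₅Trunc K AB ↔ T₅Trunc K AB' := by
  obtain ⟨hA5, hB5, hA25, hdA, hdD⟩ := residues_of_modEq hA hB
  have hΔ := disc_modEq_of_modEq hA hB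
  have hvK := padicValInt_five_le_iff_of_modEq (K := K) hΔ hfam.1 hfam'.1 (by omega)
  by_cases hv' : padicValInt 5 (4 * AB'.1 ^ 3 + 27 * AB'.2 ^ 2) ≤ K
  · obtain ⟨hv, hq⟩ := ord_eq_and_unitPart_eq_of_modEq hfam' hA hB hv'
    unfold T₅Trunc
    rw [T₅_iff_residues hTate hfam, T₅_iff_residues hTate hfam', hv, hq, hA5, hB5, hA25]
  · constructor
    · rintro ⟨-, hv⟩; exact absurd (hvK.mp hv) hv'
    · rintro ⟨-, hv⟩; exact absurd hv hv'

/-- **`P = SP'_K` is a congruence condition modulo `5^{K+2}`** on the height family (below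
`tateUniformization_points`). [cite: BhargavaSkinnerZhang2014, Lemma 18 (proof, p. 9) and Cor. 26 (proof, p. 12: S₀(5) ∖ S₁'(5))] [cite: BhargavaSkinner2014, Prop 12 and proof of Lemma 16] -/
theorem SP'_iff_of_modEq [Fact (Nat.Prime 5)] (hTate : tateUniformization_points) (K : ℕ)
    {AB AB' : ℤ × ℤ} (hfam : IsInHeightFamily AB) (hfam' : IsInHeightFamily AB')
    (hA : AB.1 ≡ AB'.1 [ZMOD (5 : ℤ) ^ (K + 2)]) (hB : AB.2 ≡ AB'.2 [ZMOD (5 : ℤ) ^ (K + 2)]) :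
    SP' K AB ↔ SP' K AB' := by
  obtain ⟨hA5, hB5, hA25, hdA, hdD⟩ := residues_of_modEq hA hB
  have hΔ := disc_modEq_of_modEq hA hB
  have hvK := padicValInt_five_le_iff_of_modEq (K := K) hΔ hfam.1 hfam'.1 (by omega)
  by_cases hv' : padicValInt 5 (4 * AB'.1 ^ 3 + 27 * AB'.2 ^ 2) ≤ K
  · obtain ⟨hv, hq⟩ := ord_eq_and_unitPart_eq_of_modEq hfam' hA hB hv'
    rw [SP'_iff_residues hTate hfam K, SP'_iff_residues hTate hfam' K, hv, hq, hA5, hB5, hA25]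
  · constructor
    · intro h; exact absurd (hvK.mp h.padicValInt_le) hv'
    · intro h; exact absurd h.padicValInt_le hv'

/-! ### The pieces as finite `5`-adic condition sets modulo `5^{K+2}` (the `R`, `hRa`, `hRΔ` of A329) -/

/-- A predicate on the height family that is invariant under congruence modulo `5^{K+2}`, lies in
`S₀(5) = {5 ∤ A}` and in the truncation `ord₅ ≤ K` is the set `{(A, B) mod 5^{K+2} ∈ R}` for a finite
`R` all of whose integer lifts have `5 ∤ a` and `5^{K+2} ∤ 4a³ + 27b²`. [folklore] -/
private theorem exists_residues_of_invariant (K : ℕ) (Q : ℤ × ℤ → Prop)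
    (hQ : ∀ AB AB' : ℤ × ℤ, IsInHeightFamily AB → IsInHeightFamily AB' →
      AB.1 ≡ AB'.1 [ZMOD (5 : ℤ) ^ (K + 2)] → AB.2 ≡ AB'.2 [ZMOD (5 : ℤ) ^ (K + 2)] → (Q AB ↔ Q AB'))
    (hQa : ∀ AB, IsInHeightFamily AB → Q AB → ¬ (5 : ℤ) ∣ AB.1)
    (hQv : ∀ AB, IsInHeightFamily AB → Q AB → padicValInt 5 (4 * AB.1 ^ 3 + 27 * AB.2 ^ 2) ≤ K) :
    ∃ R : Finset (ZMod (5 ^ (K + 2)) × ZMod (5 ^ (K + 2))),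
      (∀ AB : ℤ × ℤ, IsInHeightFamily AB →
        (Q AB ↔ (((AB.1 : ℤ) : ZMod (5 ^ (K + 2))), ((AB.2 : ℤ) : ZMod (5 ^ (K + 2)))) ∈ R)) ∧
      (∀ a b : ℤ, (((a : ℤ) : ZMod (5 ^ (K + 2))), ((b : ℤ) : ZMod (5 ^ (K + 2)))) ∈ R →
        ¬ (5 : ℤ) ∣ a) ∧
      (∀ a b : ℤ, (((a : ℤ) : ZMod (5 ^ (K + 2))), ((b : ℤ) : ZMod (5 ^ (K + 2)))) ∈ R →
        ¬ ((5 : ℤ) ^ (K + 2) ∣ 4 * a ^ 3 + 27 * b ^ 2)) := by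
  haveI : NeZero (5 ^ (K + 2)) := ⟨pow_ne_zero _ (by norm_num)⟩
  refine ⟨(Finset.univ : Finset (ZMod (5 ^ (K + 2)) × ZMod (5 ^ (K + 2)))).filter
    (fun r ↦ ∃ AB : ℤ × ℤ, IsInHeightFamily AB ∧ Q AB ∧
      (((AB.1 : ℤ) : ZMod (5 ^ (K + 2))), ((AB.2 : ℤ) : ZMod (5 ^ (K + 2)))) = r), ?_, ?_, ?_⟩
  -- lifts of a residue pair of `R` are congruent to a member with `Q`
  · intro AB hfam
    rw [Finset.mem_filter]
    constructor
    · exact fun h ↦ ⟨Finset.mem_univ _, AB, hfam, h, rfl⟩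
    · rintro ⟨-, AB', hfam', hQ', hres⟩
      rw [Prod.mk.injEq, ZMod.intCast_eq_intCast_iff, ZMod.intCast_eq_intCast_iff] at hres
      push_cast at hres
      exact (hQ AB AB' hfam hfam' hres.1.symm hres.2.symm).mpr hQ'
  · rintro a b hab
    rw [Finset.mem_filter] at hab
    obtain ⟨-, AB', hfam', hQ', hres⟩ := hab
    rw [Prod.mk.injEq, ZMod.intCast_eq_intCast_iff, ZMod.intCast_eq_intCast_iff] at hres
    push_cast at hres
    rw [← dvd_iff_of_modEq hres.1 (dvd_pow_self 5 (by omega))]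
    exact hQa AB' hfam' hQ'
  · rintro a b hab
    rw [Finset.mem_filter] at hab
    obtain ⟨-, AB', hfam', hQ', hres⟩ := hab
    rw [Prod.mk.injEq, ZMod.intCast_eq_intCast_iff, ZMod.intCast_eq_intCast_iff] at hres
    push_cast at hres
    have hΔ := disc_modEq_of_modEq hres.1 hres.2
    rw [← dvd_iff_of_modEq hΔ dvd_rfl]
    intro hdvd
    have hv := hQv AB' hfam' hQ'
    rcases (padicValInt_dvd_iff (p := 5) (K + 2) (4 * AB'.1 ^ 3 + 27 * AB'.2 ^ 2)).mp
      (by exact_mod_cast hdvd) with h0 | hle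
    · exact hfam'.1 h0
    · omega

/-- **`T_K = S₁'Trunc K` as a finite `5`-adic condition set modulo `5^{K+2}`** on the height family,
inside `S₀(5)` and `ord₅ < K + 2` on every lift. [cite: BhargavaSkinnerZhang2014, §3.1–3.2 (p. 8) and Lemma 18 (proof, p. 9: classes modulo p^{k+2})] -/
theorem exists_residues_S₁'Trunc (K : ℕ) :
    ∃ R : Finset (ZMod (5 ^ (K + 2)) × ZMod (5 ^ (K + 2))),
      (∀ AB : ℤ × ℤ, IsInHeightFamily AB →
        (S₁'Trunc K AB ↔ (((AB.1 : ℤ) : ZMod (5 ^ (K + 2))), ((AB.2 : ℤ) : ZMod (5 ^ (K + 2)))) ∈ R)) ∧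
      (∀ a b : ℤ, (((a : ℤ) : ZMod (5 ^ (K + 2))), ((b : ℤ) : ZMod (5 ^ (K + 2)))) ∈ R →
        ¬ (5 : ℤ) ∣ a) ∧
      (∀ a b : ℤ, (((a : ℤ) : ZMod (5 ^ (K + 2))), ((b : ℤ) : ZMod (5 ^ (K + 2)))) ∈ R →
        ¬ ((5 : ℤ) ^ (K + 2) ∣ 4 * a ^ 3 + 27 * b ^ 2)) :=
  haveI : Fact (Nat.Prime 5) := ⟨Nat.prime_five⟩
  exists_residues_of_invariant K (S₁'Trunc K)
    (fun _ _ hfam hfam' hA hB ↦ S₁'Trunc_iff_of_modEq K hfam hfam' hA hB)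
    (fun _ _ h ↦ h.1.1) (fun _ _ h ↦ h.2)

/-- **`R_K = T₅Trunc K` as a finite `5`-adic condition set modulo `5^{K+2}`** on the height family
(below `tateUniformization_points`). [cite: BhargavaSkinnerZhang2014, Lemma 18 (proof, p. 9) and Cor. 26 (proof, p. 12)] -/
theorem exists_residues_T₅Trunc (hTate : tateUniformization_points) (K : ℕ) :
    ∃ R : Finset (ZMod (5 ^ (K + 2)) × ZMod (5 ^ (K + 2))),
      (∀ AB : ℤ × ℤ, IsInHeightFamily AB →
        (T₅Trunc K AB ↔ (((AB.1 : ℤ) : ZMod (5 ^ (K + 2))), ((AB.2 : ℤ) : ZMod (5 ^ (K + 2)))) ∈ R)) ∧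
      (∀ a b : ℤ, (((a : ℤ) : ZMod (5 ^ (K + 2))), ((b : ℤ) : ZMod (5 ^ (K + 2)))) ∈ R →
        ¬ (5 : ℤ) ∣ a) ∧
      (∀ a b : ℤ, (((a : ℤ) : ZMod (5 ^ (K + 2))), ((b : ℤ) : ZMod (5 ^ (K + 2)))) ∈ R →
        ¬ ((5 : ℤ) ^ (K + 2) ∣ 4 * a ^ 3 + 27 * b ^ 2)) :=
  haveI : Fact (Nat.Prime 5) := ⟨Nat.prime_five⟩
  exists_residues_of_invariant K (T₅Trunc K)
    (fun _ _ hfam hfam' hA hB ↦ T₅Trunc_iff_of_modEq hTate K hfam hfam' hA hB)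
    (fun _ _ h ↦ h.1.1) (fun _ _ h ↦ h.2)

/-- **`P = SP'_K` as a finite `5`-adic condition set modulo `5^{K+2}`** on the height family (below
`tateUniformization_points`) — the `R`, `hRa`, `hRΔ` (`m = K + 2`) of
`thm7_selmerResKer_equidistributed.sum_card_selmerResKer_sub_one_le_residues`, i.e. of the binder
`hlocP` of `bsz_rankLeOne_cRank_of_pieces` on `P`. [cite: BhargavaSkinner2014, Prop 12 and proof of Lemma 16 (finite union of ν-adic discs)] [cite: BhargavaSkinnerZhang2014, Cor. 26 (proof, p. 12)] -/
theorem exists_residues_SP' (hTate : tateUniformization_points) (K : ℕ) :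
    ∃ R : Finset (ZMod (5 ^ (K + 2)) × ZMod (5 ^ (K + 2))),
      (∀ AB : ℤ × ℤ, IsInHeightFamily AB →
        (SP' K AB ↔ (((AB.1 : ℤ) : ZMod (5 ^ (K + 2))), ((AB.2 : ℤ) : ZMod (5 ^ (K + 2)))) ∈ R)) ∧
      (∀ a b : ℤ, (((a : ℤ) : ZMod (5 ^ (K + 2))), ((b : ℤ) : ZMod (5 ^ (K + 2)))) ∈ R →
        ¬ (5 : ℤ) ∣ a) ∧
      (∀ a b : ℤ, (((a : ℤ) : ZMod (5 ^ (K + 2))), ((b : ℤ) : ZMod (5 ^ (K + 2)))) ∈ R →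
        ¬ ((5 : ℤ) ^ (K + 2) ∣ 4 * a ^ 3 + 27 * b ^ 2)) :=
  haveI : Fact (Nat.Prime 5) := ⟨Nat.prime_five⟩
  exists_residues_of_invariant K (SP' K)
    (fun _ _ hfam hfam' hA hB ↦ SP'_iff_of_modEq hTate K hfam hfam' hA hB)
    (fun _ _ h ↦ h.1) (fun _ _ h ↦ h.padicValInt_le)

/-! ### Residue-class families at `5`; `T_K` and the multiplicative tail as large congruence families -/

/-- **The congruence family cut out at `5` by a predicate `Q`** (Bhargava–Shankar's sense, the tree's
`CongruenceFamily`): exponent `m` at every prime, at `5` the residue pairs modulo `5^m` of the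
height-family members satisfying `Q`, no condition at the other primes and at infinity. For `Q`
invariant under congruence modulo `5^m` on the height family its members are exactly the family members
with `Q` (`mem_residueFamily_iff`). Used with `Q = S₁'Trunc K` (`m = K + 2`) and with the multiplicative
tail `{A ≡ 2, 3 (5); 5^{K+1} ∣ 4A³+27B²}` (`m = K + 1`).
[cite: BhargavaSkinnerZhang2014, §3.1–3.2 (p. 8: "defined by congruence conditions")] [cite: BhargavaSkinner2014, Prop 12 (the family F(W))] -/
def residueFamily (m : ℕ) (Q : ℤ × ℤ → Prop) : CongruenceFamily where
  expt _ := m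
  residues p := if p = 5 then
      {r | ∃ AB : ℤ × ℤ, IsInHeightFamily AB ∧ Q AB ∧
        (((AB.1 : ℤ) : ZMod (p ^ m)), ((AB.2 : ℤ) : ZMod (p ^ m))) = r}
    else Set.univ
  allowPos := True
  allowNeg := True

/-- A height-family member with `Q` belongs to `residueFamily m Q`. [cite: BhargavaSkinnerZhang2014, §3.1–3.2 (p. 8)] -/
theorem mem_residueFamily_of {m : ℕ} {Q : ℤ × ℤ → Prop} {AB : ℤ × ℤ} (hfam : IsInHeightFamily AB)
    (hQ : Q AB) : (residueFamily m Q).Mem AB := by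
  change IsInHeightFamily AB ∧
      (∀ p : ℕ, p.Prime →
        (((AB.1 : ℤ) : ZMod (p ^ m)), ((AB.2 : ℤ) : ZMod (p ^ m))) ∈
          (if p = 5 then
            {r | ∃ AB' : ℤ × ℤ, IsInHeightFamily AB' ∧ Q AB' ∧
              (((AB'.1 : ℤ) : ZMod (p ^ m)), ((AB'.2 : ℤ) : ZMod (p ^ m))) = r}
            else Set.univ)) ∧
      (0 < -(4 * AB.1 ^ 3 + 27 * AB.2 ^ 2) → True) ∧
      (-(4 * AB.1 ^ 3 + 27 * AB.2 ^ 2) < 0 → True)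
  refine ⟨hfam, fun p hp ↦ ?_, fun _ ↦ trivial, fun _ ↦ trivial⟩
  by_cases hp5 : p = 5
  · subst hp5
    rw [if_pos rfl, Set.mem_setOf_eq]
    exact ⟨AB, hfam, hQ, rfl⟩
  · rw [if_neg hp5]
    exact Set.mem_univ _

/-- **Membership in `residueFamily m Q`** for `Q` invariant under congruence modulo `5^m` on the height
family: exactly the height-family members with `Q`. [cite: BhargavaSkinnerZhang2014, §3.1–3.2 (p. 8)] -/
theorem mem_residueFamily_iff {m : ℕ} {Q : ℤ × ℤ → Prop}
    (hQ : ∀ AB AB' : ℤ × ℤ, IsInHeightFamily AB → IsInHeightFamily AB' →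
      AB.1 ≡ AB'.1 [ZMOD (5 : ℤ) ^ m] → AB.2 ≡ AB'.2 [ZMOD (5 : ℤ) ^ m] → (Q AB ↔ Q AB'))
    (AB : ℤ × ℤ) : (residueFamily m Q).Mem AB ↔ IsInHeightFamily AB ∧ Q AB := by
  refine ⟨fun h ↦ ?_, fun h ↦ mem_residueFamily_of h.1 h.2⟩
  change (IsInHeightFamily AB ∧
      (∀ p : ℕ, p.Prime →
        (((AB.1 : ℤ) : ZMod (p ^ m)), ((AB.2 : ℤ) : ZMod (p ^ m))) ∈
          (if p = 5 then
            {r | ∃ AB' : ℤ × ℤ, IsInHeightFamily AB' ∧ Q AB' ∧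
              (((AB'.1 : ℤ) : ZMod (p ^ m)), ((AB'.2 : ℤ) : ZMod (p ^ m))) = r}
            else Set.univ)) ∧
      (0 < -(4 * AB.1 ^ 3 + 27 * AB.2 ^ 2) → True) ∧
      (-(4 * AB.1 ^ 3 + 27 * AB.2 ^ 2) < 0 → True)) at h
  obtain ⟨hH, hres, -, -⟩ := h
  have h5 := hres 5 Nat.prime_five
  rw [if_pos rfl, Set.mem_setOf_eq] at h5
  obtain ⟨AB', hfam', hQ', hr⟩ := h5
  rw [Prod.mk.injEq, ZMod.intCast_eq_intCast_iff, ZMod.intCast_eq_intCast_iff] at hr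
  push_cast at hr
  exact ⟨hH, (hQ AB AB' hH hfam' hr.1.symm hr.2.symm).mpr hQ'⟩

/-- **`residueFamily m Q` is large as soon as it contains a disc `(a₀, b₀) + 5^m ℤ₅²` with `5 ∤ a₀`**
(`discFamily 5 m a₀ b₀`, large by `isLarge_discFamily`).
[cite: BhargavaSkinner2014, Prop 12 ("the corresponding (large) family F(W)")] -/
theorem isLarge_residueFamily {m : ℕ} {Q : ℤ × ℤ → Prop} {a₀ : ℤ} (b₀ : ℤ) (ha₀ : ¬ (5 : ℤ) ∣ a₀)
    (hdisc : ∀ AB : ℤ × ℤ, IsInHeightFamily AB → AB.1 ≡ a₀ [ZMOD (5 : ℤ) ^ m] →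
      AB.2 ≡ b₀ [ZMOD (5 : ℤ) ^ m] → Q AB) :
    (residueFamily m Q).IsLarge := by
  obtain ⟨p₀, hp₀⟩ := isLarge_discFamily Nat.prime_five (by norm_num) m (a₀ := a₀) b₀
    (by exact_mod_cast ha₀)
  refine ⟨p₀, fun p hp hpp a b j hΔ ↦ ?_⟩
  obtain ⟨AB, hmem, h1, h2⟩ := hp₀ p hp hpp a b j hΔ
  obtain ⟨hfam, hA, hB⟩ := (mem_discFamily_iff Nat.prime_five m a₀ b₀ AB).mp hmem
  exact ⟨AB, mem_residueFamily_of hfam (hdisc AB hfam (by exact_mod_cast hA) (by exact_mod_cast hB)),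
    h1, h2⟩

/-- **`T_K = S₁'Trunc K` is the large congruence family `residueFamily (K+2) (S₁'Trunc K)`**: its
members are the height-family members of `T_K` (`S₁'Trunc_iff_of_modEq`), and it contains the disc
`(1, 0) + 5^{K+2} ℤ₅²` of good reduction at `5` (`A ≡ 1`, `4A³ + 27B² ≡ 4 (mod 5)`: in `S₁'(5)` with
`ord₅ = 0`). [cite: BhargavaSkinnerZhang2014, §3.1–3.2 (p. 8)] [cite: BhargavaSkinner2014, Prop 12] -/
theorem mem_residueFamily_S₁'Trunc_iff (K : ℕ) (AB : ℤ × ℤ) :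
    (residueFamily (K + 2) (S₁'Trunc K)).Mem AB ↔ IsInHeightFamily AB ∧ S₁'Trunc K AB :=
  haveI : Fact (Nat.Prime 5) := ⟨Nat.prime_five⟩
  mem_residueFamily_iff (fun _ _ hfam hfam' hA hB ↦ S₁'Trunc_iff_of_modEq K hfam hfam' hA hB) AB

/-- See `mem_residueFamily_S₁'Trunc_iff`. [cite: BhargavaSkinner2014, Prop 12 ("(large) family")] -/
theorem isLarge_residueFamily_S₁'Trunc (K : ℕ) : (residueFamily (K + 2) (S₁'Trunc K)).IsLarge := by
  haveI : Fact (Nat.Prime 5) := ⟨Nat.prime_five⟩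
  refine isLarge_residueFamily (a₀ := 1) 0 (by norm_num) fun AB hfam hA1 hB0 ↦ ?_
  have h5 : (5 : ℤ) ∣ (5 : ℤ) ^ (K + 2) := dvd_pow_self 5 (by omega)
  have hA : ¬ (5 : ℤ) ∣ AB.1 := by
    rw [dvd_iff_of_modEq hA1 h5]; norm_num
  have hdisc : ¬ (5 : ℤ) ∣ 4 * AB.1 ^ 3 + 27 * AB.2 ^ 2 := by
    rw [dvd_iff_of_modEq (disc_modEq_of_modEq hA1 hB0) h5]; norm_num
  refine ⟨S₁'_of_not_dvd_disc hfam hA hdisc, ?_⟩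
  rw [padicValInt.eq_zero_of_not_dvd (by exact_mod_cast hdisc)]
  exact Nat.zero_le K

/-- **The multiplicative tail `{A ≡ 2, 3 (mod 5); 5^{K+1} ∣ 4A³+27B²}` is the large congruence family
`residueFamily (K+1) _`**: the predicate is a congruence condition modulo `5^{K+1}`, and the family
contains the disc `(-3, 2) + 5^{K+1} ℤ₅²` (`4·(-3)³ + 27·2² = 0`, `-3 ≡ 2 (mod 5)`).
[cite: BhargavaSkinnerZhang2014, Lemma 18 (proof, p. 9: the tail k > K)] [cite: BhargavaSkinner2014, Prop 12] -/
theorem mem_residueFamily_multTail_iff (K : ℕ) (AB : ℤ × ℤ) :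
    (residueFamily (K + 1) (fun AB : ℤ × ℤ ↦ ((AB.1 : ZMod 5) = 2 ∨ (AB.1 : ZMod 5) = 3) ∧
        (5 : ℤ) ^ (K + 1) ∣ 4 * AB.1 ^ 3 + 27 * AB.2 ^ 2)).Mem AB ↔
      IsInHeightFamily AB ∧ (((AB.1 : ZMod 5) = 2 ∨ (AB.1 : ZMod 5) = 3) ∧
        (5 : ℤ) ^ (K + 1) ∣ 4 * AB.1 ^ 3 + 27 * AB.2 ^ 2) := by
  refine mem_residueFamily_iff (fun AB AB' _ _ hA hB ↦ ?_) AB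
  have h5 : (5 : ℤ) ∣ (5 : ℤ) ^ (K + 1) := dvd_pow_self 5 (by omega)
  have hA5 : (AB.1 : ZMod 5) = (AB'.1 : ZMod 5) := by
    rw [ZMod.intCast_eq_intCast_iff]; push_cast; exact hA.of_dvd h5
  rw [hA5, dvd_iff_of_modEq (disc_modEq_of_modEq hA hB) dvd_rfl]

/-- See `mem_residueFamily_multTail_iff`. [cite: BhargavaSkinner2014, Prop 12 ("(large) family")] -/
theorem isLarge_residueFamily_multTail (K : ℕ) :
    (residueFamily (K + 1) (fun AB : ℤ × ℤ ↦ ((AB.1 : ZMod 5) = 2 ∨ (AB.1 : ZMod 5) = 3) ∧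
        (5 : ℤ) ^ (K + 1) ∣ 4 * AB.1 ^ 3 + 27 * AB.2 ^ 2)).IsLarge := by
  refine isLarge_residueFamily (a₀ := -3) 2 (by norm_num) fun AB _ hA hB ↦ ?_
  have h5 : (5 : ℤ) ∣ (5 : ℤ) ^ (K + 1) := dvd_pow_self 5 (by omega)
  refine ⟨Or.inl ?_, ?_⟩
  · have h' : ((AB.1 : ℤ) : ZMod 5) = ((-3 : ℤ) : ZMod 5) := by
      rw [ZMod.intCast_eq_intCast_iff]; push_cast; exact hA.of_dvd h5
    rw [h']; push_cast; decide
  · rw [dvd_iff_of_modEq (disc_modEq_of_modEq hA hB) dvd_rfl]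
    norm_num

/-! ### The binder `h13T` from A330: on `T_K`, and on the FULL `T = S₁'(5)` -/

/-- **`h13T` on the truncation `T_K = S₁'Trunc K`, from A330** (Bhargava–Shankar Thm 31 as the named
fact `thm31_heightAverageOn_card_selmerFive_le_six`, through `.sum_card_selmerFive_le` on the ONE large
family `residueFamily (K+2) (S₁'Trunc K)`): for every `η > 0`, eventually
`Σ_{E_{A,B} ∈ T_K, H < X} #Sel₅(E_{A,B}) ≤ (6 + η)·#{E_{A,B} ∈ T_K, H < X}`.
[cite: BhargavaShankar5Selmer2013, Thm 31] [cite: BhargavaSkinnerZhang2014, Thm 13 and §3.2] -/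
theorem h13T_trunc (h31 : thm31_heightAverageOn_card_selmerFive_le_six) (K : ℕ) :
    ∀ η : ℝ, 0 < η → ∀ᶠ X : ℕ in atTop,
      ∑ AB ∈ (heightFamilyBelow X).filter (S₁'Trunc K),
          (Nat.card ((shortWeierstrass AB).selmerGroup 5) : ℝ) ≤
        (6 + η) * ((heightFamilyBelow X).filter (S₁'Trunc K)).card := by
  have h := thm31_heightAverageOn_card_selmerFive_le_six.sum_card_selmerFive_le h31
    (residueFamily (K + 2) (S₁'Trunc K)) (isLarge_residueFamily_S₁'Trunc K)
  have hfilter : ∀ X : ℕ, (heightFamilyBelow X).filter (residueFamily (K + 2) (S₁'Trunc K)).Mem =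
      (heightFamilyBelow X).filter (S₁'Trunc K) := fun X ↦
    Finset.filter_congr fun AB hAB ↦ by
      rw [mem_residueFamily_S₁'Trunc_iff]
      exact ⟨fun h ↦ h.2, fun h ↦ ⟨((mem_heightFamilyBelow_iff AB X).mp hAB).1, h⟩⟩
  intro η hη
  exact (h η hη).mono fun X hX ↦ by rw [← hfilter X]; exact hX

/-- `h13` on the multiplicative tail `{A ≡ 2, 3 (5); 5^{K+1} ∣ 4A³+27B²}` (a large congruence family),
from A330. [cite: BhargavaShankar5Selmer2013, Thm 31] -/
theorem h13_multTail (h31 : thm31_heightAverageOn_card_selmerFive_le_six) (K : ℕ) :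
    ∀ η : ℝ, 0 < η → ∀ᶠ X : ℕ in atTop,
      ∑ AB ∈ (heightFamilyBelow X).filter (fun AB : ℤ × ℤ ↦
          ((AB.1 : ZMod 5) = 2 ∨ (AB.1 : ZMod 5) = 3) ∧ (5 : ℤ) ^ (K + 1) ∣ 4 * AB.1 ^ 3 + 27 * AB.2 ^ 2),
          (Nat.card ((shortWeierstrass AB).selmerGroup 5) : ℝ) ≤
        (6 + η) * ((heightFamilyBelow X).filter (fun AB : ℤ × ℤ ↦
          ((AB.1 : ZMod 5) = 2 ∨ (AB.1 : ZMod 5) = 3) ∧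
            (5 : ℤ) ^ (K + 1) ∣ 4 * AB.1 ^ 3 + 27 * AB.2 ^ 2)).card := by
  have h := thm31_heightAverageOn_card_selmerFive_le_six.sum_card_selmerFive_le h31 _
    (isLarge_residueFamily_multTail K)
  have hfilter : ∀ X : ℕ, (heightFamilyBelow X).filter (residueFamily (K + 1)
      (fun AB : ℤ × ℤ ↦ ((AB.1 : ZMod 5) = 2 ∨ (AB.1 : ZMod 5) = 3) ∧
        (5 : ℤ) ^ (K + 1) ∣ 4 * AB.1 ^ 3 + 27 * AB.2 ^ 2)).Mem =
      (heightFamilyBelow X).filter (fun AB : ℤ × ℤ ↦ ((AB.1 : ZMod 5) = 2 ∨ (AB.1 : ZMod 5) = 3) ∧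
        (5 : ℤ) ^ (K + 1) ∣ 4 * AB.1 ^ 3 + 27 * AB.2 ^ 2) := fun X ↦
    Finset.filter_congr fun AB hAB ↦ by
      rw [mem_residueFamily_multTail_iff]
      exact ⟨fun h ↦ h.2, fun h ↦ ⟨((mem_heightFamilyBelow_iff AB X).mp hAB).1, h⟩⟩
  intro η hη
  exact (h η hη).mono fun X hX ↦ by rw [← hfilter X]; exact hX

/-- From a height density to an upper bound in binder form (private twin of the lemma in
`PiecesDensityProofs`). [folklore] -/
private theorem eventually_card_le_mul' {P : ℤ × ℤ → Prop} {μ : ℝ}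
    (hP : HasHeightDensity P μ) (η : ℝ) (hη : 0 < η) :
    ∀ᶠ X : ℕ in atTop,
      (((heightFamilyBelow X).filter P).card : ℝ) ≤ (μ + η) * (heightFamilyBelow X).card := by
  obtain ⟨N, hN⟩ := (Metric.tendsto_atTop.mp hP) η hη
  filter_upwards [eventually_ge_atTop N] with X hX
  have hd := hN X hX
  rw [Real.dist_eq, abs_lt, heightProportion_eq_card_div] at hd
  by_cases h0 : ((heightFamilyBelow X).card : ℝ) = 0
  · have h0' : heightFamilyBelow X = ∅ := Finset.card_eq_zero.mp (by exact_mod_cast h0)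
    rw [h0', Finset.filter_empty, Finset.card_empty, Nat.cast_zero, mul_zero]
  · have hpos : 0 < ((heightFamilyBelow X).card : ℝ) :=
      lt_of_le_of_ne (Nat.cast_nonneg _) (Ne.symm h0)
    have h2 := hd.2
    rw [sub_lt_iff_lt_add, div_lt_iff₀ hpos] at h2
    linarith

/-- **The binder `h13T` of `bsz_rankLeOne_cRank_of_pieces` for the FULL piece `T := Pieces.S₁'`, from
A330**: for every `η > 0`, eventually `Σ_{E_{A,B} ∈ S₁'(5), H < X} #Sel₅(E_{A,B}) ≤ (6 + η)·#{E_{A,B} ∈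
S₁'(5), H < X}` — although `S₁'(5)` is not one congruence family (the condition `5 ∤ k` involves every
level `k`). Proof: `T ⊆ T_K ∪ tail_K` on the height family (`tail_of_lt_padicValInt`), A330 on the two
large families `T_K` and `tail_K` (`h13T_trunc`, `h13_multTail` with `η = 1`), the tail has height
density `4/5^{K+2}·(1-5⁻¹⁰)⁻¹ → 0` (`hasHeightDensity_mult_tail_five`) while `T` has positive density
(`hT_pieces`): choose `K` with `5^{-K} ≤ η·μ(S₁')/…`.
[cite: BhargavaShankar5Selmer2013, Thm 31] [cite: BhargavaSkinnerZhang2014, Thm 13, Lemma 18 and §3.2 (averages over S₀(5) ∩ S₁'(5))] -/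
theorem h13T_pieces (h31 : thm31_heightAverageOn_card_selmerFive_le_six) :
    ∀ η : ℝ, 0 < η → ∀ᶠ X : ℕ in atTop,
      ∑ AB ∈ (heightFamilyBelow X).filter S₁',
          (Nat.card ((shortWeierstrass AB).selmerGroup 5) : ℝ) ≤
        (6 + η) * ((heightFamilyBelow X).filter S₁').card := by
  haveI : Fact (Nat.Prime 5) := ⟨Nat.prime_five⟩
  intro η hη
  -- `δ = η·μ(S₁')/56`; `K ≥ 1` with tail density `τ_K = (4/25)(1-5⁻¹⁰)⁻¹·5^{-K} ≤ δ`
  have hc0 : (0 : ℝ) < 1 - 1 / (5 : ℝ) ^ 10 := by norm_num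
  have hδ0 : (0 : ℝ) < η * (747265625 / 953369043) / 56 := by positivity
  have hq0 : (0 : ℝ) < 4 / 25 / (1 - 1 / (5 : ℝ) ^ 10) := div_pos (by norm_num) hc0
  obtain ⟨K₀, hK₀⟩ := exists_pow_lt_of_lt_one (div_pos hδ0 hq0) (show (1 / 5 : ℝ) < 1 by norm_num)
  set K : ℕ := K₀ + 1 with hK
  have hK1 : 1 ≤ K := by omega
  set τ : ℝ := ((5 ^ (K + 1) * (2 * 5) : ℕ) : ℝ) / ((5 : ℝ) ^ (K + 2)) ^ 2 / (1 - 1 / (5 : ℝ) ^ 10) +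
    ((5 ^ (K + 1) * (2 * 5) : ℕ) : ℝ) / ((5 : ℝ) ^ (K + 2)) ^ 2 / (1 - 1 / (5 : ℝ) ^ 10) with hτ
  have hτK : τ = 4 / 25 / (1 - 1 / (5 : ℝ) ^ 10) * (1 / 5 : ℝ) ^ K := by
    have hc' : (1 - 1 / (5 : ℝ) ^ 10) ≠ 0 := hc0.ne'
    rw [hτ, one_div_pow]; push_cast; field_simp; ring
  have hτδ : τ ≤ η * (747265625 / 953369043) / 56 := by
    rw [hτK]
    have h1 : (1 / 5 : ℝ) ^ K ≤ (1 / 5 : ℝ) ^ K₀ :=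
      pow_le_pow_of_le_one (by norm_num) (by norm_num) (by omega)
    have h2 : 4 / 25 / (1 - 1 / (5 : ℝ) ^ 10) * (1 / 5 : ℝ) ^ K₀ <
        η * (747265625 / 953369043) / 56 := by
      have := hK₀
      rwa [lt_div_iff₀ hq0, mul_comm] at this
    nlinarith [hq0.le]
  -- the four eventual inputs
  have hTK := h13T_trunc h31 K (η / 2) (by linarith)
  have htail := h13_multTail h31 K 1 one_pos
  have htaild := eventually_card_le_mul' (hasHeightDensity_mult_tail_five (K := K) hK1)
    (η * (747265625 / 953369043) / 56) hδ0
  have hTd := hT_pieces (747265625 / 953369043 / 2) (by norm_num)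
  filter_upwards [hTK, htail, htaild, hTd] with X hTKX htailX htaildX hTdX
  -- abbreviations
  set f : ℤ × ℤ → ℝ := fun AB ↦ (Nat.card ((shortWeierstrass AB).selmerGroup 5) : ℝ) with hf
  set sT := (heightFamilyBelow X).filter S₁' with hsT
  set sK := (heightFamilyBelow X).filter (S₁'Trunc K) with hsK
  set st := (heightFamilyBelow X).filter (fun AB : ℤ × ℤ ↦
    ((AB.1 : ZMod 5) = 2 ∨ (AB.1 : ZMod 5) = 3) ∧ (5 : ℤ) ^ (K + 1) ∣ 4 * AB.1 ^ 3 + 27 * AB.2 ^ 2)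
    with hst
  have hf0 : ∀ AB, 0 ≤ f AB := fun AB ↦ Nat.cast_nonneg _
  -- `T ⊆ T_K ∪ tail_K` and `T_K ⊆ T`
  have hsub : sT ⊆ sK ∪ st := by
    intro AB hAB
    rw [hsT, Finset.mem_filter] at hAB
    rw [Finset.mem_union, hsK, hst, Finset.mem_filter, Finset.mem_filter]
    have hfam : IsInHeightFamily AB := ((mem_heightFamilyBelow_iff AB X).mp hAB.1).1
    by_cases hvK : padicValInt 5 (4 * AB.1 ^ 3 + 27 * AB.2 ^ 2) ≤ K
    · exact Or.inl ⟨hAB.1, hAB.2, hvK⟩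
    · exact Or.inr ⟨hAB.1, tail_of_lt_padicValInt hfam hAB.2.1 (by omega)⟩
  have hKT : sK ⊆ sT := by
    intro AB hAB
    rw [hsK, Finset.mem_filter] at hAB
    rw [hsT, Finset.mem_filter]
    exact ⟨hAB.1, hAB.2.1⟩
  have hsum : ∑ AB ∈ sT, f AB ≤ ∑ AB ∈ sK, f AB + ∑ AB ∈ st, f AB := by
    have hu : ∑ AB ∈ sT, f AB ≤ ∑ AB ∈ sK ∪ st, f AB :=
      Finset.sum_le_sum_of_subset_of_nonneg hsub fun AB _ _ ↦ hf0 AB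
    have hui := Finset.sum_union_inter (s₁ := sK) (s₂ := st) (f := f)
    have hi : 0 ≤ ∑ AB ∈ sK ∩ st, f AB := Finset.sum_nonneg fun AB _ ↦ hf0 AB
    linarith
  have hcardK : (sK.card : ℝ) ≤ sT.card := by exact_mod_cast Finset.card_le_card hKT
  have hN : (0 : ℝ) ≤ (heightFamilyBelow X).card := Nat.cast_nonneg _
  -- arithmetic: `Σ_{T_K} ≤ (6 + η/2)·#T`, `Σ_{tail} ≤ 7·#tail ≤ 14 δ N ≤ (η/2)·#T`
  have h1 : ∑ AB ∈ sK, f AB ≤ (6 + η / 2) * sT.card :=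
    hTKX.trans (mul_le_mul_of_nonneg_left hcardK (by linarith))
  have h2 : ∑ AB ∈ st, f AB ≤ 7 * st.card := htailX.trans_eq (by norm_num)
  -- (the tail count of `htaildX` is `st.card` up to the decidability instance of the filter)
  have h3' : (st.card : ℝ) ≤
      (τ + η * (747265625 / 953369043) / 56) * (heightFamilyBelow X).card := by
    convert htaildX using 4
  have h3 : (st.card : ℝ) ≤ 2 * (η * (747265625 / 953369043) / 56) * (heightFamilyBelow X).card := by
    have := mul_le_mul_of_nonneg_right hτδ hN
    linarith
  have h4 : η / 2 * (747265625 / 953369043 / 2 * ((heightFamilyBelow X).card : ℝ)) ≤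
      η / 2 * sT.card :=
    mul_le_mul_of_nonneg_left (by linarith) (by linarith)
  have h5 : 7 * (st.card : ℝ) ≤ η / 2 * sT.card := by linarith
  calc ∑ AB ∈ sT, f AB ≤ ∑ AB ∈ sK, f AB + ∑ AB ∈ st, f AB := hsum
    _ ≤ (6 + η / 2) * sT.card + η / 2 * sT.card := by linarith
    _ = (6 + η) * sT.card := by ring

/-! ### The binders `hU`, `hUflip`, `hκU` (on `T_K`) and `hU₀`, `hU₀flip`, `hκU₀` (on `R_K`) from A328 -/

/-- `residueFamily m Q` imposes no residue condition at the primes `p ≢ 1 (mod 4)` (indeed at no prime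
`≠ 5`) — hypothesis `_h4` of A328. [cite: BhargavaSkinnerZhang2014, §2.3–2.4 (Thm. 16: conditions at p ≡ 1 (mod 4) only)] -/
theorem residueFamily_residues_eq_univ (m : ℕ) (Q : ℤ × ℤ → Prop) (p : ℕ) (hp : p % 4 ≠ 1) :
    (residueFamily m Q).residues p = Set.univ := by
  have hp5 : p ≠ 5 := by rintro rfl; exact hp rfl
  show (if p = 5 then _ else _) = _
  rw [if_neg hp5]
  rfl

/-- **`R_K = T₅Trunc K` is the large congruence family `residueFamily (K+2) (T₅Trunc K)`** (below
`tateUniformization_points`, `K ≥ 8`): membership by `T₅Trunc_iff_of_modEq`; largeness because `R_K`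
has POSITIVE lower density (`hR_trunc_pieces`: `μ(T₅) - 10⁻⁶ > 0`), hence a member `(A₀, B₀)`, whose
disc `(A₀, B₀) + 5^{K+2}ℤ₅²` lies in `R_K` by congruence invariance.
[cite: BhargavaSkinnerZhang2014, Cor. 26 (proof, p. 12)] [cite: BhargavaSkinner2014, Prop 12] -/
theorem mem_residueFamily_T₅Trunc_iff (hTate : tateUniformization_points) (K : ℕ) (AB : ℤ × ℤ) :
    (residueFamily (K + 2) (T₅Trunc K)).Mem AB ↔ IsInHeightFamily AB ∧ T₅Trunc K AB :=
  haveI : Fact (Nat.Prime 5) := ⟨Nat.prime_five⟩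
  mem_residueFamily_iff (fun _ _ hfam hfam' hA hB ↦ T₅Trunc_iff_of_modEq hTate K hfam hfam' hA hB) AB

/-- See `mem_residueFamily_T₅Trunc_iff`. [cite: BhargavaSkinner2014, Prop 12 ("(large) family")] -/
theorem isLarge_residueFamily_T₅Trunc (hTate : tateUniformization_points) {K : ℕ} (hK : 8 ≤ K) :
    (residueFamily (K + 2) (T₅Trunc K)).IsLarge := by
  haveI : Fact (Nat.Prime 5) := ⟨Nat.prime_five⟩
  -- a member of `R_K`, from its positive lower density
  have hev := hR_trunc_pieces hTate hK (78125 / 3813476172 / 2) (by norm_num)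
  obtain ⟨X, hX, hN⟩ := (hev.and eventually_heightFamilyBelow_card_pos).exists
  have hpos : (0 : ℝ) < ((heightFamilyBelow X).filter (T₅Trunc K)).card := by
    have hN' : (0 : ℝ) < (heightFamilyBelow X).card := by exact_mod_cast hN
    have : (0 : ℝ) < (78125 / 3813476172 - 1 / 1000000 - 78125 / 3813476172 / 2) *
        (heightFamilyBelow X).card := mul_pos (by norm_num) hN'
    linarith
  obtain ⟨AB₀, hAB₀⟩ := Finset.card_pos.mp (by exact_mod_cast hpos)
  rw [Finset.mem_filter] at hAB₀
  have hfam₀ : IsInHeightFamily AB₀ := ((mem_heightFamilyBelow_iff AB₀ X).mp hAB₀.1).1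
  refine isLarge_residueFamily (a₀ := AB₀.1) AB₀.2 hAB₀.2.1.1 fun AB hfam hA hB ↦ ?_
  exact (T₅Trunc_iff_of_modEq hTate K hfam hfam₀ hA hB).mpr hAB₀.2

/-- **The binders `hUT`, `hU`, `hUflip`, `hκU` of `bsz_rankLeOne_cRank_of_pieces` for `T := S₁'Trunc K`,
from A328** (`thm16_exists_rootNumber_twist_subfamily_of_twistStable`, BSZ Thm. 16 as used in the proof
of Cor. 26: "a finite union `F′` of large subfamilies in `S₀(5) ∩ S₁′(5)` of density `κμ(S₀(5) ∩ S₁′(5))`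
with `κ ≥ .5501` … the root number of `E` and its `−1`-twist have opposite signs"), applied to the ONE
large, twist-stable congruence family `T_K` (`residueFamily (K+2) (S₁'Trunc K)`; `S₁'Trunc.negB`).
[cite: BhargavaSkinnerZhang2014, Thm. 16 (§2.4, p. 6) and proof of Cor. 26 (p. 11)] -/
theorem exists_twistSubfamily_S₁'Trunc (h16 : thm16_exists_rootNumber_twist_subfamily_of_twistStable)
    (K : ℕ) :
    ∃ U : ℤ × ℤ → Prop,
      (∀ AB, U AB → S₁'Trunc K AB) ∧ (∀ AB, U AB → U (negB AB)) ∧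
      (∀ AB, U AB → (shortWeierstrass (negB AB)).rootNumber = -(shortWeierstrass AB).rootNumber) ∧
      ∀ η : ℝ, 0 < η → ∀ᶠ X : ℕ in atTop,
        (0.5501 - η) * ((heightFamilyBelow X).filter (S₁'Trunc K)).card ≤
          ((heightFamilyBelow X).filter U).card := by
  haveI : Fact (Nat.Prime 5) := ⟨Nat.prime_five⟩
  obtain ⟨U, hUF, hUneg, hflip, hdens⟩ :=
    thm16_exists_rootNumber_twist_subfamily_of_twistStable.exists_subfamily h16
      (residueFamily (K + 2) (S₁'Trunc K)) (isLarge_residueFamily_S₁'Trunc K)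
      (fun p _ hp ↦ residueFamily_residues_eq_univ _ _ p hp) trivial trivial
      (fun AB hAB ↦ by
        rw [mem_residueFamily_S₁'Trunc_iff] at hAB ⊢
        exact ⟨(isInHeightFamily_negB AB).mpr hAB.1, hAB.2.negB hAB.1⟩)
  have hfilter : ∀ X : ℕ, (heightFamilyBelow X).filter (residueFamily (K + 2) (S₁'Trunc K)).Mem =
      (heightFamilyBelow X).filter (S₁'Trunc K) := fun X ↦
    Finset.filter_congr fun AB hAB ↦ by
      rw [mem_residueFamily_S₁'Trunc_iff]
      exact ⟨fun h ↦ h.2, fun h ↦ ⟨((mem_heightFamilyBelow_iff AB X).mp hAB).1, h⟩⟩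
  refine ⟨U, fun AB hAB ↦ ((mem_residueFamily_S₁'Trunc_iff K AB).mp (hUF AB hAB)).2, hUneg, hflip,
    fun η hη ↦ ?_⟩
  exact (hdens η hη).mono fun X hX ↦ by rw [← hfilter X]; exact hX

/-- **The binders `hU₀R`, `hU₀`, `hU₀flip`, `hκU₀` for `R := T₅Trunc K` (`K ≥ 8`), from A328** applied
to the large, twist-stable congruence family `R_K` (below `tateUniformization_points`;
`T₅Trunc_negB_iff`). [cite: BhargavaSkinnerZhang2014, Thm. 16 and proof of Cor. 26 (pp. 11–12)] -/
theorem exists_twistSubfamily_T₅Trunc (h16 : thm16_exists_rootNumber_twist_subfamily_of_twistStable)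
    (hTate : tateUniformization_points) {K : ℕ} (hK : 8 ≤ K) :
    ∃ U₀ : ℤ × ℤ → Prop,
      (∀ AB, U₀ AB → T₅Trunc K AB) ∧ (∀ AB, U₀ AB → U₀ (negB AB)) ∧
      (∀ AB, U₀ AB → (shortWeierstrass (negB AB)).rootNumber = -(shortWeierstrass AB).rootNumber) ∧
      ∀ η : ℝ, 0 < η → ∀ᶠ X : ℕ in atTop,
        (0.5501 - η) * ((heightFamilyBelow X).filter (T₅Trunc K)).card ≤
          ((heightFamilyBelow X).filter U₀).card := by
  haveI : Fact (Nat.Prime 5) := ⟨Nat.prime_five⟩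
  obtain ⟨U, hUF, hUneg, hflip, hdens⟩ :=
    thm16_exists_rootNumber_twist_subfamily_of_twistStable.exists_subfamily h16
      (residueFamily (K + 2) (T₅Trunc K)) (isLarge_residueFamily_T₅Trunc hTate hK)
      (fun p _ hp ↦ residueFamily_residues_eq_univ _ _ p hp) trivial trivial
      (fun AB hAB ↦ by
        rw [mem_residueFamily_T₅Trunc_iff hTate] at hAB ⊢
        exact ⟨(isInHeightFamily_negB AB).mpr hAB.1, (T₅Trunc_negB_iff hAB.1).mpr hAB.2⟩)
  have hfilter : ∀ X : ℕ, (heightFamilyBelow X).filter (residueFamily (K + 2) (T₅Trunc K)).Mem =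
      (heightFamilyBelow X).filter (T₅Trunc K) := fun X ↦
    Finset.filter_congr fun AB hAB ↦ by
      rw [mem_residueFamily_T₅Trunc_iff hTate]
      exact ⟨fun h ↦ h.2, fun h ↦ ⟨((mem_heightFamilyBelow_iff AB X).mp hAB).1, h⟩⟩
  refine ⟨U, fun AB hAB ↦ ((mem_residueFamily_T₅Trunc_iff hTate K AB).mp (hUF AB hAB)).2, hUneg,
    hflip, fun η hη ↦ ?_⟩
  exact (hdens η hη).mono fun X hX ↦ by rw [← hfilter X]; exact hX

/-! ### … and on the FULL pieces `T = S₁'(5)`, `R = T₅`, with relative density `≥ .5501 - 10⁻⁶` -/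

/-- Relative-density transfer from a truncation to the full piece (real arithmetic): if `U` has
relative count `≥ κ - η/2` in `T_K`, `#T - #tail ≤ #T_K` and `κ·#tail ≤ a·#T`, then `U` has
relative count `≥ κ - a - η` in `T`. [folklore] -/
private theorem rel_transfer {κ η a t tk tl u : ℝ} (hη : 0 < η) (ha : 0 ≤ a) (hu0 : 0 ≤ u)
    (ht0 : 0 ≤ t) (htl0 : 0 ≤ tl) (hkey : (κ - η / 2) * tk ≤ u) (hTK : t - tl ≤ tk)
    (htl : κ * tl ≤ a * t) : (κ - a - η) * t ≤ u := by
  by_cases hk : 0 ≤ κ - η / 2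
  · have h1 := mul_le_mul_of_nonneg_left hTK hk
    have h2 : 0 ≤ η / 2 * tl := by positivity
    have h3 : 0 ≤ η / 2 * t := by positivity
    nlinarith
  · have : (κ - a - η) * t ≤ 0 := mul_nonpos_of_nonpos_of_nonneg (by linarith) ht0
    linarith

/-- The tail density for `K = 16`: `τ₁₆ = (4/25)(1-5⁻¹⁰)⁻¹·5⁻¹⁶ ≤ 1.1·10⁻¹²` (small against
`μ(T₅) = 2.05·10⁻⁵`). [cite: BhargavaSkinnerZhang2014, Cor. 26 (proof, pp. 11–12: truncation allowances)] -/
private theorem mult_tail_density_sixteen_le :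
    ((5 ^ (16 + 1) * (2 * 5) : ℕ) : ℝ) / ((5 : ℝ) ^ (16 + 2)) ^ 2 / (1 - 1 / (5 : ℝ) ^ 10) +
        ((5 ^ (16 + 1) * (2 * 5) : ℕ) : ℝ) / ((5 : ℝ) ^ (16 + 2)) ^ 2 / (1 - 1 / (5 : ℝ) ^ 10) ≤
      11 / 10000000000000 := by
  norm_num

/-- **The binders `hUT`, `hU`, `hUflip` and `hκU` WITH `κ = .5501 - 10⁻⁶` of the parametrised assembly
`heightDensityGE_satisfiesBSDRankLeOne_of_resPieces`, for the FULL piece `T := Pieces.S₁'`, from A328**: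
the twist subfamily `U ⊆ T₉ ⊆ T` of `exists_twistSubfamily_S₁'Trunc` has relative count `≥ .5501 - η`
in `T₉`, and `T ∖ T₉` lies in the multiplicative tail of density `≤ 10⁻⁷` (`mult_tail_density_le_of_nine_le`)
against `μ(S₁') = .7838…` (`hT_pieces`), whence relative count `≥ .5501 - 10⁻⁶ - η` in `T`. (`S₁'(5)`
itself is not a congruence family, so A328 is not applied to it directly.)
[cite: BhargavaSkinnerZhang2014, Thm. 16 (§2.4) and proof of Cor. 26 (p. 11: F′ ⊂ S₀(5) ∩ S₁′(5), κ ≥ .5501)] -/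
theorem exists_twistSubfamily_S₁' (h16 : thm16_exists_rootNumber_twist_subfamily_of_twistStable) :
    ∃ U : ℤ × ℤ → Prop,
      (∀ AB, U AB → S₁' AB) ∧ (∀ AB, U AB → U (negB AB)) ∧
      (∀ AB, U AB → (shortWeierstrass (negB AB)).rootNumber = -(shortWeierstrass AB).rootNumber) ∧
      ∀ η : ℝ, 0 < η → ∀ᶠ X : ℕ in atTop,
        (0.5501 - 1 / 1000000 - η) * ((heightFamilyBelow X).filter S₁').card ≤
          ((heightFamilyBelow X).filter U).card := by
  haveI : Fact (Nat.Prime 5) := ⟨Nat.prime_five⟩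
  obtain ⟨U, hUT, hUneg, hflip, hdens⟩ := exists_twistSubfamily_S₁'Trunc h16 9
  refine ⟨U, fun AB h ↦ (hUT AB h).1, hUneg, hflip, fun η hη ↦ ?_⟩
  have hτ := mult_tail_density_le_of_nine_le (le_refl 9)
  have E1 := hdens (η / 2) (by linarith)
  have E2 := eventually_card_le_mul' (hasHeightDensity_mult_tail_five (K := 9) (by norm_num))
    (1 / 10000000) (by norm_num)
  have E3 := hT_pieces (747265625 / 953369043 / 2) (by norm_num)
  filter_upwards [E1, E2, E3] with X h1 h2 h3
  set tl := ((heightFamilyBelow X).filter (fun AB : ℤ × ℤ ↦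
    ((AB.1 : ZMod 5) = 2 ∨ (AB.1 : ZMod 5) = 3) ∧ (5 : ℤ) ^ (9 + 1) ∣ 4 * AB.1 ^ 3 + 27 * AB.2 ^ 2))
    with htl_def
  have h2' : (tl.card : ℝ) ≤ (((5 ^ (9 + 1) * (2 * 5) : ℕ) : ℝ) / ((5 : ℝ) ^ (9 + 2)) ^ 2 /
      (1 - 1 / (5 : ℝ) ^ 10) + ((5 ^ (9 + 1) * (2 * 5) : ℕ) : ℝ) / ((5 : ℝ) ^ (9 + 2)) ^ 2 /
      (1 - 1 / (5 : ℝ) ^ 10) + 1 / 10000000) * (heightFamilyBelow X).card := by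
    convert h2 using 4
  have hN : (0 : ℝ) ≤ (heightFamilyBelow X).card := Nat.cast_nonneg _
  have hτN := mul_le_mul_of_nonneg_right hτ hN
  -- `T ⊆ T₉ ∪ tail₉`, `T₉ ⊆ T`
  have hsub : (heightFamilyBelow X).filter S₁' ⊆ (heightFamilyBelow X).filter (S₁'Trunc 9) ∪ tl := by
    intro AB hAB
    rw [Finset.mem_filter] at hAB
    rw [Finset.mem_union, htl_def, Finset.mem_filter, Finset.mem_filter]
    have hfam : IsInHeightFamily AB := ((mem_heightFamilyBelow_iff AB X).mp hAB.1).1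
    by_cases hvK : padicValInt 5 (4 * AB.1 ^ 3 + 27 * AB.2 ^ 2) ≤ 9
    · exact Or.inl ⟨hAB.1, hAB.2, hvK⟩
    · exact Or.inr ⟨hAB.1, tail_of_lt_padicValInt hfam hAB.2.1 (by omega)⟩
  have hTK : (((heightFamilyBelow X).filter S₁').card : ℝ) - tl.card ≤
      ((heightFamilyBelow X).filter (S₁'Trunc 9)).card := by
    have := (Finset.card_le_card hsub).trans (Finset.card_union_le _ _)
    have h' : (((heightFamilyBelow X).filter S₁').card : ℝ) ≤
        ((heightFamilyBelow X).filter (S₁'Trunc 9)).card + tl.card := by exact_mod_cast this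
    linarith
  refine rel_transfer hη (by norm_num) (Nat.cast_nonneg _) (Nat.cast_nonneg _) (Nat.cast_nonneg _)
    h1 hTK ?_
  -- `.5501·#tail ≤ 10⁻⁶·#T`: `#tail ≤ 2·10⁻⁷·N`, `N ≤ (2/μ(S₁'))·#T`
  nlinarith

/-- **The binders `hU₀R`, `hU₀`, `hU₀flip` and `hκU₀` WITH `κ = .5501 - 10⁻⁶`, for the FULL piece
`R := Pieces.T₅`, from A328** (below `tateUniformization_points`): as `exists_twistSubfamily_S₁'`, with
the truncation `R₁₆` (tail density `≤ 1.1·10⁻¹²` against `μ(T₅) = 2.05·10⁻⁵`, `hR_pieces`).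
[cite: BhargavaSkinnerZhang2014, Thm. 16 and proof of Cor. 26 (pp. 11–12)] -/
theorem exists_twistSubfamily_T₅ (h16 : thm16_exists_rootNumber_twist_subfamily_of_twistStable)
    (hTate : tateUniformization_points) :
    ∃ U₀ : ℤ × ℤ → Prop,
      (∀ AB, U₀ AB → T₅ AB) ∧ (∀ AB, U₀ AB → U₀ (negB AB)) ∧
      (∀ AB, U₀ AB → (shortWeierstrass (negB AB)).rootNumber = -(shortWeierstrass AB).rootNumber) ∧
      ∀ η : ℝ, 0 < η → ∀ᶠ X : ℕ in atTop,
        (0.5501 - 1 / 1000000 - η) * ((heightFamilyBelow X).filter T₅).card ≤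
          ((heightFamilyBelow X).filter U₀).card := by
  haveI : Fact (Nat.Prime 5) := ⟨Nat.prime_five⟩
  obtain ⟨U, hUR, hUneg, hflip, hdens⟩ := exists_twistSubfamily_T₅Trunc h16 hTate (K := 16) (by norm_num)
  refine ⟨U, fun AB h ↦ (hUR AB h).1, hUneg, hflip, fun η hη ↦ ?_⟩
  have hτ := mult_tail_density_sixteen_le
  have E1 := hdens (η / 2) (by linarith)
  have E2 := eventually_card_le_mul' (hasHeightDensity_mult_tail_five (K := 16) (by norm_num))
    (1 / 1000000000000) (by norm_num)
  have E3 := hR_pieces hTate (78125 / 3813476172 / 2) (by norm_num)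
  filter_upwards [E1, E2, E3] with X h1 h2 h3
  set tl := ((heightFamilyBelow X).filter (fun AB : ℤ × ℤ ↦
    ((AB.1 : ZMod 5) = 2 ∨ (AB.1 : ZMod 5) = 3) ∧ (5 : ℤ) ^ (16 + 1) ∣ 4 * AB.1 ^ 3 + 27 * AB.2 ^ 2))
    with htl_def
  have h2' : (tl.card : ℝ) ≤ (((5 ^ (16 + 1) * (2 * 5) : ℕ) : ℝ) / ((5 : ℝ) ^ (16 + 2)) ^ 2 /
      (1 - 1 / (5 : ℝ) ^ 10) + ((5 ^ (16 + 1) * (2 * 5) : ℕ) : ℝ) / ((5 : ℝ) ^ (16 + 2)) ^ 2 /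
      (1 - 1 / (5 : ℝ) ^ 10) + 1 / 1000000000000) * (heightFamilyBelow X).card := by
    convert h2 using 4
  have hN : (0 : ℝ) ≤ (heightFamilyBelow X).card := Nat.cast_nonneg _
  have hτN := mul_le_mul_of_nonneg_right hτ hN
  have hsub : (heightFamilyBelow X).filter T₅ ⊆ (heightFamilyBelow X).filter (T₅Trunc 16) ∪ tl := by
    intro AB hAB
    rw [Finset.mem_filter] at hAB
    rw [Finset.mem_union, htl_def, Finset.mem_filter, Finset.mem_filter]
    have hfam : IsInHeightFamily AB := ((mem_heightFamilyBelow_iff AB X).mp hAB.1).1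
    by_cases hvK : padicValInt 5 (4 * AB.1 ^ 3 + 27 * AB.2 ^ 2) ≤ 16
    · exact Or.inl ⟨hAB.1, hAB.2, hvK⟩
    · exact Or.inr ⟨hAB.1, tail_of_lt_padicValInt hfam hAB.2.1 (by omega)⟩
  have hTK : (((heightFamilyBelow X).filter T₅).card : ℝ) - tl.card ≤
      ((heightFamilyBelow X).filter (T₅Trunc 16)).card := by
    have := (Finset.card_le_card hsub).trans (Finset.card_union_le _ _)
    have h' : (((heightFamilyBelow X).filter T₅).card : ℝ) ≤
        ((heightFamilyBelow X).filter (T₅Trunc 16)).card + tl.card := by exact_mod_cast this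
    linarith
  refine rel_transfer hη (by norm_num) (Nat.cast_nonneg _) (Nat.cast_nonneg _) (Nat.cast_nonneg _)
    h1 hTK ?_
  nlinarith

/-- **`h13` on `R_K = T₅Trunc K` from A330** (`K ≥ 8`, below `tateUniformization_points`): for every
`η > 0`, eventually `Σ_{E ∈ R_K, H < X} #Sel₅(E) ≤ (6 + η)·#{E ∈ R_K, H < X}` — A330 on the large family
`residueFamily (K+2) (T₅Trunc K)`. (Not a binder of `bsz_rankLeOne_cRank_of_pieces`, which wants the
average on the twist subfamily `U₀ ⊆ R` (`h13U₀`, cell book G2); offered to the assembler as the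
available substitute: with `U₀ ⊆ R_K` of relative density `κ`, `Σ_{U₀} #Sel₅ ≤ ((5 + η)/κ + 1)·#U₀`.)
[cite: BhargavaShankar5Selmer2013, Thm 31] [cite: BhargavaSkinnerZhang2014, Cor. 26 (proof, p. 12)] -/
theorem h13R_trunc (h31 : thm31_heightAverageOn_card_selmerFive_le_six)
    (hTate : tateUniformization_points) {K : ℕ} (hK : 8 ≤ K) :
    ∀ η : ℝ, 0 < η → ∀ᶠ X : ℕ in atTop,
      ∑ AB ∈ (heightFamilyBelow X).filter (T₅Trunc K),
          (Nat.card ((shortWeierstrass AB).selmerGroup 5) : ℝ) ≤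
        (6 + η) * ((heightFamilyBelow X).filter (T₅Trunc K)).card := by
  have h := thm31_heightAverageOn_card_selmerFive_le_six.sum_card_selmerFive_le h31
    (residueFamily (K + 2) (T₅Trunc K)) (isLarge_residueFamily_T₅Trunc hTate hK)
  have hfilter : ∀ X : ℕ, (heightFamilyBelow X).filter (residueFamily (K + 2) (T₅Trunc K)).Mem =
      (heightFamilyBelow X).filter (T₅Trunc K) := fun X ↦
    Finset.filter_congr fun AB hAB ↦ by
      rw [mem_residueFamily_T₅Trunc_iff hTate]
      exact ⟨fun h ↦ h.2, fun h ↦ ⟨((mem_heightFamilyBelow_iff AB X).mp hAB).1, h⟩⟩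
  intro η hη
  exact (h η hη).mono fun X hX ↦ by rw [← hfilter X]; exact hX

/-! ### `h13U₀` together with `hU₀` / `hU₀flip` / `hκU₀`, from the SHARPENED A328 (A331: disjoint pieces) and A330 -/

/-- **The binders `hU₀R`, `hU₀`, `hU₀flip`, `hκU₀` AND `h13U₀` of `bsz_rankLeOne_cRank_of_pieces` for
`R := T₅Trunc K` (`K ≥ 8`; below `tateUniformization_points`)**, from the sharpened fact A331
(`thm16_exists_disjoint_rootNumber_twist_subfamily_of_twistStable`: the twist subfamily is a finite
union of PAIRWISE DISJOINT large congruence families, [BS5] §5 as constructed) on the large twist-stable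
family `R_K`, and A330 on that disjoint union (`sum_card_selmerFive_le_of_disjoint`) — the SAME `U₀`
carries the relative density and the `5`-Selmer average (cell book G2).
[cite: BhargavaSkinnerZhang2014, Thm. 16 and proof of Cor. 26 (pp. 11–12)] [cite: BhargavaShankar5Selmer2013, Thm 31 and §5] -/
theorem exists_twistSubfamily_T₅Trunc_sum_le
    (h16d : thm16_exists_disjoint_rootNumber_twist_subfamily_of_twistStable)
    (h31 : thm31_heightAverageOn_card_selmerFive_le_six) (hTate : tateUniformization_points) {K : ℕ}
    (hK : 8 ≤ K) :
    ∃ U₀ : ℤ × ℤ → Prop,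
      (∀ AB, U₀ AB → T₅Trunc K AB) ∧ (∀ AB, U₀ AB → U₀ (negB AB)) ∧
      (∀ AB, U₀ AB → (shortWeierstrass (negB AB)).rootNumber = -(shortWeierstrass AB).rootNumber) ∧
      (∀ η : ℝ, 0 < η → ∀ᶠ X : ℕ in atTop,
        (0.5501 - η) * ((heightFamilyBelow X).filter (T₅Trunc K)).card ≤
          ((heightFamilyBelow X).filter U₀).card) ∧
      ∀ η : ℝ, 0 < η → ∀ᶠ X : ℕ in atTop,
        ∑ AB ∈ (heightFamilyBelow X).filter U₀,
            (Nat.card ((shortWeierstrass AB).selmerGroup 5) : ℝ) ≤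
          (6 + η) * ((heightFamilyBelow X).filter U₀).card := by
  haveI : Fact (Nat.Prime 5) := ⟨Nat.prime_five⟩
  obtain ⟨n, G, U, hL, hdisj, hU, hUF, hUneg, hflip, hdens⟩ :=
    thm16_exists_disjoint_rootNumber_twist_subfamily_of_twistStable.exists_disjoint_subfamily h16d
      (residueFamily (K + 2) (T₅Trunc K)) (isLarge_residueFamily_T₅Trunc hTate hK)
      (fun p _ hp ↦ residueFamily_residues_eq_univ _ _ p hp) trivial trivial
      (fun AB hAB ↦ by
        rw [mem_residueFamily_T₅Trunc_iff hTate] at hAB ⊢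
        exact ⟨(isInHeightFamily_negB AB).mpr hAB.1, (T₅Trunc_negB_iff hAB.1).mpr hAB.2⟩)
  have hfilter : ∀ X : ℕ, (heightFamilyBelow X).filter (residueFamily (K + 2) (T₅Trunc K)).Mem =
      (heightFamilyBelow X).filter (T₅Trunc K) := fun X ↦
    Finset.filter_congr fun AB hAB ↦ by
      rw [mem_residueFamily_T₅Trunc_iff hTate]
      exact ⟨fun h ↦ h.2, fun h ↦ ⟨((mem_heightFamilyBelow_iff AB X).mp hAB).1, h⟩⟩
  refine ⟨U, fun AB hAB ↦ ((mem_residueFamily_T₅Trunc_iff hTate K AB).mp (hUF AB hAB)).2, hUneg,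
    hflip, fun η hη ↦ ?_,
    thm31_heightAverageOn_card_selmerFive_le_six.sum_card_selmerFive_le_of_disjoint h31 G hL hdisj U hU⟩
  exact (hdens η hη).mono fun X hX ↦ by rw [← hfilter X]; exact hX

/-- **The same five binders for the FULL piece `R := Pieces.T₅` with `κ = .5501 - 10⁻⁶`** (for the
parametrised assembly), from A331 + A330, below `tateUniformization_points`: `U₀ ⊆ R₁₆ ⊆ R` as in
`exists_twistSubfamily_T₅`, and the `5`-Selmer average on `U₀` from the disjoint pieces.
[cite: BhargavaSkinnerZhang2014, Thm. 16 and proof of Cor. 26 (pp. 11–12)] [cite: BhargavaShankar5Selmer2013, Thm 31 and §5] -/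
theorem exists_twistSubfamily_T₅_sum_le
    (h16d : thm16_exists_disjoint_rootNumber_twist_subfamily_of_twistStable)
    (h31 : thm31_heightAverageOn_card_selmerFive_le_six) (hTate : tateUniformization_points) :
    ∃ U₀ : ℤ × ℤ → Prop,
      (∀ AB, U₀ AB → T₅ AB) ∧ (∀ AB, U₀ AB → U₀ (negB AB)) ∧
      (∀ AB, U₀ AB → (shortWeierstrass (negB AB)).rootNumber = -(shortWeierstrass AB).rootNumber) ∧
      (∀ η : ℝ, 0 < η → ∀ᶠ X : ℕ in atTop,
        (0.5501 - 1 / 1000000 - η) * ((heightFamilyBelow X).filter T₅).card ≤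
          ((heightFamilyBelow X).filter U₀).card) ∧
      ∀ η : ℝ, 0 < η → ∀ᶠ X : ℕ in atTop,
        ∑ AB ∈ (heightFamilyBelow X).filter U₀,
            (Nat.card ((shortWeierstrass AB).selmerGroup 5) : ℝ) ≤
          (6 + η) * ((heightFamilyBelow X).filter U₀).card := by
  haveI : Fact (Nat.Prime 5) := ⟨Nat.prime_five⟩
  obtain ⟨U, hUR, hUneg, hflip, hdens, h13⟩ :=
    exists_twistSubfamily_T₅Trunc_sum_le h16d h31 hTate (K := 16) (by norm_num)
  refine ⟨U, fun AB h ↦ (hUR AB h).1, hUneg, hflip, fun η hη ↦ ?_, h13⟩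
  have hτ := mult_tail_density_sixteen_le
  have E1 := hdens (η / 2) (by linarith)
  have E2 := eventually_card_le_mul' (hasHeightDensity_mult_tail_five (K := 16) (by norm_num))
    (1 / 1000000000000) (by norm_num)
  have E3 := hR_pieces hTate (78125 / 3813476172 / 2) (by norm_num)
  filter_upwards [E1, E2, E3] with X h1 h2 h3
  set tl := ((heightFamilyBelow X).filter (fun AB : ℤ × ℤ ↦
    ((AB.1 : ZMod 5) = 2 ∨ (AB.1 : ZMod 5) = 3) ∧ (5 : ℤ) ^ (16 + 1) ∣ 4 * AB.1 ^ 3 + 27 * AB.2 ^ 2))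
    with htl_def
  have h2' : (tl.card : ℝ) ≤ (((5 ^ (16 + 1) * (2 * 5) : ℕ) : ℝ) / ((5 : ℝ) ^ (16 + 2)) ^ 2 /
      (1 - 1 / (5 : ℝ) ^ 10) + ((5 ^ (16 + 1) * (2 * 5) : ℕ) : ℝ) / ((5 : ℝ) ^ (16 + 2)) ^ 2 /
      (1 - 1 / (5 : ℝ) ^ 10) + 1 / 1000000000000) * (heightFamilyBelow X).card := by
    convert h2 using 4
  have hN : (0 : ℝ) ≤ (heightFamilyBelow X).card := Nat.cast_nonneg _
  have hτN := mul_le_mul_of_nonneg_right hτ hN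
  have hsub : (heightFamilyBelow X).filter T₅ ⊆ (heightFamilyBelow X).filter (T₅Trunc 16) ∪ tl := by
    intro AB hAB
    rw [Finset.mem_filter] at hAB
    rw [Finset.mem_union, htl_def, Finset.mem_filter, Finset.mem_filter]
    have hfam : IsInHeightFamily AB := ((mem_heightFamilyBelow_iff AB X).mp hAB.1).1
    by_cases hvK : padicValInt 5 (4 * AB.1 ^ 3 + 27 * AB.2 ^ 2) ≤ 16
    · exact Or.inl ⟨hAB.1, hAB.2, hvK⟩
    · exact Or.inr ⟨hAB.1, tail_of_lt_padicValInt hfam hAB.2.1 (by omega)⟩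
  have hTK : (((heightFamilyBelow X).filter T₅).card : ℝ) - tl.card ≤
      ((heightFamilyBelow X).filter (T₅Trunc 16)).card := by
    have := (Finset.card_le_card hsub).trans (Finset.card_union_le _ _)
    have h' : (((heightFamilyBelow X).filter T₅).card : ℝ) ≤
        ((heightFamilyBelow X).filter (T₅Trunc 16)).card + tl.card := by exact_mod_cast this
    linarith
  refine rel_transfer hη (by norm_num) (Nat.cast_nonneg _) (Nat.cast_nonneg _) (Nat.cast_nonneg _)
    h1 hTK ?_
  nlinarith

/-! ### The binder `hlocP` on `P = SP'_K` from A329 (+ A330), below `tateUniformization_points` -/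

/-- **The binder `hlocP` of `bsz_rankLeOne_cRank_of_pieces` for `P := Pieces.SP' K` and
`Z := Pieces.Z v` (`v ∋ 5`), from the named facts A329 (Bhargava–Skinner Thm 7 (ii) / Thm 9,
`thm7_selmerResKer_equidistributed`) and A330 (the `5`-Selmer average, as A329's `h31` input), below
`tateUniformization_points`**: for every `η > 0`, eventually
`Σ_{E ∈ SP'_K, H < X} (#Z(E) - 1) ≤ (1 + η)·#{E ∈ SP'_K, H < X}`. Assembly: `SP'_K` is the finite
`5`-adic condition set `exists_residues_SP'` (its `R`, `hRa`, `hRΔ`, `m = K + 2`); on it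
`E(ℚ₅)[5] = 0` (`SP'.locallyTorsionFree`, in `ℚ_[5]`-currency) transported to the completion `ℚ_v`
(`natCard_ker_nsmul_adicCompletion_eq_one_of_forall_padic`) is A329's `htors`; then
`thm7_selmerResKer_equidistributed.sum_card_selmerResKer_sub_one_le_residues_of_avg`.
[cite: BhargavaSkinner2014, Thm 7 (ii), Thm 9, Prop 12 and proof of Lemma 16] [cite: BhargavaShankar5Selmer2013, Thm 31] -/
theorem hlocP_pieces (h7 : thm7_selmerResKer_equidistributed)
    (h31 : thm31_heightAverageOn_card_selmerFive_le_six) (hTate : tateUniformization_points) (K : ℕ)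
    {v : HeightOneSpectrum (𝓞 ℚ)} (hv : ((5 : ℕ) : 𝓞 ℚ) ∈ v.asIdeal) :
    ∀ η : ℝ, 0 < η → ∀ᶠ X : ℕ in atTop,
      ∑ AB ∈ (heightFamilyBelow X).filter (SP' K), ((Nat.card (Z v AB) : ℝ) - 1) ≤
        (1 + η) * ((heightFamilyBelow X).filter (SP' K)).card := by
  haveI : Fact (Nat.Prime 5) := ⟨Nat.prime_five⟩
  obtain ⟨R, hR, hRa, hRΔ⟩ := exists_residues_SP' hTate K
  have htors : ∀ AB : ℤ × ℤ, IsInHeightFamily AB →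
      (((AB.1 : ℤ) : ZMod (5 ^ (K + 2))), ((AB.2 : ℤ) : ZMod (5 ^ (K + 2)))) ∈ R →
      Nat.card (nsmulAddMonoidHom 5 :
        ((shortWeierstrass AB).baseChange (v.adicCompletion ℚ)).toAffine.Point →+ _).ker = 1 :=
    fun AB hfam hres ↦
      (shortWeierstrass AB).natCard_ker_nsmul_adicCompletion_eq_one_of_forall_padic hv
        ((hR AB hfam).mpr hres).locallyTorsionFree
  have h := h7.sum_card_selmerResKer_sub_one_le_residues_of_avg hv R hRa hRΔ htors h31
  have hfilter : ∀ X : ℕ, (heightFamilyBelow X).filter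
      (fun AB : ℤ × ℤ ↦ (((AB.1 : ℤ) : ZMod (5 ^ (K + 2))), ((AB.2 : ℤ) : ZMod (5 ^ (K + 2)))) ∈ R) =
      (heightFamilyBelow X).filter (SP' K) := fun X ↦
    Finset.filter_congr fun AB hAB ↦ (hR AB ((mem_heightFamilyBelow_iff AB X).mp hAB).1).symm
  intro η hη
  exact (h η hη).mono fun X hX ↦ by rw [← hfilter X]; exact hX

/-! ### The density side of the parametrised assembly, FULL instantiation, in one theorem -/

/-- **Every density-side binder of `heightDensityGE_satisfiesBSDRankLeOne_of_resPieces` for the FULL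
instantiation `T := Pieces.S₁'`, `R := Pieces.T₅`, `P := Pieces.SP' K` (`K ≥ 8`), `W := Pieces.W₅`,
`Z := Pieces.Z v`, with `μT = 747265625/953369043`, `μR = 78125/3813476172`,
`μP = 20546875/1271158724 - 10⁻⁶`, `κ = .5501 - 10⁻⁶`** — granted the named facts
`tateUniformization_points` (A230), Duke 1997, A331 (⇒ A328), A329, A330: the twist subfamilies `U ⊆ T`,
`U₀ ⊆ R` and the statements `hUT hU hUflip hU₀R hU₀ hU₀flip h13T h13U₀ hlocP hT hκU hR hκU₀ hPd hW`, in
this order (the structural binders are in `Pieces.lean`; `hν` is the tree's `bsz_mu_diff_inter_le`; the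
class theorems `h5 h9 hker hKim hWtors` and `hGZK hDD` are not density statements). With these values
`(19/24 + κ/12)·μT + 3/8·κ·μR + 3/4·μP - 10⁻⁵ - c_rank = 8.51…·10⁻⁷ > 0` for
`c_rank = 3059480216411717/4576171406400000` (cell book `cells/density/C0-SPEC.md`, G11).
[cite: BhargavaSkinnerZhang2014, Lemma 18, Thm. 16, Lemma 20 and proof of Cor. 26 (pp. 8–12)]
[cite: BhargavaSkinner2014, Thm 7 (ii) and proof of Lemma 16] [cite: BhargavaShankar5Selmer2013, Thm 31 and §5] -/
theorem densitySide (hTate : tateUniformization_points) (hD : Duke1997_exceptionalPrimes_densityZero)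
    (h16d : thm16_exists_disjoint_rootNumber_twist_subfamily_of_twistStable)
    (h7 : thm7_selmerResKer_equidistributed) (h31 : thm31_heightAverageOn_card_selmerFive_le_six)
    {K : ℕ} (hK : 8 ≤ K) {v : HeightOneSpectrum (𝓞 ℚ)} (hv : ((5 : ℕ) : 𝓞 ℚ) ∈ v.asIdeal) :
    ∃ U U₀ : ℤ × ℤ → Prop,
      (∀ AB, U AB → S₁' AB) ∧ (∀ AB, U AB → U (negB AB)) ∧
      (∀ AB, U AB → (shortWeierstrass (negB AB)).rootNumber = -(shortWeierstrass AB).rootNumber) ∧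
      (∀ AB, U₀ AB → T₅ AB) ∧ (∀ AB, U₀ AB → U₀ (negB AB)) ∧
      (∀ AB, U₀ AB → (shortWeierstrass (negB AB)).rootNumber = -(shortWeierstrass AB).rootNumber) ∧
      (∀ η : ℝ, 0 < η → ∀ᶠ X : ℕ in atTop,
        ∑ AB ∈ (heightFamilyBelow X).filter S₁',
            (Nat.card ((shortWeierstrass AB).selmerGroup 5) : ℝ) ≤
          (6 + η) * ((heightFamilyBelow X).filter S₁').card) ∧
      (∀ η : ℝ, 0 < η → ∀ᶠ X : ℕ in atTop,
        ∑ AB ∈ (heightFamilyBelow X).filter U₀,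
            (Nat.card ((shortWeierstrass AB).selmerGroup 5) : ℝ) ≤
          (6 + η) * ((heightFamilyBelow X).filter U₀).card) ∧
      (∀ η : ℝ, 0 < η → ∀ᶠ X : ℕ in atTop,
        ∑ AB ∈ (heightFamilyBelow X).filter (SP' K), ((Nat.card (Z v AB) : ℝ) - 1) ≤
          (1 + η) * ((heightFamilyBelow X).filter (SP' K)).card) ∧
      (∀ η : ℝ, 0 < η → ∀ᶠ X : ℕ in atTop,
        (747265625 / 953369043 - η) * (heightFamilyBelow X).card ≤
          ((heightFamilyBelow X).filter S₁').card) ∧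
      (∀ η : ℝ, 0 < η → ∀ᶠ X : ℕ in atTop,
        (0.5501 - 1 / 1000000 - η) * ((heightFamilyBelow X).filter S₁').card ≤
          ((heightFamilyBelow X).filter U).card) ∧
      (∀ η : ℝ, 0 < η → ∀ᶠ X : ℕ in atTop,
        (78125 / 3813476172 - η) * (heightFamilyBelow X).card ≤
          ((heightFamilyBelow X).filter T₅).card) ∧
      (∀ η : ℝ, 0 < η → ∀ᶠ X : ℕ in atTop,
        (0.5501 - 1 / 1000000 - η) * ((heightFamilyBelow X).filter T₅).card ≤
          ((heightFamilyBelow X).filter U₀).card) ∧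
      (∀ η : ℝ, 0 < η → ∀ᶠ X : ℕ in atTop,
        (20546875 / 1271158724 - 1 / 1000000 - η) * (heightFamilyBelow X).card ≤
          ((heightFamilyBelow X).filter (SP' K)).card) ∧
      (∀ η : ℝ, 0 < η → ∀ᶠ X : ℕ in atTop,
        (((heightFamilyBelow X).filter (fun AB ↦ ¬ W₅ AB)).card : ℝ) ≤
          η * (heightFamilyBelow X).card) := by
  obtain ⟨U, hUT, hUneg, hUflip, hκU⟩ := exists_twistSubfamily_S₁' h16d.to_thm16
  obtain ⟨U₀, hU₀R, hU₀neg, hU₀flip, hκU₀, h13U₀⟩ := exists_twistSubfamily_T₅_sum_le h16d h31 hTate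
  exact ⟨U, U₀, hUT, hUneg, hUflip, hU₀R, hU₀neg, hU₀flip, h13T_pieces h31, h13U₀,
    hlocP_pieces h7 h31 hTate K hv, hT_pieces, hκU, hR_pieces hTate, hκU₀, hPd_pieces hTate hK,
    hW_pieces hD⟩


/-! ### The capstone of the density side: `bsz_rankLeOne_cRank_of_pieces` on the pieces, every
group-(B) binder discharged (FULL instantiation), modulo the class theorems and the named facts -/

/-- The binder `hν` on `T := S₁'`, `S₁ := S₁Cond`: BSZ display (2) (`μ(S₁′(5)) − μ(S₁(5)) ≤ .00001`) in
the tree's kernel form `bsz_mu_diff_inter_le` (`LeadingTermBSZMuDiffProofs`), its predicate bridged to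
`S₁Cond` on the height family (`S₁Cond_iff_of_ne_zero`, `4A³ + 27B² ≠ 0` there).
[cite: BhargavaSkinnerZhang2014, §3.2 display (2) (p. 10) and §3.1 (p. 8)] -/
theorem hν_pieces : ∀ η : ℝ, 0 < η → ∀ᶠ X : ℕ in atTop,
    (((heightFamilyBelow X).filter (fun AB ↦ S₁' AB ∧ ¬ S₁Cond AB)).card : ℝ) ≤
      (0.00001 + η) * (heightFamilyBelow X).card := by
  intro η hη
  filter_upwards [bsz_mu_diff_inter_le S₁' η hη] with X hX
  refine le_trans ?_ hX
  exact_mod_cast Finset.card_le_card fun AB hAB ↦ by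
    rw [Finset.mem_filter] at hAB ⊢
    exact ⟨hAB.1, hAB.2.1, fun hall ↦ hAB.2.2
      ((S₁Cond_iff_of_ne_zero ((mem_heightFamilyBelow_iff AB X).1 hAB.1).1.1).2 hall)⟩

/-- **The rank part of BSD at the constant `c_rank = 3059480216411717/4576171406400000 = 0.66856766…`
on Bhargava–Skinner–Zhang's pieces, with the whole DENSITY SIDE discharged.** This is the theorem of
record `bsz_rankLeOne_cRank_of_pieces` (`LeadingTermBSZResCellAssemblyProofs`) — BSZ Cor 26 assembled
with the local-equidistribution piece of Bhargava–Skinner — instantiated on the pieces of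
`BhargavaSkinnerZhang2014/Pieces.lean` (`S₀ := S₀`, `T := S₁'`, `R := T₅`, `P := SP' K` for any
`K ≥ 8`, `S₁ := S₁Cond`, `W := W₅`, `Z := Z v` for the place `v ∋ 5`), in the FULL instantiation
shape (`bsz_rankLeOne_cRank_of_pieces_full`: root-number subfamilies of relative density
`.5501 − 10⁻⁶`), with: the structural binders `hTS₀ … hPR` by `Pieces.trichotomy`'s projections; `hU`,
`hUflip`, `hκU`, `hU₀`, `hU₀flip`, `hκU₀`, `h13T`, `h13U₀`, `hlocP`, `hT`, `hR`, `hPd`, `hW` by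
`densitySide` (from the named facts A331 = [BSZ] Thm 16 / [BS5] §5 as constructed, A329 = [BS14]
Thm 7 (ii) + Prop 12, A330 = [BS5] Thm 31, A230 = Tate's uniformization, Duke 1997 Thm 1, and the
kernel densities `μ(S₁′(5)) = 747265625/953369043`, `μ(T₅) = 78125/3813476172`,
`μ(SP′) = 20546875/1271158724`); `hν` by `hν_pieces` (display (2), kernel). What REMAINS as hypotheses
is exactly the ARITHMETIC of single curves — Gross–Zagier–Kolyvagin `hGZK` (A18), the parity fact `hDD`
(Dokchitser–Dokchitser / BSZ Thm 15), and the five class-theorem binders: `h5` (rank-`0` converse on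
`S₀ ∩ W₅`: BSZ Thm 5 = Skinner–Urban + Skinner 2016 Thm C), `h9` (rank-`1` converse on
`S₁' ∩ S₁Cond ∩ W₅`: BSZ Thm 9 = W. Zhang 2014 Thm 1.4 (i) + Skinner–Zhang Thm 1.1), `hker`
(`#Sel₅ ≤ 5·#Z` on `SP' K`: [BS14] proof of Lemma 16; kernel, `PiecesClassTheoremsProofs.hker_pieces`),
`hKim` (rank-`1` converse under the local condition on `SP' K ∩ W₅`: Kim 2023 Thm 1.1 — ANONYMOUS
binder, cell book G3), `hWtors` (`E(ℚ)[5] = 0` on `W₅`; kernel, `hWtors_pieces`). No density number,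
RESIDUAL-MAP mark, tier or K1 word moves by this theorem; it is bookkeeping between kernel theorems
and named facts. [cite: BhargavaSkinnerZhang2014, Cor 26 (proof, pp. 10–13) with Lemmas 17–20, Thm 16, display (2)]
[cite: BhargavaSkinner2014, Thm 7 (ii), Prop 12 and Lemma 16] [cite: BhargavaShankar5Selmer2013, Thm 31 and §5] -/
theorem heightDensityGE_satisfiesBSDRankLeOne_cRank
    (hGZK : rank_eq_analyticRank_of_analyticRank_le_one)
    (hDD : even_selmerRank_sub_torsionRank_iff)
    (hTate : tateUniformization_points) (hD : Duke1997_exceptionalPrimes_densityZero)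
    (h16d : thm16_exists_disjoint_rootNumber_twist_subfamily_of_twistStable)
    (h7 : thm7_selmerResKer_equidistributed) (h31 : thm31_heightAverageOn_card_selmerFive_le_six)
    {K : ℕ} (hK : 8 ≤ K) {v : HeightOneSpectrum (𝓞 ℚ)} (hv : ((5 : ℕ) : 𝓞 ℚ) ∈ v.asIdeal)
    (h5 : ∀ AB, IsInHeightFamily AB → S₀ AB → W₅ AB →
      Nat.card ((shortWeierstrass AB).selmerGroup 5) = 1 →
        (shortWeierstrass AB).mordellWeilRank = 0 ∧ (shortWeierstrass AB).analyticRank = 0)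
    (h9 : ∀ AB, IsInHeightFamily AB → S₁' AB → S₁Cond AB → W₅ AB →
      Nat.card ((shortWeierstrass AB).selmerGroup 5) = 5 →
        (shortWeierstrass AB).mordellWeilRank = 1 ∧ (shortWeierstrass AB).analyticRank = 1)
    (hker : ∀ AB, IsInHeightFamily AB → SP' K AB →
      Nat.card ((shortWeierstrass AB).selmerGroup 5) ≤ 5 * Nat.card (Z v AB))
    (hKim : ∀ AB, IsInHeightFamily AB → SP' K AB → W₅ AB →
      Nat.card ((shortWeierstrass AB).selmerGroup 5) = 5 → Nat.card (Z v AB) = 1 →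
        (shortWeierstrass AB).mordellWeilRank = 1 ∧ (shortWeierstrass AB).analyticRank = 1)
    (hWtors : ∀ AB, IsInHeightFamily AB → W₅ AB →
      (shortWeierstrass AB).toAffine.Point[(5 : ℤ)] = ⊥) :
    HeightDensityGE SatisfiesBSDRankLeOne (3059480216411717 / 4576171406400000) := by
  obtain ⟨U, U₀, hUT, hU, hUflip, hU₀R, hU₀, hU₀flip, h13T, h13U₀, hlocP, hT, hκU, hR, hκU₀, hPd,
    hW⟩ := densitySide hTate hD h16d h7 h31 hK hv
  exact bsz_rankLeOne_cRank_of_pieces_full hGZK hDD S₀ S₁' U T₅ U₀ (SP' K) S₁Cond W₅ (Z v)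
    (fun _ h ↦ h.s₀) hUT (fun _ h ↦ h.s₀) (fun _ h ↦ h.not_s₁') hU₀R (fun _ h ↦ h.s₀)
    (fun _ h ↦ h.not_s₁') (fun _ h ↦ h.not_t₅) hU hUflip hU₀ hU₀flip h5 h9 hker hKim hWtors h13T
    h13U₀ hlocP hT hκU hR hκU₀ hPd hν_pieces hW

end Literature.NumberTheory.EllipticCurves.BhargavaSkinnerZhang2014.Pieces

end
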